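import Literature.NumberTheory.Sieve.BombieriFriedlanderIwaniecTheorem7StarSwitchModel
import Literature.NumberTheory.Sieve.BombieriFriedlanderIwaniecTheorem7StarSwitchAmbiguous
import HarnessLib

/-!
# Bombieri–Friedlander–Iwaniec 1986, Theorem 7* (§14): the switched pieces of the `q ↔ s` switch

Topic `Literature/NumberTheory/Sieve`; continuation of `…Theorem7StarSwitchModel`,
`…Theorem7StarSwitchCells` and `…Theorem7StarSwitchAmbiguous`.  Everything here is PROVED; no
named fact is introduced.

This file prepares the regime `Q²R > x` of Theorem 7* (BFI §14 p. 246: "If `Q²R > x` then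
`S²R < x`, so we can apply the same method with `q` and `s` interchanged"): the `q`-range is cut
into exact dyadic blocks `(c, 2c]` and `O(log Q)` singletons (`deltaStarSets_Icc_le_halving`), the
small `m`, `n` are set aside (`deltaStarSets_msplit_le`; `lmn > 4|a|D₀` on the remaining pieces),
singleton blocks with large `q₀` are bounded elementarily (`deltaStarSets_singleton_Q_le_elem`),
and for a switched piece each `(r, l)` term is the switched difference plus the model error of
`…SwitchModel` (`abs_setQSum_Ioc_le`); the switched difference is reduced, subdivided into cells
of ratio `1 + 1/D₀` (`bp`, `cell_spread`) and embedded into `Δ*` of the reduced data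
(`…SwitchCells`, `sum_corners4_le_cornerDS`), the ambiguous ranges being reduced to the count `ρ_J`
of `…SwitchAmbiguous` (`ambTotalA_le`, `spread_of_cells`) and to short sums of `1/φ`
(`ambTotalB_le`).  The outcome is `deltaStarSets_piece_le`: `Δ*` of a switched piece is at most
the sum over `(d, g, v, t)` of `termBound` (corner instances of `Δ*`, `∑ ρ_J(K̃)`, `∑ |C_i||C_j| winSum/φ`)
plus the model error.

## References

* E. Bombieri, J. B. Friedlander, H. Iwaniec, *Primes in arithmetic progressions to large moduli*,
  Acta Math. 156 (1986), 203–251: §13 p. 241–242, §14 p. 244–246. [BombieriFriedlanderIwaniecActa1986]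
-/

noncomputable section

open Finset Real

open scoped ArithmeticFunction.sigma ArithmeticFunction.Moebius

namespace Literature.NumberTheory.Sieve

namespace BFI

/-! ### Rough divisors -/

/-- A divisor of a `z`-rough number is `z`-rough. [folklore] -/
theorem roughIndicator_of_dvd {d n : ℕ} (hn : n ≠ 0) (hd : d ∣ n) (z : ℝ) (h : roughIndicator z n = 1) :
    roughIndicator z d = 1 := by
  unfold roughIndicator at h ⊢
  by_cases hall : ∀ p ∈ n.primeFactors, z ≤ (p : ℝ)
  · rw [if_pos]
    intro p hp
    exact hall p (Nat.primeFactors_mono hd hn hp)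
  · rw [if_neg hall] at h; exact absurd h (by norm_num)

/-- `roughIndicator ∈ {0, 1}`. [folklore] -/
theorem roughIndicator_eq_zero_or_one (z : ℝ) (m : ℕ) : roughIndicator z m = 0 ∨ roughIndicator z m = 1 := by
  unfold roughIndicator; split_ifs <;> simp

/-! ### One `(r, l)` term of an exact dyadic `q`-block: switched difference plus model error -/

/-- **`setQSum = (A^{sw} − B^{sw}) + (B^{sw} − B)`** for the block `q ∈ (Q', 2Q']`: the count is switched
exactly (`…SwitchPadic`), the expected term is `BFI.Borig`. [cite: BombieriFriedlanderIwaniecActa1986, §13 p. 241] -/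
theorem setQSum_Ioc_eq {a : ℤ} (ha : a ≠ 0) (z : ℝ) {SM SN : Finset ℕ} {l r : ℕ} (hr : 0 < r) (Q' : ℕ)
    {S : ℕ} (hpos : ∀ m ∈ SM, ∀ n ∈ SN, a < ((l * m * n : ℕ) : ℤ))
    (hS : ∀ m ∈ SM, ∀ n ∈ SN, ((l * m * n : ℕ) : ℤ) - a ≤ S) :
    setQSum a z SM SN (Ioc Q' (2 * Q')) r l =
      (∑ d ∈ a.natAbs.divisors, (μ d : ℝ) * ∑ s ∈ Icc 1 S,
        (gcount a z SM SN l l (d * (r * s)) (a + (Q' : ℤ) * r * s) (a + 2 * (Q' : ℤ) * r * s) -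
          gmodel a z SM SN l l (d * (r * s)) (a + (Q' : ℤ) * r * s) (a + 2 * (Q' : ℤ) * r * s))) +
      (Bsw a z SM SN l r Q' S - Borig a z SM SN l r Q') := by
  unfold setQSum
  rw [Finset.sum_sub_distrib, sum_filter_coprime_setCongrCount_eq_moebius_switch ha z hr Q' hpos hS]
  unfold Bsw Borig
  have e : ∑ d ∈ a.natAbs.divisors, (μ d : ℝ) * ∑ s ∈ Icc 1 S,
        (gcount a z SM SN l l (d * (r * s)) (a + (Q' : ℤ) * r * s) (a + 2 * (Q' : ℤ) * r * s) -
          gmodel a z SM SN l l (d * (r * s)) (a + (Q' : ℤ) * r * s) (a + 2 * (Q' : ℤ) * r * s)) =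
      ∑ d ∈ a.natAbs.divisors, (μ d : ℝ) * ∑ s ∈ Icc 1 S,
        gcount a z SM SN l l (d * (r * s)) (a + (Q' : ℤ) * r * s) (a + 2 * (Q' : ℤ) * r * s) -
      ∑ d ∈ a.natAbs.divisors, (μ d : ℝ) * ∑ s ∈ Icc 1 S,
        gmodel a z SM SN l l (d * (r * s)) (a + (Q' : ℤ) * r * s) (a + 2 * (Q' : ℤ) * r * s) := by
    rw [← Finset.sum_sub_distrib]
    refine Finset.sum_congr rfl fun d _ => ?_
    rw [Finset.sum_sub_distrib, mul_sub]
  rw [e]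
  ring

/-- **The `(r, l)` term of an exact dyadic block**: `|setQSum| ≤ |A^{sw} − B^{sw}| + |B^{sw} − B|`, the first
bounded through `BFI.abs_switch_diff_le_sum_Xred`, the second through `BFI.abs_Bsw_sub_Borig_le`.
[cite: BombieriFriedlanderIwaniecActa1986, §13 p. 241–242] -/
theorem abs_setQSum_Ioc_le {a : ℤ} (ha : a ≠ 0) (z : ℝ) {SM SN : Finset ℕ}
    (hSM : ∀ m ∈ SM, 0 < m) (hSN : ∀ n ∈ SN, 0 < n) {l r : ℕ} (hl : 0 < l) (hr : 0 < r)
    (hrA : r.Coprime a.natAbs) (hlr : l.Coprime r) {Q' : ℕ} (hQ' : 0 < Q') {S : ℕ}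
    (hpos : ∀ m ∈ SM, ∀ n ∈ SN, a < ((l * m * n : ℕ) : ℤ))
    (hS : ∀ m ∈ SM, ∀ n ∈ SN, ((l * m * n : ℕ) : ℤ) - a ≤ S) :
    |setQSum a z SM SN (Ioc Q' (2 * Q')) r l| ≤
      (∑ d ∈ a.natAbs.divisors, ∑ g ∈ (ThetaD a.natAbs d).divisors,
        ((Tsel a d g (profOf a l)).map (fun t =>
          roughIndicator z t.2.1 * roughIndicator z t.2.2 * |Xred a z SM SN l r Q' S d g t|)).sum) +
      ∑ m ∈ SM, ∑ n ∈ SN, merrConst a S * (σ 0 (a.natAbs * (l * m * n)) : ℝ) * totInvSum (S + 2 * Q') *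
        ((Q' * r : ℝ) / (((l * m * n : ℕ) : ℝ) - a) + 1 / Q') / Nat.totient r := by
  rw [setQSum_Ioc_eq ha z hr Q' hpos hS]
  refine (abs_add_le _ _).trans (add_le_add ?_ ?_)
  · exact abs_switch_diff_le_sum_Xred ha z hSM hSN hl hr hrA Q' S
  · exact abs_Bsw_sub_Borig_le ha z hSM hSN hl hr hrA hlr hQ' hpos hS

/-! ### The `q`-range: exact dyadic blocks and `O(log Q)` singletons -/

/-- Halving decomposition of `[1, c]` (with fuel): `[1, c] = [1, c/2] ∪ (c/2, 2(c/2)] ∪ ({c} if c odd)`,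
recursively; returns the list of `b` (blocks `(b, 2b]`) and the list of singletons. [folklore] -/
def halveAux : ℕ → ℕ → List ℕ × List ℕ
  | 0, _ => ([], [])
  | fuel + 1, c =>
    if c = 0 then ([], [])
    else ((c / 2) :: (halveAux fuel (c / 2)).1,
      if c % 2 = 1 then c :: (halveAux fuel (c / 2)).2 else (halveAux fuel (c / 2)).2)

/-- The blocks `(b, 2b]` of the halving decomposition of `[1, c]`. [folklore] -/
def halvingBlocks (c : ℕ) : List ℕ := (halveAux c c).1

/-- The singletons of the halving decomposition of `[1, c]`. [folklore] -/
def halvingSingles (c : ℕ) : List ℕ := (halveAux c c).2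

/-- `Δ*` over an empty `q`-range vanishes. [folklore] -/
theorem deltaStarSets_empty_Q (a : ℤ) (z : ℝ) (SM SN SL SR : Finset ℕ) :
    deltaStarSets a z SM SN SL (∅ : Finset ℕ) SR = 0 := by
  unfold deltaStarSets setQSum
  simp

/-- **`Δ*` over `[1, c]` in `q` is at most the sum over the halving blocks and singletons.** [folklore] -/
theorem deltaStarSets_le_halveAux (a : ℤ) (z : ℝ) (SM SN SL SR : Finset ℕ) :
    ∀ fuel c : ℕ, c ≤ fuel →
      deltaStarSets a z SM SN SL (Icc 1 c) SR ≤
        ((halveAux fuel c).1.map (fun b => deltaStarSets a z SM SN SL (Ioc b (2 * b)) SR)).sum +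
          ((halveAux fuel c).2.map (fun s => deltaStarSets a z SM SN SL ({s} : Finset ℕ) SR)).sum := by
  intro fuel
  induction fuel with
  | zero =>
    intro c hc
    have : c = 0 := by omega
    subst this
    rw [show Icc 1 0 = (∅ : Finset ℕ) from rfl, deltaStarSets_empty_Q]
    simp [halveAux]
  | succ fuel ih =>
    intro c hc
    rcases Nat.eq_zero_or_pos c with h0 | h0
    · subst h0
      rw [show Icc 1 0 = (∅ : Finset ℕ) from rfl, deltaStarSets_empty_Q]
      simp [halveAux]
    · simp only [halveAux, if_neg h0.ne']
      have hIH := ih (c / 2) (by omega)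
      -- `[1, c] = [1, c/2] ∪ (c/2, 2(c/2)] ∪ ({c} if odd)`
      have hsplit1 : Icc 1 (2 * (c / 2)) = Icc 1 (c / 2) ∪ Ioc (c / 2) (2 * (c / 2)) := by
        ext q; simp only [Finset.mem_union, Finset.mem_Icc, Finset.mem_Ioc]; omega
      have hdisj1 : Disjoint (Icc 1 (c / 2)) (Ioc (c / 2) (2 * (c / 2))) := by
        rw [Finset.disjoint_left]; intro q h1 h2
        rw [Finset.mem_Icc] at h1; rw [Finset.mem_Ioc] at h2; omega
      have h1 := deltaStarSets_union_Q_le a z SM SN SL SR hdisj1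
      rw [← hsplit1] at h1
      by_cases hodd : c % 2 = 1
      · rw [if_pos hodd]
        have hsplit2 : Icc 1 c = Icc 1 (2 * (c / 2)) ∪ ({c} : Finset ℕ) := by
          ext q; simp only [Finset.mem_union, Finset.mem_Icc, Finset.mem_singleton]; omega
        have hdisj2 : Disjoint (Icc 1 (2 * (c / 2))) ({c} : Finset ℕ) := by
          rw [Finset.disjoint_singleton_right, Finset.mem_Icc]; omega
        have h2 := deltaStarSets_union_Q_le a z SM SN SL SR hdisj2
        rw [← hsplit2] at h2
        simp only [List.map_cons, List.sum_cons]
        linarith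
      · rw [if_neg hodd]
        have hc : c = 2 * (c / 2) := by omega
        simp only [List.map_cons, List.sum_cons]
        rw [hc]
        have : 2 * (c / 2) / 2 = c / 2 := by omega
        rw [this]
        linarith

/-- The same for `halvingBlocks`/`halvingSingles`. [folklore] -/
theorem deltaStarSets_Icc_le_halving (a : ℤ) (z : ℝ) (SM SN SL SR : Finset ℕ) (c : ℕ) :
    deltaStarSets a z SM SN SL (Icc 1 c) SR ≤
      ((halvingBlocks c).map (fun b => deltaStarSets a z SM SN SL (Ioc b (2 * b)) SR)).sum +
        ((halvingSingles c).map (fun s => deltaStarSets a z SM SN SL ({s} : Finset ℕ) SR)).sum :=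
  deltaStarSets_le_halveAux a z SM SN SL SR c c le_rfl

/-- Elements and lengths of the halving lists: blocks `b` have `2b ≤ c`, singletons lie in `[1, c]`,
and both lists have length `≤ log₂ c + 1`. [folklore] -/
theorem halveAux_props : ∀ fuel c : ℕ,
    (∀ b ∈ (halveAux fuel c).1, 2 * b ≤ c) ∧ (∀ s ∈ (halveAux fuel c).2, 1 ≤ s ∧ s ≤ c) ∧
      (halveAux fuel c).1.length ≤ Nat.log 2 c + 1 ∧ (halveAux fuel c).2.length ≤ Nat.log 2 c + 1 := by
  intro fuel
  induction fuel with
  | zero => intro c; simp [halveAux]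
  | succ fuel ih =>
    intro c
    rcases Nat.eq_zero_or_pos c with h0 | h0
    · subst h0; simp [halveAux]
    simp only [halveAux, if_neg h0.ne']
    obtain ⟨hb, hs, hl1, hl2⟩ := ih (c / 2)
    -- `log₂ (c/2) + 1 ≤ log₂ c` for `c ≥ 2`, and the lists of `c/2 = 0` are empty for `c = 1`
    have hlen : ∀ L : List ℕ, L.length ≤ Nat.log 2 (c / 2) + 1 →
        (L = [] ∨ 2 ≤ c) → L.length + 1 ≤ Nat.log 2 c + 1 := by
      intro L hL hcase
      rcases hcase with h | h
      · subst h; simp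
      · have : Nat.log 2 (c / 2) + 1 = Nat.log 2 c := by
          rw [Nat.log_div_base, Nat.sub_add_cancel]
          exact Nat.log_pos (by norm_num) h
        omega
    have hcase1 : (halveAux fuel (c / 2)).1 = [] ∨ 2 ≤ c := by
      rcases lt_or_ge c 2 with h | h
      · left; have : c / 2 = 0 := by omega
        rw [this]; cases fuel <;> simp [halveAux]
      · right; exact h
    have hcase2 : (halveAux fuel (c / 2)).2 = [] ∨ 2 ≤ c := by
      rcases lt_or_ge c 2 with h | h
      · left; have : c / 2 = 0 := by omega
        rw [this]; cases fuel <;> simp [halveAux]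
      · right; exact h
    refine ⟨?_, ?_, ?_, ?_⟩
    · intro b hb'
      rw [List.mem_cons] at hb'
      rcases hb' with h | h
      · subst h; omega
      · have := hb b h; omega
    · intro s hs'
      split_ifs at hs' with hodd
      · rw [List.mem_cons] at hs'
        rcases hs' with h | h
        · subst h; exact ⟨h0, le_rfl⟩
        · have := hs s h; omega
      · have := hs s hs'; omega
    · rw [List.length_cons]; exact hlen _ hl1 hcase1
    · split_ifs with hodd
      · rw [List.length_cons]; exact hlen _ hl2 hcase2
      · have := hlen _ hl2 hcase2; omega

/-- Blocks `b` of `halvingBlocks c` satisfy `2b ≤ c`. [folklore] -/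
theorem two_mul_le_of_mem_halvingBlocks {c b : ℕ} (hb : b ∈ halvingBlocks c) : 2 * b ≤ c :=
  (halveAux_props c c).1 b hb

/-- Singletons of `halvingSingles c` lie in `[1, c]`. [folklore] -/
theorem mem_Icc_of_mem_halvingSingles {c s : ℕ} (hs : s ∈ halvingSingles c) : 1 ≤ s ∧ s ≤ c :=
  (halveAux_props c c).2.1 s hs

/-- `halvingBlocks c` has at most `log₂ c + 1` elements. [folklore] -/
theorem length_halvingBlocks_le (c : ℕ) : (halvingBlocks c).length ≤ Nat.log 2 c + 1 :=
  (halveAux_props c c).2.2.1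

/-- `halvingSingles c` has at most `log₂ c + 1` elements. [folklore] -/
theorem length_halvingSingles_le (c : ℕ) : (halvingSingles c).length ≤ Nat.log 2 c + 1 :=
  (halveAux_props c c).2.2.2

/-! ### Setting aside the small `m`, `n` (so that `lmn > |a|` on the remaining pieces) -/

/-- `Δ*` over an empty `m`-range vanishes. [folklore] -/
theorem deltaStarSets_empty_M (a : ℤ) (z : ℝ) (SN SL SQ SR : Finset ℕ) :
    deltaStarSets a z (∅ : Finset ℕ) SN SL SQ SR = 0 := by
  have h0 : ∀ r l, setQSum a z (∅ : Finset ℕ) SN SQ r l = 0 := by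
    intro r l
    unfold setQSum setCongrCount setCoprimeCount
    simp only [Finset.sum_empty, zero_div, sub_zero, Finset.sum_const_zero]
  unfold deltaStarSets
  simp only [h0, abs_zero, mul_zero, Finset.sum_const_zero]

/-- `Δ*` over a disjoint union of singletons in `m` is at most the sum over the singletons. [folklore] -/
theorem deltaStarSets_Icc_M_le_sum (a : ℤ) (z : ℝ) (K : ℕ) (SN SL SQ SR : Finset ℕ) :
    deltaStarSets a z (Icc 1 K) SN SL SQ SR ≤
      ∑ m₀ ∈ Icc 1 K, deltaStarSets a z ({m₀} : Finset ℕ) SN SL SQ SR := by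
  induction K with
  | zero =>
    rw [show Icc 1 0 = (∅ : Finset ℕ) from rfl, Finset.sum_empty, deltaStarSets_empty_M]
  | succ K ih =>
    rw [Finset.sum_Icc_succ_top (by omega)]
    have hsplit : Icc 1 (K + 1) = Icc 1 K ∪ ({K + 1} : Finset ℕ) := by
      ext m; simp only [Finset.mem_union, Finset.mem_Icc, Finset.mem_singleton]; omega
    have hdisj : Disjoint (Icc 1 K) ({K + 1} : Finset ℕ) := by
      rw [Finset.disjoint_singleton_right, Finset.mem_Icc]; omega
    rw [hsplit]
    exact (deltaStarSets_union_M_le a z hdisj SN SL SQ SR).trans (by linarith)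

/-- **The `m`-split**: with `A₀ = |a|`,
`Δ*([1,M] × [1,N]) ≤ Δ*((A₀, M] × [1, N]) + ∑_{m₀ ≤ min(A₀, M)} (Δ*({m₀} × (A₀, N]) + Δ*({m₀} × [1, min(A₀, N)]))`;
on the first two kinds of pieces `lmn > A₀ ≥ |a|`. [folklore] -/
theorem deltaStarSets_msplit_le (a : ℤ) (z : ℝ) (M N A₀ : ℕ) (SL SQ SR : Finset ℕ) :
    deltaStarSets a z (Icc 1 M) (Icc 1 N) SL SQ SR ≤
      deltaStarSets a z (Ioc A₀ M) (Icc 1 N) SL SQ SR +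
        ∑ m₀ ∈ Icc 1 (min A₀ M), (deltaStarSets a z ({m₀} : Finset ℕ) (Ioc A₀ N) SL SQ SR +
          deltaStarSets a z ({m₀} : Finset ℕ) (Icc 1 (min A₀ N)) SL SQ SR) := by
  have hM : Icc 1 M = Icc 1 (min A₀ M) ∪ Ioc A₀ M := by
    ext m; simp only [Finset.mem_union, Finset.mem_Icc, Finset.mem_Ioc]; omega
  have hMd : Disjoint (Icc 1 (min A₀ M)) (Ioc A₀ M) := by
    rw [Finset.disjoint_left]; intro m h1 h2
    rw [Finset.mem_Icc] at h1; rw [Finset.mem_Ioc] at h2; omega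
  have hN : Icc 1 N = Icc 1 (min A₀ N) ∪ Ioc A₀ N := by
    ext n; simp only [Finset.mem_union, Finset.mem_Icc, Finset.mem_Ioc]; omega
  have hNd : Disjoint (Icc 1 (min A₀ N)) (Ioc A₀ N) := by
    rw [Finset.disjoint_left]; intro n h1 h2
    rw [Finset.mem_Icc] at h1; rw [Finset.mem_Ioc] at h2; omega
  have h1 : deltaStarSets a z (Icc 1 M) (Icc 1 N) SL SQ SR ≤
      deltaStarSets a z (Icc 1 (min A₀ M)) (Icc 1 N) SL SQ SR + deltaStarSets a z (Ioc A₀ M) (Icc 1 N) SL SQ SR := by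
    rw [hM]; exact deltaStarSets_union_M_le a z hMd (Icc 1 N) SL SQ SR
  have h2 : deltaStarSets a z (Icc 1 (min A₀ M)) (Icc 1 N) SL SQ SR ≤
      ∑ m₀ ∈ Icc 1 (min A₀ M), deltaStarSets a z ({m₀} : Finset ℕ) (Icc 1 N) SL SQ SR :=
    deltaStarSets_Icc_M_le_sum a z (min A₀ M) (Icc 1 N) SL SQ SR
  have h3 : ∀ m₀ : ℕ, deltaStarSets a z ({m₀} : Finset ℕ) (Icc 1 N) SL SQ SR ≤
      deltaStarSets a z ({m₀} : Finset ℕ) (Ioc A₀ N) SL SQ SR +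
        deltaStarSets a z ({m₀} : Finset ℕ) (Icc 1 (min A₀ N)) SL SQ SR := by
    intro m₀
    rw [hN, add_comm]
    exact deltaStarSets_union_N_le a z ({m₀} : Finset ℕ) hNd SL SQ SR
  have h4 := Finset.sum_le_sum fun m₀ (_ : m₀ ∈ Icc 1 (min A₀ M)) => h3 m₀
  linarith

/-- A singleton range is a difference of two initial ranges: `Δ*({m₀} × …) ≤ Δ*([1,m₀]) + Δ*([1,m₀−1])`.
[folklore] -/
theorem deltaStarSets_singleton_M_le (a : ℤ) (z : ℝ) {m₀ : ℕ} (hm₀ : 1 ≤ m₀) (SN SL SQ SR : Finset ℕ) :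
    deltaStarSets a z ({m₀} : Finset ℕ) SN SL SQ SR ≤
      deltaStarSets a z (Icc 1 m₀) SN SL SQ SR + deltaStarSets a z (Icc 1 (m₀ - 1)) SN SL SQ SR := by
  have h : ({m₀} : Finset ℕ) = Icc 1 m₀ \ Icc 1 (m₀ - 1) := by
    ext m; simp only [Finset.mem_singleton, Finset.mem_sdiff, Finset.mem_Icc]; omega
  rw [h]
  exact deltaStarSets_sdiff_M_le a z (by intro m hm; rw [Finset.mem_Icc] at hm ⊢; omega) SN SL SQ SR

/-- The same in `q`. [folklore] -/
theorem deltaStarSets_singleton_Q_le (a : ℤ) (z : ℝ) (SM SN SL SR : Finset ℕ) {q₀ : ℕ} (hq₀ : 1 ≤ q₀) :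
    deltaStarSets a z SM SN SL ({q₀} : Finset ℕ) SR ≤
      deltaStarSets a z SM SN SL (Icc 1 q₀) SR + deltaStarSets a z SM SN SL (Icc 1 (q₀ - 1)) SR := by
  have h : ({q₀} : Finset ℕ) = Icc 1 q₀ \ Icc 1 (q₀ - 1) := by
    ext q; simp only [Finset.mem_singleton, Finset.mem_sdiff, Finset.mem_Icc]; omega
  rw [h]
  exact deltaStarSets_sdiff_Q_le a z SM SN SL SR (by intro q hq; rw [Finset.mem_Icc] at hq ⊢; omega)

/-- An exact dyadic block in `q` as a difference of initial ranges. [folklore] -/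
theorem deltaStarSets_Ioc_Q_le (a : ℤ) (z : ℝ) (SM SN SL SR : Finset ℕ) (b : ℕ) :
    deltaStarSets a z SM SN SL (Ioc b (2 * b)) SR ≤
      deltaStarSets a z SM SN SL (Icc 1 (2 * b)) SR + deltaStarSets a z SM SN SL (Icc 1 b) SR := by
  have h : Ioc b (2 * b) = Icc 1 (2 * b) \ Icc 1 b := by
    ext q; simp only [Finset.mem_Ioc, Finset.mem_sdiff, Finset.mem_Icc]; omega
  rw [h]
  exact deltaStarSets_sdiff_Q_le a z SM SN SL SR (by intro q hq; rw [Finset.mem_Icc] at hq ⊢; omega)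

/-- The `r`-range split at a threshold: `Δ*(…, [1, R]) = Δ*(…, [1, r*]) + Δ*(…, (r*, R])` (`r* ≤ R`). [folklore] -/
theorem deltaStarSets_R_split (a : ℤ) (z : ℝ) (SM SN SL SQ : Finset ℕ) {rs R : ℕ} (h : rs ≤ R) :
    deltaStarSets a z SM SN SL SQ (Icc 1 R) =
      deltaStarSets a z SM SN SL SQ (Icc 1 rs) + deltaStarSets a z SM SN SL SQ (Ioc rs R) := by
  have hsplit : Icc 1 R = Icc 1 rs ∪ Ioc rs R := by
    ext r; simp only [Finset.mem_union, Finset.mem_Icc, Finset.mem_Ioc]; omega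
  have hdisj : Disjoint (Icc 1 rs) (Ioc rs R) := by
    rw [Finset.disjoint_left]; intro r h1 h2
    rw [Finset.mem_Icc] at h1; rw [Finset.mem_Ioc] at h2; omega
  rw [hsplit, deltaStarSets_union_R a z SM SN SL SQ hdisj]

/-! ### Singleton `q`-blocks with large `q₀`: elementary bound -/

/-- The number of `k ∈ [1, X]` in a residue class modulo `w ≥ 1` is at most `X/w + 1`. [folklore] -/
theorem card_Icc_filter_int_dvd_le (X : ℕ) {w : ℕ} (hw : 0 < w) (a : ℤ) :
    (((Icc 1 X).filter (fun k : ℕ => (w : ℤ) ∣ (k : ℤ) - a)).card : ℝ) ≤ (X : ℝ) / w + 1 := by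
  set F := (Icc 1 X).filter (fun k : ℕ => (w : ℤ) ∣ (k : ℤ) - a) with hF
  have hinj : Set.InjOn (fun k : ℕ => (k - 1) / w) (F : Set ℕ) := by
    intro k₁ hk₁ k₂ hk₂ heq
    simp only [hF, Finset.coe_filter, Set.mem_setOf_eq, Finset.mem_Icc] at hk₁ hk₂
    simp only at heq
    have hd : (w : ℤ) ∣ (k₁ : ℤ) - k₂ := by
      have := dvd_sub hk₁.2 hk₂.2; rwa [sub_sub_sub_cancel_right] at this
    have hlt : |((k₁ : ℤ) - k₂)| < w := by
      have h1 := Nat.div_mul_le_self (k₁ - 1) w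
      have h2 := Nat.lt_div_mul_add (a := k₁ - 1) hw
      have h3 := Nat.div_mul_le_self (k₂ - 1) w
      have h4 := Nat.lt_div_mul_add (a := k₂ - 1) hw
      rw [heq] at h1 h2
      rw [abs_lt]; constructor <;> omega
    have := Int.eq_zero_of_abs_lt_dvd hd hlt
    omega
  have hmaps : ∀ k ∈ F, (fun k : ℕ => (k - 1) / w) k ∈ Finset.range ((X - 1) / w + 1) := by
    intro k hk
    simp only [hF, Finset.mem_filter, Finset.mem_Icc] at hk
    rw [Finset.mem_range]
    exact Nat.lt_succ_of_le (Nat.div_le_div_right (by omega))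
  have hcard := Finset.card_le_card_of_injOn _ hmaps hinj
  rw [Finset.card_range] at hcard
  have h1 : ((F.card : ℕ) : ℝ) ≤ ((((X - 1) / w : ℕ)) : ℝ) + 1 := by exact_mod_cast hcard
  have h2 : ((((X - 1) / w : ℕ)) : ℝ) ≤ (X : ℝ) / w := by
    calc ((((X - 1) / w : ℕ)) : ℝ) ≤ ((X - 1 : ℕ) : ℝ) / w := Nat.cast_div_le
      _ ≤ (X : ℝ) / w := by
          apply div_le_div_of_nonneg_right _ (by positivity)
          exact_mod_cast Nat.sub_le X 1
  linarith

/-- **Triples in a box in a residue class**: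
`#{(l,m,n) ∈ [1,L]×[1,M]×[1,N] : w ∣ lmn − a} ≤ ∑_{k ≤ LMN, w ∣ k − a} τ(k)²`. [folklore] -/
theorem card_box_filter_dvd_le (L M N w : ℕ) (a : ℤ) :
    ((((Icc 1 L) ×ˢ ((Icc 1 M) ×ˢ (Icc 1 N))).filter
        (fun p : ℕ × (ℕ × ℕ) => (w : ℤ) ∣ ((p.1 * p.2.1 * p.2.2 : ℕ) : ℤ) - a)).card : ℝ) ≤
      ∑ k ∈ (Icc 1 (L * M * N)).filter (fun k : ℕ => (w : ℤ) ∣ (k : ℤ) - a), (σ 0 k : ℝ) ^ 2 := by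
  classical
  set B := (Icc 1 L) ×ˢ ((Icc 1 M) ×ˢ (Icc 1 N)) with hB
  set f : ℕ × (ℕ × ℕ) → ℕ := fun p => p.1 * p.2.1 * p.2.2 with hf
  have hmaps : ∀ p ∈ B.filter (fun p : ℕ × (ℕ × ℕ) => (w : ℤ) ∣ ((p.1 * p.2.1 * p.2.2 : ℕ) : ℤ) - a),
      f p ∈ (Icc 1 (L * M * N)).filter (fun k : ℕ => (w : ℤ) ∣ (k : ℤ) - a) := by
    intro p hp
    simp only [hB, Finset.mem_filter, Finset.mem_product, Finset.mem_Icc] at hp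
    obtain ⟨⟨⟨hl1, hl2⟩, ⟨hm1, hm2⟩, ⟨hn1, hn2⟩⟩, hdvd⟩ := hp
    simp only [hf, Finset.mem_filter, Finset.mem_Icc]
    refine ⟨⟨?_, ?_⟩, hdvd⟩
    · exact Nat.mul_pos (Nat.mul_pos hl1 hm1) hn1
    · exact Nat.mul_le_mul (Nat.mul_le_mul hl2 hm2) hn2
  rw [Finset.card_eq_sum_card_fiberwise hmaps]
  push_cast
  refine Finset.sum_le_sum fun k hk => ?_
  have hk0 : k ≠ 0 := by
    have := (Finset.mem_Icc.1 (Finset.mem_filter.1 hk).1).1; omega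
  have hsub : (B.filter (fun p : ℕ × (ℕ × ℕ) => (w : ℤ) ∣ ((p.1 * p.2.1 * p.2.2 : ℕ) : ℤ) - a)).filter (fun p => f p = k) ⊆
      B.filter (fun p : ℕ × (ℕ × ℕ) => p.1 * p.2.1 * p.2.2 = k) := by
    intro p hp
    simp only [Finset.mem_filter, hf] at hp ⊢
    exact ⟨hp.1.1, hp.2⟩
  calc (((B.filter (fun p : ℕ × (ℕ × ℕ) => (w : ℤ) ∣ ((p.1 * p.2.1 * p.2.2 : ℕ) : ℤ) - a)).filter (fun p => f p = k)).card : ℝ)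
      ≤ ((B.filter (fun p : ℕ × (ℕ × ℕ) => p.1 * p.2.1 * p.2.2 = k)).card : ℝ) := by
        exact_mod_cast Finset.card_le_card hsub
    _ ≤ ((k.divisors.card ^ 2 : ℕ) : ℝ) := by exact_mod_cast card_triples_le hk0 _ _ _
    _ = (σ 0 k : ℝ) ^ 2 := by rw [Nat.cast_pow, ArithmeticFunction.sigma_zero_apply]

/-- `roughIndicator ≤ 1`. [folklore] -/
theorem roughIndicator_le_one' (z : ℝ) (m : ℕ) : roughIndicator z m ≤ 1 := by
  rcases roughIndicator_eq_zero_or_one z m with h | h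
  · rw [h]; norm_num
  · rw [h]

/-- The harmonic bound with `R = 0` allowed. [folklore] -/
theorem sum_Icc_inv_le_log' (R : ℕ) : ∑ r ∈ Icc 1 R, (1 : ℝ) / r ≤ 1 + Real.log R := by
  rcases Nat.eq_zero_or_pos R with h | h
  · subst h; simp
  · exact sum_Icc_inv_le_log R h

/-- **A singleton `q`-block, elementary bound**: for `q₀ ≥ 1` and a pointwise divisor bound `τ(n) ≤ C n^η`,
`Δ*([1,M],[1,N],[1,L],{q₀},[1,R]) ≤ C² X^{2η} (X (1 + log R)/q₀ + R) + X Φ(R)/φ(q₀)`, `X = LMN`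
(congruence part: `≤ X/(q₀ r) + 1` members of each progression, each with `≤ τ² ≤ C² X^{2η}` representations;
expected part: `φ(q₀ r) ≥ φ(q₀) φ(r)`). [folklore] -/
theorem deltaStarSets_singleton_Q_le_elem (a : ℤ) (z : ℝ) (M N L R : ℕ) {q₀ : ℕ} (hq₀ : 0 < q₀)
    {C η : ℝ} (hη : 0 ≤ η) (hC : 0 ≤ C) (hτ : ∀ n : ℕ, (σ 0 n : ℝ) ≤ C * (n : ℝ) ^ η) :
    deltaStarSets a z (Icc 1 M) (Icc 1 N) (Icc 1 L) ({q₀} : Finset ℕ) (Icc 1 R) ≤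
      C ^ 2 * ((L * M * N : ℕ) : ℝ) ^ (2 * η) * (((L * M * N : ℕ) : ℝ) * (1 + Real.log R) / q₀ + R) +
        ((L * M * N : ℕ) : ℝ) * totInvSum R / Nat.totient q₀ := by
  classical
  set X : ℕ := L * M * N with hX
  have hφq : (0 : ℝ) < Nat.totient q₀ := by exact_mod_cast Nat.totient_pos.2 hq₀
  -- Step 1: each `(r, l)` term is at most congruence count + expected count
  have hterm : ∀ r ∈ Icc 1 R, ∀ l ∈ Icc 1 L,
      roughIndicator z l * |setQSum a z (Icc 1 M) (Icc 1 N) ({q₀} : Finset ℕ) r l| ≤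
        (∑ m ∈ Icc 1 M, ∑ n ∈ Icc 1 N,
          (if ((q₀ * r : ℕ) : ℤ) ∣ ((l * m * n : ℕ) : ℤ) - a then (1 : ℝ) else 0)) +
        (M : ℝ) * N / ((Nat.totient q₀ : ℝ) * Nat.totient r) := by
    intro r hr l _
    have hr0 : 0 < r := (Finset.mem_Icc.1 hr).1
    have hA0 : 0 ≤ ∑ m ∈ Icc 1 M, ∑ n ∈ Icc 1 N,
        (if ((q₀ * r : ℕ) : ℤ) ∣ ((l * m * n : ℕ) : ℤ) - a then (1 : ℝ) else 0) :=
      Finset.sum_nonneg fun _ _ => Finset.sum_nonneg fun _ _ => by split_ifs <;> norm_num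
    have hB0 : 0 ≤ (M : ℝ) * N / ((Nat.totient q₀ : ℝ) * Nat.totient r) := by positivity
    refine (mul_le_of_le_one_left (abs_nonneg _) (roughIndicator_le_one' z l)).trans ?_
    have hρρ : ∀ m n : ℕ, roughIndicator z m * roughIndicator z n ≤ 1 := fun m n =>
      mul_le_one₀ (roughIndicator_le_one' z m) (roughIndicator_nonneg z n) (roughIndicator_le_one' z n)
    have hρρ0 : ∀ m n : ℕ, 0 ≤ roughIndicator z m * roughIndicator z n := fun m n =>
      mul_nonneg (roughIndicator_nonneg z m) (roughIndicator_nonneg z n)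
    have hCC0 : 0 ≤ setCongrCount a z (Icc 1 M) (Icc 1 N) l (q₀ * r) := by
      unfold setCongrCount
      exact Finset.sum_nonneg fun m _ => Finset.sum_nonneg fun n _ => by
        split_ifs
        · exact hρρ0 m n
        · exact le_rfl
    have hCC : setCongrCount a z (Icc 1 M) (Icc 1 N) l (q₀ * r) ≤
        ∑ m ∈ Icc 1 M, ∑ n ∈ Icc 1 N,
          (if ((q₀ * r : ℕ) : ℤ) ∣ ((l * m * n : ℕ) : ℤ) - a then (1 : ℝ) else 0) := by
      unfold setCongrCount
      refine Finset.sum_le_sum fun m _ => Finset.sum_le_sum fun n _ => ?_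
      simp only [natCast_zmod_eq_iff_dvd]
      split_ifs
      · exact hρρ m n
      · exact le_rfl
    have hCP0 : 0 ≤ setCoprimeCount z (Icc 1 M) (Icc 1 N) (q₀ * r) := by
      unfold setCoprimeCount
      exact Finset.sum_nonneg fun m _ => Finset.sum_nonneg fun n _ => by
        split_ifs
        · exact hρρ0 m n
        · exact le_rfl
    have hCP : setCoprimeCount z (Icc 1 M) (Icc 1 N) (q₀ * r) ≤ (M : ℝ) * N := by
      unfold setCoprimeCount
      calc ∑ m ∈ Icc 1 M, ∑ n ∈ Icc 1 N,
            (if (m * n).Coprime (q₀ * r) then roughIndicator z m * roughIndicator z n else 0)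
          ≤ ∑ m ∈ Icc 1 M, ∑ n ∈ Icc 1 N, (1 : ℝ) := by
            refine Finset.sum_le_sum fun m _ => Finset.sum_le_sum fun n _ => ?_
            split_ifs
            · exact hρρ m n
            · norm_num
        _ = (M : ℝ) * N := by simp
    have hφ : (0 : ℝ) < Nat.totient (q₀ * r) := by exact_mod_cast Nat.totient_pos.2 (Nat.mul_pos hq₀ hr0)
    have hφmul : (Nat.totient q₀ : ℝ) * Nat.totient r ≤ Nat.totient (q₀ * r) := by
      exact_mod_cast Nat.totient_super_multiplicative q₀ r
    have hB : setCoprimeCount z (Icc 1 M) (Icc 1 N) (q₀ * r) / (Nat.totient (q₀ * r) : ℝ) ≤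
        (M : ℝ) * N / ((Nat.totient q₀ : ℝ) * Nat.totient r) :=
      calc setCoprimeCount z (Icc 1 M) (Icc 1 N) (q₀ * r) / (Nat.totient (q₀ * r) : ℝ)
          ≤ ((M : ℝ) * N) / (Nat.totient (q₀ * r) : ℝ) := div_le_div_of_nonneg_right hCP hφ.le
        _ ≤ (M : ℝ) * N / ((Nat.totient q₀ : ℝ) * Nat.totient r) :=
            div_le_div_of_nonneg_left (by positivity) (by positivity) hφmul
    unfold setQSum
    by_cases hcop : IsCoprime (q₀ : ℤ) (a * l)
    · rw [Finset.filter_singleton, if_pos hcop, Finset.sum_singleton]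
      refine (abs_sub _ _).trans (add_le_add ?_ ?_)
      · rw [abs_of_nonneg hCC0]; exact hCC
      · rw [abs_of_nonneg (div_nonneg hCP0 hφ.le)]; exact hB
    · rw [Finset.filter_singleton, if_neg hcop, Finset.sum_empty, abs_zero]
      exact add_nonneg hA0 hB0
  -- Step 2: sum over `(r, l)` (dropping the filters)
  have hnn : ∀ r l, 0 ≤ roughIndicator z l * |setQSum a z (Icc 1 M) (Icc 1 N) ({q₀} : Finset ℕ) r l| :=
    fun r l => mul_nonneg (roughIndicator_nonneg z l) (abs_nonneg _)
  have hstep2 : deltaStarSets a z (Icc 1 M) (Icc 1 N) (Icc 1 L) ({q₀} : Finset ℕ) (Icc 1 R) ≤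
      ∑ r ∈ Icc 1 R, ∑ l ∈ Icc 1 L,
        ((∑ m ∈ Icc 1 M, ∑ n ∈ Icc 1 N,
          (if ((q₀ * r : ℕ) : ℤ) ∣ ((l * m * n : ℕ) : ℤ) - a then (1 : ℝ) else 0)) +
        (M : ℝ) * N / ((Nat.totient q₀ : ℝ) * Nat.totient r)) := by
    unfold deltaStarSets
    calc ∑ r ∈ (Icc 1 R).filter (fun r : ℕ => IsCoprime (r : ℤ) a),
          ∑ l ∈ (Icc 1 L).filter (fun l : ℕ => l.Coprime r),
            roughIndicator z l * |setQSum a z (Icc 1 M) (Icc 1 N) ({q₀} : Finset ℕ) r l|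
        ≤ ∑ r ∈ Icc 1 R, ∑ l ∈ Icc 1 L,
            roughIndicator z l * |setQSum a z (Icc 1 M) (Icc 1 N) ({q₀} : Finset ℕ) r l| := by
          refine (Finset.sum_le_sum_of_subset_of_nonneg (Finset.filter_subset _ _) fun r _ _ =>
            Finset.sum_nonneg fun l _ => hnn r l).trans ?_
          exact Finset.sum_le_sum fun r _ =>
            Finset.sum_le_sum_of_subset_of_nonneg (Finset.filter_subset _ _) fun l _ _ => hnn r l
      _ ≤ _ := Finset.sum_le_sum fun r hr => Finset.sum_le_sum fun l hl => hterm r hr l hl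
  refine hstep2.trans ?_
  rw [Finset.sum_congr rfl fun r _ => Finset.sum_add_distrib, Finset.sum_add_distrib]
  refine add_le_add ?_ ?_
  · -- Step 3: the congruence part
    have hXη : ∀ k ∈ Icc 1 X, (σ 0 k : ℝ) ^ 2 ≤ C ^ 2 * (X : ℝ) ^ (2 * η) := by
      intro k hk
      rw [Finset.mem_Icc] at hk
      have h1 := hτ k
      have hk0 : (0 : ℝ) ≤ k := by positivity
      have hkX : (k : ℝ) ≤ X := by exact_mod_cast hk.2
      have h2 : (k : ℝ) ^ η ≤ (X : ℝ) ^ η := Real.rpow_le_rpow hk0 hkX hη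
      have h0 : 0 ≤ (σ 0 k : ℝ) := by positivity
      have hX2 : ((X : ℝ) ^ η) ^ 2 = (X : ℝ) ^ (2 * η) := by
        rw [← Real.rpow_natCast ((X : ℝ) ^ η) 2, ← Real.rpow_mul (by positivity)]
        norm_num; ring_nf
      calc (σ 0 k : ℝ) ^ 2 ≤ (C * (k : ℝ) ^ η) ^ 2 := pow_le_pow_left₀ h0 h1 2
        _ ≤ (C * (X : ℝ) ^ η) ^ 2 := by
            apply pow_le_pow_left₀ (by positivity)
            exact mul_le_mul_of_nonneg_left h2 hC
        _ = C ^ 2 * (X : ℝ) ^ (2 * η) := by rw [mul_pow, hX2]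
    have hr_bound : ∀ r ∈ Icc 1 R, ∑ l ∈ Icc 1 L, ∑ m ∈ Icc 1 M, ∑ n ∈ Icc 1 N,
        (if ((q₀ * r : ℕ) : ℤ) ∣ ((l * m * n : ℕ) : ℤ) - a then (1 : ℝ) else 0) ≤
        C ^ 2 * (X : ℝ) ^ (2 * η) * ((X : ℝ) / (q₀ * r) + 1) := by
      intro r hr
      have hr0 : 0 < r := (Finset.mem_Icc.1 hr).1
      have hw : 0 < q₀ * r := Nat.mul_pos hq₀ hr0
      -- as a cardinality
      have hcard : ∑ l ∈ Icc 1 L, ∑ m ∈ Icc 1 M, ∑ n ∈ Icc 1 N,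
          (if ((q₀ * r : ℕ) : ℤ) ∣ ((l * m * n : ℕ) : ℤ) - a then (1 : ℝ) else 0) =
          ((((Icc 1 L) ×ˢ ((Icc 1 M) ×ˢ (Icc 1 N))).filter
            (fun p : ℕ × (ℕ × ℕ) => ((q₀ * r : ℕ) : ℤ) ∣ ((p.1 * p.2.1 * p.2.2 : ℕ) : ℤ) - a)).card : ℝ) := by
        rw [Finset.card_filter, Nat.cast_sum, Finset.sum_product]
        refine Finset.sum_congr rfl fun l _ => ?_
        rw [Finset.sum_product]
        refine Finset.sum_congr rfl fun m _ => Finset.sum_congr rfl fun n _ => ?_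
        split_ifs <;> simp
      rw [hcard]
      refine (card_box_filter_dvd_le L M N (q₀ * r) a).trans ?_
      rw [← hX]
      calc ∑ k ∈ (Icc 1 X).filter (fun k : ℕ => ((q₀ * r : ℕ) : ℤ) ∣ (k : ℤ) - a), (σ 0 k : ℝ) ^ 2
          ≤ ∑ k ∈ (Icc 1 X).filter (fun k : ℕ => ((q₀ * r : ℕ) : ℤ) ∣ (k : ℤ) - a), C ^ 2 * (X : ℝ) ^ (2 * η) :=
            Finset.sum_le_sum fun k hk => hXη k (Finset.mem_filter.1 hk).1
        _ = (((Icc 1 X).filter (fun k : ℕ => ((q₀ * r : ℕ) : ℤ) ∣ (k : ℤ) - a)).card : ℝ) * (C ^ 2 * (X : ℝ) ^ (2 * η)) := by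
            rw [Finset.sum_const, nsmul_eq_mul]
        _ ≤ ((X : ℝ) / (q₀ * r) + 1) * (C ^ 2 * (X : ℝ) ^ (2 * η)) := by
            refine mul_le_mul_of_nonneg_right ?_ (by positivity)
            have := card_Icc_filter_int_dvd_le X hw a
            push_cast at this
            exact this
        _ = C ^ 2 * (X : ℝ) ^ (2 * η) * ((X : ℝ) / (q₀ * r) + 1) := by ring
    have hq₀' : (0 : ℝ) < q₀ := by exact_mod_cast hq₀
    have hsumr : ∑ r ∈ Icc 1 R, ((X : ℝ) / (q₀ * r) + 1) ≤ (X : ℝ) * (1 + Real.log R) / q₀ + R := by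
      rw [Finset.sum_add_distrib]
      simp only [Finset.sum_const, Nat.card_Icc, add_tsub_cancel_right, nsmul_eq_mul, mul_one]
      suffices h : ∑ r ∈ Icc 1 R, (X : ℝ) / (q₀ * r) ≤ (X : ℝ) * (1 + Real.log R) / q₀ by linarith
      have e : ∑ r ∈ Icc 1 R, (X : ℝ) / (q₀ * r) = (X : ℝ) / q₀ * ∑ r ∈ Icc 1 R, (1 : ℝ) / r := by
        rw [Finset.mul_sum]
        refine Finset.sum_congr rfl fun r hr => ?_
        have hr0 : (0 : ℝ) < r := by exact_mod_cast (Finset.mem_Icc.1 hr).1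
        field_simp
      rw [e, show (X : ℝ) * (1 + Real.log R) / q₀ = (X : ℝ) / q₀ * (1 + Real.log R) by ring]
      exact mul_le_mul_of_nonneg_left (sum_Icc_inv_le_log' R) (by positivity)
    calc ∑ r ∈ Icc 1 R, ∑ l ∈ Icc 1 L, ∑ m ∈ Icc 1 M, ∑ n ∈ Icc 1 N,
          (if ((q₀ * r : ℕ) : ℤ) ∣ ((l * m * n : ℕ) : ℤ) - a then (1 : ℝ) else 0)
        ≤ ∑ r ∈ Icc 1 R, C ^ 2 * (X : ℝ) ^ (2 * η) * ((X : ℝ) / (q₀ * r) + 1) := Finset.sum_le_sum hr_bound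
      _ = C ^ 2 * (X : ℝ) ^ (2 * η) * ∑ r ∈ Icc 1 R, ((X : ℝ) / (q₀ * r) + 1) := by rw [← Finset.mul_sum]
      _ ≤ C ^ 2 * (X : ℝ) ^ (2 * η) * ((X : ℝ) * (1 + Real.log R) / q₀ + R) :=
          mul_le_mul_of_nonneg_left hsumr (by positivity)
  · -- Step 4: the expected part
    apply le_of_eq
    unfold totInvSum
    rw [hX]
    push_cast
    simp only [Finset.sum_const, Nat.card_Icc, add_tsub_cancel_right, nsmul_eq_mul]
    rw [Finset.mul_sum, Finset.sum_div]
    refine Finset.sum_congr rfl fun r hr => ?_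
    have hr0 : (0 : ℝ) < Nat.totient r := by exact_mod_cast Nat.totient_pos.2 (Finset.mem_Icc.1 hr).1
    field_simp

/-! ### Cells of relative width `β − 1` -/

/-- Breakpoints of the cells of `(lo, X]`: `b_i = max(lo, min(X, ⌊β^i⌋ − 1))`. [folklore] -/
def bp (lo X : ℕ) (β : ℝ) (i : ℕ) : ℕ := max lo (min X (⌊β ^ i⌋₊ - 1))

/-- `b_0 = lo`. [folklore] -/
theorem bp_zero (lo X : ℕ) (β : ℝ) : bp lo X β 0 = lo := by
  unfold bp; simp

/-- `b` is monotone for `β ≥ 1`. [folklore] -/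
theorem bp_mono (lo X : ℕ) {β : ℝ} (hβ : 1 ≤ β) : Monotone (bp lo X β) := by
  intro i j hij
  unfold bp
  have h : ⌊β ^ i⌋₊ ≤ ⌊β ^ j⌋₊ := Nat.floor_le_floor (pow_le_pow_right₀ hβ hij)
  omega

/-- `lo ≤ b_i ≤ max lo X`. [folklore] -/
theorem bp_bounds (lo X : ℕ) (β : ℝ) (i : ℕ) : lo ≤ bp lo X β i ∧ bp lo X β i ≤ max lo X := by
  unfold bp; omega

/-- `b_J = X` as soon as `β^J ≥ X + 1` (and `lo ≤ X`). [folklore] -/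
theorem bp_eq_top {lo X : ℕ} (hlo : lo ≤ X) {β : ℝ} {J : ℕ} (hJ : (X : ℝ) + 1 ≤ β ^ J) : bp lo X β J = X := by
  unfold bp
  have h : X + 1 ≤ ⌊β ^ J⌋₊ := Nat.le_floor (by exact_mod_cast hJ)
  omega

/-- A sufficient number of cells: with `J = ⌈log(X+1)/log β⌉ `, `β^J ≥ X + 1` (`β > 1`). [folklore] -/
theorem pow_numCells_ge {β : ℝ} (hβ : 1 < β) (X : ℕ) :
    (X : ℝ) + 1 ≤ β ^ ⌈Real.log ((X : ℝ) + 1) / Real.log β⌉₊ := by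
  have hlogβ : 0 < Real.log β := Real.log_pos hβ
  have hX1 : (0 : ℝ) < (X : ℝ) + 1 := by positivity
  have h1 : Real.log ((X : ℝ) + 1) / Real.log β ≤ (⌈Real.log ((X : ℝ) + 1) / Real.log β⌉₊ : ℝ) := Nat.le_ceil _
  have h2 : Real.log ((X : ℝ) + 1) ≤ (⌈Real.log ((X : ℝ) + 1) / Real.log β⌉₊ : ℝ) * Real.log β := by
    rwa [div_le_iff₀ hlogβ] at h1
  rw [← Real.log_le_log_iff hX1 (by positivity), Real.log_pow]
  exact h2

/-- The number of cells is `O(log X / log β)`: `⌈log(X+1)/log β⌉ ≤ log(X+1)/log β + 1`. [folklore] -/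
theorem numCells_le {β : ℝ} (hβ : 1 < β) (X : ℕ) :
    (⌈Real.log ((X : ℝ) + 1) / Real.log β⌉₊ : ℝ) ≤ Real.log ((X : ℝ) + 1) / Real.log β + 1 := by
  have h0 : 0 ≤ Real.log ((X : ℝ) + 1) / Real.log β :=
    div_nonneg (Real.log_nonneg (by have : (0:ℝ) ≤ X := Nat.cast_nonneg X; linarith)) (Real.log_pos hβ).le
  exact (Nat.ceil_lt_add_one h0).le

/-- **Spread of a cell**: for `m, m'` in the same cell `(b_i, b_{i+1}]` (`β ≥ 1`), `m' ≤ β m + (β − 1)`.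
[folklore] -/
theorem cell_spread {lo X : ℕ} {β : ℝ} (hβ : 1 ≤ β) {i m m' : ℕ}
    (hm : m ∈ Ioc (bp lo X β i) (bp lo X β (i + 1))) (hm' : m' ∈ Ioc (bp lo X β i) (bp lo X β (i + 1))) :
    (m' : ℝ) ≤ β * m + (β - 1) := by
  rw [Finset.mem_Ioc] at hm hm'
  -- `b_{i+1} ≤ ⌊β^{i+1}⌋ − 1 < β^{i+1} = β β^i < β (⌊β^i⌋ + 1)` unless `b_{i+1} = lo` (then the cell is empty)
  have hβ0 : (0 : ℝ) ≤ β := by linarith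
  have hpow : (1 : ℝ) ≤ β ^ i := one_le_pow₀ hβ
  have hfl : (1 : ℕ) ≤ ⌊β ^ i⌋₊ := Nat.le_floor (by exact_mod_cast hpow)
  have hlt : β ^ i < (⌊β ^ i⌋₊ : ℝ) + 1 := Nat.lt_floor_add_one _
  -- case analysis on which term realises `b_{i+1}`
  by_cases htop : bp lo X β (i + 1) = lo
  · -- then `b_i = lo` too and the cell is empty
    have : lo ≤ bp lo X β i := (bp_bounds lo X β i).1
    omega
  · -- `b_{i+1} = min X (⌊β^{i+1}⌋ − 1) ≤ ⌊β^{i+1}⌋ − 1`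
    have hb1 : bp lo X β (i + 1) ≤ ⌊β ^ (i + 1)⌋₊ - 1 := by
      unfold bp at htop ⊢
      rcases le_or_gt (min X (⌊β ^ (i + 1)⌋₊ - 1)) lo with h | h
      · exact absurd (max_eq_left h) htop
      · rw [max_eq_right h.le]; exact min_le_right _ _
    -- `b_i ≥ ⌊β^i⌋ − 1` or `b_i ≥ X ≥ b_{i+1}` hmm: `b_i ≥ min X (⌊β^i⌋ − 1)`
    have hb0 : min X (⌊β ^ i⌋₊ - 1) ≤ bp lo X β i := by unfold bp; exact le_max_right _ _
    have hbX : bp lo X β (i + 1) ≤ max lo X := (bp_bounds lo X β (i + 1)).2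
    -- real inequalities
    have hfl1 : ((⌊β ^ (i + 1)⌋₊ : ℕ) : ℝ) ≤ β ^ (i + 1) := Nat.floor_le (by positivity)
    have hm'r : (m' : ℝ) ≤ bp lo X β (i + 1) := by exact_mod_cast hm'.2
    have hmr : ((bp lo X β i : ℕ) : ℝ) + 1 ≤ m := by exact_mod_cast hm.1
    rcases le_or_gt X (⌊β ^ i⌋₊ - 1) with hXs | hXs
    · -- `min = X`, so `b_i ≥ X ≥ b_{i+1}`: empty cell
      rw [min_eq_left hXs] at hb0
      have : bp lo X β (i + 1) ≤ X := by
        rcases le_or_gt lo X with h | h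
        · rw [max_eq_right h] at hbX; exact hbX
        · -- `lo > X`: then all breakpoints equal `lo`
          exfalso; apply htop; unfold bp; apply max_eq_left; exact (min_le_left _ _).trans h.le
      omega
    · rw [min_eq_right hXs.le] at hb0
      -- `b_{i+1} ≤ β^{i+1} − 1 < β(⌊β^i⌋ + 1) − 1 = β (⌊β^i⌋ − 1 + 2) − 1 ≤ β (b_i + 2) − 1`
      have h1 : ((bp lo X β (i + 1) : ℕ) : ℝ) ≤ β ^ (i + 1) - 1 := by
        have : ((bp lo X β (i + 1) : ℕ) : ℝ) ≤ ((⌊β ^ (i + 1)⌋₊ - 1 : ℕ) : ℝ) := by exact_mod_cast hb1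
        have hfl2 : (1 : ℕ) ≤ ⌊β ^ (i + 1)⌋₊ := Nat.le_floor (by exact_mod_cast one_le_pow₀ hβ)
        rw [Nat.cast_sub hfl2] at this
        push_cast at this
        linarith
      have h2 : β ^ (i + 1) ≤ β * ((⌊β ^ i⌋₊ : ℝ) + 1) := by
        rw [pow_succ, mul_comm]
        exact mul_le_mul_of_nonneg_left hlt.le hβ0
      have h3 : ((⌊β ^ i⌋₊ : ℕ) : ℝ) ≤ (bp lo X β i : ℝ) + 1 := by
        have : ((⌊β ^ i⌋₊ - 1 : ℕ) : ℝ) ≤ bp lo X β i := by exact_mod_cast hb0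
        rw [Nat.cast_sub hfl] at this
        push_cast at this
        linarith
      have h4 : ((bp lo X β (i + 1) : ℕ) : ℝ) ≤ β * ((bp lo X β i : ℝ) + 2) - 1 := by nlinarith
      nlinarith

/-- The relative form: for `β = 1 + δ`, `0 ≤ δ`, elements of one cell satisfy `m' ≤ (1 + 2δ) m`. [folklore] -/
theorem cell_spread_rel {lo X : ℕ} {δ : ℝ} (hδ : 0 ≤ δ) {i m m' : ℕ}
    (hm : m ∈ Ioc (bp lo X (1 + δ) i) (bp lo X (1 + δ) (i + 1)))
    (hm' : m' ∈ Ioc (bp lo X (1 + δ) i) (bp lo X (1 + δ) (i + 1))) :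
    (m' : ℝ) ≤ (1 + 2 * δ) * m := by
  have h := cell_spread (by linarith) hm hm'
  have hm1 : (1 : ℝ) ≤ m := by
    have : bp lo X (1 + δ) i < m := (Finset.mem_Ioc.1 hm).1
    exact_mod_cast Nat.one_le_of_lt this
  nlinarith

/-! ### One reduction term over a switched piece: corners and ambiguous ranges -/

/-- The reduced coefficient `l̃ = l D_m D_n / E`. [folklore] -/
def lred (a : ℤ) (d g : ℕ) (t : ℤ × ℕ × ℕ) (l : ℕ) : ℕ := l * t.2.1 * t.2.2 / Ea a d g

/-- The upper inside breakpoint `S₂ = (K₋ − 1)/(Q' g r₊)`. [folklore] -/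
def bpS2 (Q' g rp Km : ℕ) : ℕ := (Km - 1) / (Q' * g * rp)

/-- The lower inside breakpoint minus one, `S₁ − 1 = ⌈K₊/(2Q' g r₋)⌉ − 1`. [folklore] -/
def bpS1 (Q' g rm Kp : ℕ) : ℕ := (Kp + 2 * (Q' * g * rm) - 1) / (2 * (Q' * g * rm)) - 1

/-- `K₋` of a product cell from the `l`-, `m''`-, `n''`-cells. [folklore] -/
def KmCell (a : ℤ) (Dm Dn lm mi nj : ℕ) : ℕ := cellK (lm * Dm * Dn) a (mi + 1) (nj + 1)

/-- `K₊` of a product cell. [folklore] -/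
def KpCell (a : ℤ) (Dm Dn lp mi' nj' : ℕ) : ℕ := cellK (lp * Dm * Dn) a mi' nj'

/-- The four corner instances of `Δ*` of the reduced data attached to a product cell and an
`s'`-endpoint `S•`: ranges `[1, m•] × [1, n•] × [1, L D_m D_n] × [1, S•] × [1, P r₊]`. [folklore] -/
def cornerDS (ared : ℤ) (z : ℝ) (m₁ m₂ n₁ n₂ L₁ Sb Rb : ℕ) : ℝ :=
  deltaStarSets ared z (Icc 1 m₂) (Icc 1 n₂) (Icc 1 L₁) (Icc 1 Sb) (Icc 1 Rb) +
    deltaStarSets ared z (Icc 1 m₁) (Icc 1 n₂) (Icc 1 L₁) (Icc 1 Sb) (Icc 1 Rb) +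
    deltaStarSets ared z (Icc 1 m₂) (Icc 1 n₁) (Icc 1 L₁) (Icc 1 Sb) (Icc 1 Rb) +
    deltaStarSets ared z (Icc 1 m₁) (Icc 1 n₁) (Icc 1 L₁) (Icc 1 Sb) (Icc 1 Rb)

/-- `cornerDS ≥ 0`. [folklore] -/
theorem cornerDS_nonneg (ared : ℤ) (z : ℝ) (m₁ m₂ n₁ n₂ L₁ Sb Rb : ℕ) : 0 ≤ cornerDS ared z m₁ m₂ n₁ n₂ L₁ Sb Rb := by
  unfold cornerDS
  have h := deltaStarSets_nonneg ared z
  exact add_nonneg (add_nonneg (add_nonneg (h _ _ _ _ _) (h _ _ _ _ _)) (h _ _ _ _ _)) (h _ _ _ _ _)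

/-- **Corners of one cell of `(r, l)` embed into `Δ*` of the reduced data.**  For an `r`-cell `C_r`
(elements `≤ r₊`) and a set `C_l` of `l` with a common profile and `E ∣ l D_m D_n`, weights `w ≤ 1`
vanishing unless `(r, a) = (l, r) = 1`, `(l̃, P) = 1` and `l, D_m, D_n` are `z`-rough:
`∑_{r ∈ C_r} ∑_{l ∈ C_l} w(r,l) corners4(ã, …, S•, P r, l̃) ≤ cornerDS(ã, …, L D_m D_n, S•, P r₊)`.
[cite: BombieriFriedlanderIwaniecActa1986, §13 p. 241–242] -/
theorem sum_corners4_le_cornerDS {a : ℤ} (ha : a ≠ 0) (z : ℝ) {d g L : ℕ} (hd : d ∣ a.natAbs)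
    (hgΘ : g ∣ ThetaD a.natAbs d) (prof : ℕ → ℕ) {t : ℤ × ℕ × ℕ} (ht : t ∈ Tsel a d g prof)
    (Cr Cl : Finset ℕ) {rp : ℕ} (hCr : ∀ r ∈ Cr, 0 < r ∧ r ≤ rp)
    (hCl : ∀ l ∈ Cl, 0 < l ∧ l ≤ L ∧ profOf a l = prof)
    (w : ℕ → ℕ → ℝ) (hw1 : ∀ r l, w r l ≤ 1)
    (hw : ∀ r ∈ Cr, ∀ l ∈ Cl, w r l ≠ 0 →
      r.Coprime a.natAbs ∧ l.Coprime r ∧ (lred a d g t l).Coprime (Pa a d g) ∧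
        roughIndicator z l = 1 ∧ roughIndicator z t.2.1 = 1 ∧ roughIndicator z t.2.2 = 1)
    (m₁ m₂ n₁ n₂ Sb : ℕ) :
    ∑ r ∈ Cr, ∑ l ∈ Cl, w r l * corners4 (a / (Ea a d g : ℤ)) z m₁ m₂ n₁ n₂ Sb (Pa a d g * r) (lred a d g t l) ≤
      cornerDS (a / (Ea a d g : ℤ)) z m₁ m₂ n₁ n₂ (L * t.2.1 * t.2.2) Sb (Pa a d g * rp) := by
  classical
  set ared := a / (Ea a d g : ℤ) with hared
  obtain ⟨-, hterms, hident⟩ := Tsel_spec ha hd hgΘ prof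
  obtain ⟨-, hDm, hDn, -⟩ := hterms t ht
  have hP : 0 < Pa a d g := Pa_pos a d g
  have hE : 0 < Ea a d g := Ea_pos a d g
  -- `E ∣ l Dm Dn` for `l ∈ Cl`
  have hEdvd : ∀ l ∈ Cl, Ea a d g ∣ l * t.2.1 * t.2.2 := by
    intro l hl
    obtain ⟨hl0, -, hprof⟩ := hCl l hl
    obtain ⟨h1, -⟩ := hident l hl0 (fun p hp => by rw [← hprof]; exact profOf_apply_of_mem hp)
    exact h1 t ht
  -- injectivity of the relabellings
  have hinjr : Set.InjOn (fun r => Pa a d g * r) (Cr : Set ℕ) := by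
    intro r₁ _ r₂ _ h; exact Nat.eq_of_mul_eq_mul_left hP h
  have hinjl : Set.InjOn (lred a d g t) (Cl : Set ℕ) := by
    intro l₁ hl₁ l₂ hl₂ h
    simp only [lred] at h
    have h1 := Nat.div_mul_cancel (hEdvd l₁ hl₁)
    have h2 := Nat.div_mul_cancel (hEdvd l₂ hl₂)
    have : l₁ * t.2.1 * t.2.2 = l₂ * t.2.1 * t.2.2 := by rw [← h1, ← h2, h]
    have hDD : 0 < t.2.1 * t.2.2 := Nat.mul_pos hDm hDn
    rw [mul_assoc, mul_assoc] at this
    exact Nat.eq_of_mul_eq_mul_right hDD this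
  -- the conditions of the embedding
  have hcond : ∀ r ∈ Cr, ∀ l ∈ Cl, w r l ≠ 0 →
      IsCoprime (((Pa a d g * r : ℕ) : ℕ) : ℤ) ared ∧ (lred a d g t l).Coprime (Pa a d g * r) ∧
        roughIndicator z (lred a d g t l) = 1 := by
    intro r hr l hl hwne
    obtain ⟨hrA, hlr, hcop, hρl, hρm, hρn⟩ := hw r hr l hl hwne
    obtain ⟨hl0, -, hprof⟩ := hCl l hl
    refine ⟨?_, ?_, ?_⟩
    · rw [Int.isCoprime_iff_gcd_eq_one, Int.gcd_comm, Int.gcd_eq_natAbs, Int.natAbs_natCast]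
      exact coprime_ared_Pa_mul ha d g hrA
    · have ht' : t ∈ Tsel a d g (profOf a l) := by rw [hprof]; exact ht
      exact Nat.Coprime.mul_right hcop (coprime_lred ha hd hgΘ hl0 ht' hrA hlr)
    · -- `l̃ ∣ l Dm Dn`, which is `z`-rough
      have hlDD : l * t.2.1 * t.2.2 ≠ 0 := (Nat.mul_pos (Nat.mul_pos hl0 hDm) hDn).ne'
      have hrough : roughIndicator z (l * t.2.1 * t.2.2) = 1 := by
        rw [roughIndicator_mul (Nat.mul_pos hl0 hDm).ne' hDn.ne', roughIndicator_mul hl0.ne' hDm.ne',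
          hρl, hρm, hρn]; ring
      exact roughIndicator_of_dvd hlDD (Nat.div_dvd_of_dvd (hEdvd l hl)) z hrough
  -- images of the relabellings
  have himgr : Cr.image (fun r => Pa a d g * r) ⊆ Icc 1 (Pa a d g * rp) := by
    intro r' hr'
    rw [Finset.mem_image] at hr'
    obtain ⟨r, hr, rfl⟩ := hr'
    obtain ⟨hr0, hrle⟩ := hCr r hr
    rw [Finset.mem_Icc]
    exact ⟨Nat.mul_pos hP hr0, Nat.mul_le_mul_left _ hrle⟩
  have himgl : Cl.image (lred a d g t) ⊆ Icc 1 (L * t.2.1 * t.2.2) := by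
    intro l' hl'
    rw [Finset.mem_image] at hl'
    obtain ⟨l, hl, rfl⟩ := hl'
    obtain ⟨hl0, hlL, -⟩ := hCl l hl
    rw [Finset.mem_Icc]
    constructor
    · simp only [lred]
      exact Nat.div_pos (Nat.le_of_dvd (Nat.mul_pos (Nat.mul_pos hl0 hDm) hDn) (hEdvd l hl)) hE
    · simp only [lred]
      exact (Nat.div_le_self _ _).trans (Nat.mul_le_mul (Nat.mul_le_mul_right _ hlL) le_rfl)
  -- one corner
  have one : ∀ mb nb : ℕ, ∑ r ∈ Cr, ∑ l ∈ Cl, w r l *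
      |setQSum ared z (Icc 1 mb) (Icc 1 nb) (Icc 1 Sb) (Pa a d g * r) (lred a d g t l)| ≤
      deltaStarSets ared z (Icc 1 mb) (Icc 1 nb) (Icc 1 (L * t.2.1 * t.2.2)) (Icc 1 Sb) (Icc 1 (Pa a d g * rp)) := by
    intro mb nb
    refine (sum_mul_abs_setQSum_le_deltaStarSets ared z (Icc 1 mb) (Icc 1 nb) (Icc 1 Sb) Cr Cl
      (fun r => Pa a d g * r) (lred a d g t) w hinjr hinjl hw1 hcond).trans ?_
    exact deltaStarSets_mono ared z _ _ _ himgl himgr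
  unfold corners4 cornerDS
  simp only [mul_add, Finset.sum_add_distrib]
  linarith [one m₂ n₂, one m₁ n₂, one m₂ n₁, one m₁ n₁]

/-! ### The cell data of a switched piece -/

/-- Breakpoints of the `m''`-cells of the piece `(mlo, M']` for the reduction term `t`. [folklore] -/
def bpM (mlo M' : ℕ) (t : ℤ × ℕ × ℕ) (β : ℝ) (i : ℕ) : ℕ := bp (mlo / t.2.1) (M' / t.2.1) β i

/-- Breakpoints of the `n''`-cells. [folklore] -/
def bpN (nlo N' : ℕ) (t : ℤ × ℕ × ℕ) (β : ℝ) (j : ℕ) : ℕ := bp (nlo / t.2.2) (N' / t.2.2) β j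

/-- `K₋` of the product cell `(κ, i, j)`. [folklore] -/
def KmOf (a : ℤ) (mlo M' nlo N' L : ℕ) (t : ℤ × ℕ × ℕ) (β : ℝ) (κ i j : ℕ) : ℕ :=
  cellK ((bp 0 L β κ + 1) * t.2.1 * t.2.2) a (bpM mlo M' t β i + 1) (bpN nlo N' t β j + 1)

/-- `K₊` of the product cell `(κ, i, j)`. [folklore] -/
def KpOf (a : ℤ) (mlo M' nlo N' L : ℕ) (t : ℤ × ℕ × ℕ) (β : ℝ) (κ i j : ℕ) : ℕ :=
  cellK (bp 0 L β (κ + 1) * t.2.1 * t.2.2) a (bpM mlo M' t β (i + 1)) (bpN nlo N' t β (j + 1))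

/-- The weight of `(r, l)` in the reduction term `t`: `ρ(l) ρ(D_m) ρ(D_n) [(l̃, P) = 1]`. [folklore] -/
def wRL (a : ℤ) (z : ℝ) (d g : ℕ) (t : ℤ × ℕ × ℕ) (l : ℕ) : ℝ :=
  roughIndicator z l * (roughIndicator z t.2.1 * roughIndicator z t.2.2) *
    (if (lred a d g t l).Coprime (Pa a d g) then 1 else 0)

/-- `0 ≤ wRL ≤ 1`. [folklore] -/
theorem wRL_mem (a : ℤ) (z : ℝ) (d g : ℕ) (t : ℤ × ℕ × ℕ) (l : ℕ) :
    0 ≤ wRL a z d g t l ∧ wRL a z d g t l ≤ 1 := by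
  unfold wRL
  have h1 := roughIndicator_nonneg z l
  have h2 := roughIndicator_nonneg z t.2.1
  have h3 := roughIndicator_nonneg z t.2.2
  have h1' := roughIndicator_le_one' z l
  have h2' := roughIndicator_le_one' z t.2.1
  have h3' := roughIndicator_le_one' z t.2.2
  constructor
  · split_ifs <;> positivity
  · split_ifs
    · rw [mul_one]
      exact mul_le_one₀ h1' (mul_nonneg h2 h3) (mul_le_one₀ h2' h3 h3')
    · rw [mul_zero]; norm_num

/-- The corner instances of the product cell `(k, κ, i, j)` (both `s'`-endpoints). [folklore] -/
def cornersOf (a : ℤ) (z : ℝ) (mlo M' nlo N' L Q' rlo R d g : ℕ) (t : ℤ × ℕ × ℕ) (β : ℝ) (k κ i j : ℕ) : ℝ :=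
  cornerDS (a / (Ea a d g : ℤ)) z (bpM mlo M' t β i) (bpM mlo M' t β (i + 1)) (bpN nlo N' t β j) (bpN nlo N' t β (j + 1))
      (L * t.2.1 * t.2.2) (bpS2 Q' g (bp rlo R β (k + 1)) (KmOf a mlo M' nlo N' L t β κ i j))
      (Pa a d g * bp rlo R β (k + 1)) +
    cornerDS (a / (Ea a d g : ℤ)) z (bpM mlo M' t β i) (bpM mlo M' t β (i + 1)) (bpN nlo N' t β j) (bpN nlo N' t β (j + 1))
      (L * t.2.1 * t.2.2) (bpS1 Q' g (bp rlo R β k + 1) (KpOf a mlo M' nlo N' L t β κ i j))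
      (Pa a d g * bp rlo R β (k + 1))

/-- The ambiguous contribution of `(r, l)` in the product cell `(k, κ, i, j)`. [folklore] -/
def ambOf (a : ℤ) (z : ℝ) (mlo M' nlo N' L Q' rlo R S d g : ℕ) (t : ℤ × ℕ × ℕ) (β : ℝ) (k κ i j r l : ℕ) : ℝ :=
  ambCell (a / (Ea a d g : ℤ)) z (bpM mlo M' t β i) (bpM mlo M' t β (i + 1)) (bpN nlo N' t β j) (bpN nlo N' t β (j + 1))
    (lred a d g t l) (l * t.2.1 * t.2.2) (Pa a d g * r) (S / g)
    (KmOf a mlo M' nlo N' L t β κ i j) (KpOf a mlo M' nlo N' L t β κ i j)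
    (Q' * g * (bp rlo R β k + 1)) (Q' * g * bp rlo R β (k + 1))
    (fun s' => a + (Q' : ℤ) * r * ((g * s' : ℕ) : ℤ)) (fun s' => a + 2 * (Q' : ℤ) * r * ((g * s' : ℕ) : ℤ))

/-- `ambOf ≥ 0`. [folklore] -/
theorem ambOf_nonneg (a : ℤ) (z : ℝ) (mlo M' nlo N' L Q' rlo R S d g : ℕ) (t : ℤ × ℕ × ℕ) (β : ℝ) (k κ i j r l : ℕ) :
    0 ≤ ambOf a z mlo M' nlo N' L Q' rlo R S d g t β k κ i j r l := by
  unfold ambOf; exact ambCell_nonneg _ _ _ _ _ _ _ _ _ _ _ _ _ _ _ _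

set_option maxHeartbeats 800000 in
/-- **One `(r, l)` of a switched piece, one reduction term**: for `r` in the `r`-cell `k` and `l` in the
`l`-cell `κ`, `ρ(l)ρ(D_m)ρ(D_n) |X_t(r,l)| ≤ w(r,l) ∑_{i,j} (corners4(S₂) + corners4(S₁−1) + ambiguous)`
with the cell data above (`w = ρρρ [(l̃,P)=1]`). [cite: BombieriFriedlanderIwaniecActa1986, §13 p. 241–242] -/
theorem weight_abs_Xred_le {a : ℤ} (ha : a ≠ 0) (z : ℝ) {mlo M' nlo N' L Q' rlo R S d g : ℕ}
    (hd : d ∣ a.natAbs) (hgΘ : g ∣ ThetaD a.natAbs d) {prof : ℕ → ℕ} {t : ℤ × ℕ × ℕ}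
    (ht : t ∈ Tsel a d g prof) (hQ' : 0 < Q') {β : ℝ} (hβ : 1 ≤ β) {J : ℕ}
    (hmlo : mlo ≤ M') (hnlo : nlo ≤ N')
    (hJM : bpM mlo M' t β J = M' / t.2.1) (hJN : bpN nlo N' t β J = N' / t.2.2)
    (hpos : a < (((mlo + 1) * (nlo + 1) : ℕ) : ℤ))
    (hS : L * (M' + t.2.1) * (N' + t.2.2) + a.natAbs ≤ S)
    {k κ r l : ℕ} (hr : r ∈ Ioc (bp rlo R β k) (bp rlo R β (k + 1)))
    (hl : l ∈ Ioc (bp 0 L β κ) (bp 0 L β (κ + 1))) (hlL : l ≤ L) (hprof : profOf a l = prof)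
    (hrA : r.Coprime a.natAbs) (hlr : l.Coprime r) :
    roughIndicator z l * (roughIndicator z t.2.1 * roughIndicator z t.2.2) *
        |Xred a z (Ioc mlo M') (Ioc nlo N') l r Q' S d g t| ≤
      wRL a z d g t l * ∑ i ∈ range J, ∑ j ∈ range J,
        (corners4 (a / (Ea a d g : ℤ)) z (bpM mlo M' t β i) (bpM mlo M' t β (i + 1)) (bpN nlo N' t β j) (bpN nlo N' t β (j + 1))
            (bpS2 Q' g (bp rlo R β (k + 1)) (KmOf a mlo M' nlo N' L t β κ i j)) (Pa a d g * r) (lred a d g t l) +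
          corners4 (a / (Ea a d g : ℤ)) z (bpM mlo M' t β i) (bpM mlo M' t β (i + 1)) (bpN nlo N' t β j) (bpN nlo N' t β (j + 1))
            (bpS1 Q' g (bp rlo R β k + 1) (KpOf a mlo M' nlo N' L t β κ i j)) (Pa a d g * r) (lred a d g t l) +
          ambOf a z mlo M' nlo N' L Q' rlo R S d g t β k κ i j r l) := by
  obtain ⟨-, hterms, -⟩ := Tsel_spec ha hd hgΘ prof
  obtain ⟨-, hDm, hDn, -⟩ := hterms t ht
  have hl0 : 0 < l := by have := (Finset.mem_Ioc.1 hl).1; omega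
  have hg : 0 < g := Nat.pos_of_ne_zero fun h =>
    (ThetaD_pos a.natAbs d).ne' (by rw [h, zero_dvd_iff] at hgΘ; exact hgΘ)
  have hrcell := Finset.mem_Ioc.1 hr
  have hlcell := Finset.mem_Ioc.1 hl
  unfold wRL
  by_cases hcop : (lred a d g t l).Coprime (Pa a d g)
  swap
  · -- the reduced sum vanishes
    rw [if_neg hcop, mul_zero, zero_mul]
    have : Xred a z (Ioc mlo M') (Ioc nlo N') l r Q' S d g t = 0 :=
      Xred_eq_zero_of_not_coprime ha z _ _ l r Q' S d g t hcop
    rw [this, abs_zero, mul_zero]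
  rw [if_pos hcop, mul_one]
  refine mul_le_mul_of_nonneg_left ?_ (mul_nonneg (roughIndicator_nonneg z l)
    (mul_nonneg (roughIndicator_nonneg z _) (roughIndicator_nonneg z _)))
  -- the lower corners of the cells dominate `(mlo + 1)(nlo + 1) > a`
  have hmcell : ∀ i, mlo + 1 ≤ t.2.1 * (bpM mlo M' t β i + 1) := by
    intro i
    have h1 : mlo / t.2.1 ≤ bpM mlo M' t β i := by unfold bpM; exact (bp_bounds _ _ _ _).1
    have h2 : mlo < t.2.1 * (mlo / t.2.1 + 1) := by
      have h := Nat.lt_div_mul_add (a := mlo) hDm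
      have e : mlo / t.2.1 * t.2.1 + t.2.1 = t.2.1 * (mlo / t.2.1 + 1) := by ring
      rw [e] at h; exact h
    exact (Nat.succ_le_of_lt h2).trans (Nat.mul_le_mul_left _ (by omega))
  have hncell : ∀ j, nlo + 1 ≤ t.2.2 * (bpN nlo N' t β j + 1) := by
    intro j
    have h1 : nlo / t.2.2 ≤ bpN nlo N' t β j := by unfold bpN; exact (bp_bounds _ _ _ _).1
    have h2 : nlo < t.2.2 * (nlo / t.2.2 + 1) := by
      have h := Nat.lt_div_mul_add (a := nlo) hDn
      have e : nlo / t.2.2 * t.2.2 + t.2.2 = t.2.2 * (nlo / t.2.2 + 1) := by ring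
      rw [e] at h; exact h
    exact (Nat.succ_le_of_lt h2).trans (Nat.mul_le_mul_left _ (by omega))
  have hprod : ∀ i j, (mlo + 1) * (nlo + 1) ≤
      (bp 0 L β κ + 1) * (t.2.1 * t.2.2) * (bpM mlo M' t β i + 1) * (bpN nlo N' t β j + 1) := by
    intro i j
    calc (mlo + 1) * (nlo + 1) ≤ (t.2.1 * (bpM mlo M' t β i + 1)) * (t.2.2 * (bpN nlo N' t β j + 1)) :=
          Nat.mul_le_mul (hmcell i) (hncell j)
      _ = 1 * (t.2.1 * t.2.2) * (bpM mlo M' t β i + 1) * (bpN nlo N' t β j + 1) := by ring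
      _ ≤ (bp 0 L β κ + 1) * (t.2.1 * t.2.2) * (bpM mlo M' t β i + 1) * (bpN nlo N' t β j + 1) := by
          gcongr; omega
  have hposK : ∀ i j, a < ((((bp 0 L β κ + 1) * (t.2.1 * t.2.2) * (bpM mlo M' t β i + 1) * (bpN nlo N' t β j + 1) : ℕ)) : ℤ) := by
    intro i j
    have : (((mlo + 1) * (nlo + 1) : ℕ) : ℤ) ≤
        ((((bp 0 L β κ + 1) * (t.2.1 * t.2.2) * (bpM mlo M' t β i + 1) * (bpN nlo N' t β j + 1) : ℕ)) : ℤ) := by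
      exact_mod_cast hprod i j
    linarith
  -- `K₋` as an integer, `1 ≤ K₋ ≤ S`
  have hKmcast : ∀ i j, ((KmOf a mlo M' nlo N' L t β κ i j : ℕ) : ℤ) =
      ((((bp 0 L β κ + 1) * t.2.1 * t.2.2 * (bpM mlo M' t β i + 1) * (bpN nlo N' t β j + 1) : ℕ)) : ℤ) - a := by
    intro i j
    unfold KmOf
    rw [cellK_cast]
    have := hposK i j
    have e : (bp 0 L β κ + 1) * t.2.1 * t.2.2 * (bpM mlo M' t β i + 1) * (bpN nlo N' t β j + 1) =
        (bp 0 L β κ + 1) * (t.2.1 * t.2.2) * (bpM mlo M' t β i + 1) * (bpN nlo N' t β j + 1) := by ring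
    rw [e]; exact this.le
  have hKm1 : ∀ i j, 1 ≤ KmOf a mlo M' nlo N' L t β κ i j := by
    intro i j
    have h := hKmcast i j
    have h2 := hposK i j
    have e : ((((bp 0 L β κ + 1) * t.2.1 * t.2.2 * (bpM mlo M' t β i + 1) * (bpN nlo N' t β j + 1) : ℕ)) : ℤ) =
        ((((bp 0 L β κ + 1) * (t.2.1 * t.2.2) * (bpM mlo M' t β i + 1) * (bpN nlo N' t β j + 1) : ℕ)) : ℤ) := by
      push_cast; ring
    have : (1 : ℤ) ≤ (KmOf a mlo M' nlo N' L t β κ i j : ℤ) := by rw [h, e]; linarith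
    exact_mod_cast this
  have hKmS : ∀ i j, KmOf a mlo M' nlo N' L t β κ i j ≤ S := by
    intro i j
    -- `K₋ ≤ product + |a| ≤ L (M' + Dm)(N' + Dn) + |a| ≤ S`
    have hlL' : bp 0 L β κ + 1 ≤ L := by have := hlcell.1; omega
    have hM : t.2.1 * (bpM mlo M' t β i + 1) ≤ M' + t.2.1 := by
      have h1 : bpM mlo M' t β i ≤ max (mlo / t.2.1) (M' / t.2.1) := by unfold bpM; exact (bp_bounds _ _ _ _).2
      rw [max_eq_right (Nat.div_le_div_right hmlo)] at h1
      have h3 : t.2.1 * (M' / t.2.1) ≤ M' := Nat.mul_div_le M' t.2.1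
      calc t.2.1 * (bpM mlo M' t β i + 1) = t.2.1 * bpM mlo M' t β i + t.2.1 := by ring
        _ ≤ t.2.1 * (M' / t.2.1) + t.2.1 := by gcongr
        _ ≤ M' + t.2.1 := by omega
    have hN : t.2.2 * (bpN nlo N' t β j + 1) ≤ N' + t.2.2 := by
      have h1 : bpN nlo N' t β j ≤ max (nlo / t.2.2) (N' / t.2.2) := by unfold bpN; exact (bp_bounds _ _ _ _).2
      rw [max_eq_right (Nat.div_le_div_right hnlo)] at h1
      have h3 : t.2.2 * (N' / t.2.2) ≤ N' := Nat.mul_div_le N' t.2.2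
      calc t.2.2 * (bpN nlo N' t β j + 1) = t.2.2 * bpN nlo N' t β j + t.2.2 := by ring
        _ ≤ t.2.2 * (N' / t.2.2) + t.2.2 := by gcongr
        _ ≤ N' + t.2.2 := by omega
    have hP : (bp 0 L β κ + 1) * t.2.1 * t.2.2 * (bpM mlo M' t β i + 1) * (bpN nlo N' t β j + 1) ≤
        L * (M' + t.2.1) * (N' + t.2.2) := by
      calc (bp 0 L β κ + 1) * t.2.1 * t.2.2 * (bpM mlo M' t β i + 1) * (bpN nlo N' t β j + 1)
          = (bp 0 L β κ + 1) * (t.2.1 * (bpM mlo M' t β i + 1)) * (t.2.2 * (bpN nlo N' t β j + 1)) := by ring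
        _ ≤ L * (M' + t.2.1) * (N' + t.2.2) := Nat.mul_le_mul (Nat.mul_le_mul hlL' hM) hN
    have h : ((KmOf a mlo M' nlo N' L t β κ i j : ℕ) : ℤ) ≤ (S : ℤ) := by
      rw [hKmcast]
      have hP' : ((((bp 0 L β κ + 1) * t.2.1 * t.2.2 * (bpM mlo M' t β i + 1) * (bpN nlo N' t β j + 1) : ℕ)) : ℤ) ≤
          ((L * (M' + t.2.1) * (N' + t.2.2) : ℕ) : ℤ) := by exact_mod_cast hP
      have hS' : ((L * (M' + t.2.1) * (N' + t.2.2) : ℕ) : ℤ) + (a.natAbs : ℤ) ≤ S := by exact_mod_cast hS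
      have ha' : -a ≤ (a.natAbs : ℤ) := by
        have := Int.le_natAbs (a := -a); rwa [Int.natAbs_neg] at this
      linarith
    exact_mod_cast h
  -- the cell lemma
  have hmain := abs_Xred_le_sum_cells ha z (M₁ := mlo) (M₂ := M') (N₁ := nlo) (N₂ := N') hd hgΘ hl0
    (by rw [hprof]; exact ht) hQ' hrA hlr (rm := bp rlo R β k + 1) (rp := bp rlo R β (k + 1)) (by omega)
    ⟨hrcell.1, hrcell.2⟩ (bm := bpM mlo M' t β) (bn := bpN nlo N' t β)
    (fun i j hij => by unfold bpM; exact bp_mono _ _ hβ hij) (fun i j hij => by unfold bpN; exact bp_mono _ _ hβ hij)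
    (Jm := J) (Jn := J) (by unfold bpM; exact bp_zero _ _ _) hJM (by unfold bpN; exact bp_zero _ _ _) hJN
    (Km := KmOf a mlo M' nlo N' L t β κ) (Kp := KpOf a mlo M' nlo N' L t β κ) hKm1
    (fun i j m hm n hn => by
      obtain ⟨K, hK, hK1, hK2⟩ := exists_K_of_mem_cell (D := t.2.1 * t.2.2) (a := a)
        (lm := bp 0 L β κ + 1) (lp := bp 0 L β (κ + 1)) ⟨hlcell.1, hlcell.2⟩ hm hn (hposK i j)
      refine ⟨K, ?_, ?_, ?_⟩
      · rw [← hK]; push_cast; ring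
      · unfold KmOf; simpa [mul_assoc] using hK1
      · unfold KpOf; simpa [mul_assoc] using hK2)
    (fun i j => by
      have hrp : 0 < bp rlo R β (k + 1) := by omega
      calc (KmOf a mlo M' nlo N' L t β κ i j - 1) / (Q' * g * bp rlo R β (k + 1))
          ≤ S / (Q' * g * bp rlo R β (k + 1)) := Nat.div_le_div_right (by have := hKmS i j; omega)
        _ ≤ S / g := Nat.div_le_div_left (by
            calc g = 1 * g * 1 := by ring
              _ ≤ Q' * g * bp rlo R β (k + 1) := Nat.mul_le_mul (Nat.mul_le_mul_right _ hQ') hrp) hg)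
  simp only [ambOf, lred] at hmain ⊢
  exact hmain

/-! ### Profiles as value lists (decidable grouping of `l`) -/

/-- The profile of `l` as the list of its values on the primes of `a`. [folklore] -/
def profVec (a : ℤ) (l : ℕ) : List ℕ := (psA a).map (profOf a l)

/-- The profile function attached to a value list: the listed value at the primes of `a`, `0` elsewhere.
[folklore] -/
def profFun (a : ℤ) (v : List ℕ) : ℕ → ℕ := fun p => (((psA a).zip v).lookup p).getD 0

/-- `lookup` in the graph of a function. [folklore] -/
theorem lookup_map_graph (f : ℕ → ℕ) (p : ℕ) : ∀ L : List ℕ,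
    ((L.map (fun q => (q, f q))).lookup p) = if p ∈ L then some (f p) else none := by
  intro L
  induction L with
  | nil => simp
  | cons q L ih =>
    simp only [List.map_cons, List.lookup_cons, List.mem_cons]
    by_cases hpq : p = q
    · subst hpq; simp
    · have : (p == q) = false := beq_false_of_ne hpq
      rw [this]
      simp only [ih, hpq, false_or]

/-- `L.zip (L.map f)` is the graph of `f` on `L`. [folklore] -/
theorem zip_map_self_eq_graph (f : ℕ → ℕ) : ∀ L : List ℕ, L.zip (L.map f) = L.map (fun q => (q, f q)) := by
  intro L
  induction L with
  | nil => simp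
  | cons q L ih => simp [ih]

/-- **`profFun a (profVec a l) = profOf a l`**: the value list determines the profile. [folklore] -/
theorem profFun_profVec (a : ℤ) (l : ℕ) : profFun a (profVec a l) = profOf a l := by
  funext p
  unfold profFun profVec
  rw [zip_map_self_eq_graph, lookup_map_graph]
  by_cases hp : p ∈ psA a
  · rw [if_pos hp]; rfl
  · rw [if_neg hp]
    unfold profOf
    rw [if_neg (fun h => hp (mem_psA.2 h))]
    rfl

/-- Sum over a filtered `Ioc (b 0) (b J)` as a sum over filtered cells. [folklore] -/
theorem sum_filter_Ioc_eq_sum_cells {b : ℕ → ℕ} (hb : Monotone b) (P : ℕ → Prop) [DecidablePred P]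
    (f : ℕ → ℝ) (J : ℕ) :
    ∑ m ∈ (Ioc (b 0) (b J)).filter P, f m = ∑ i ∈ range J, ∑ m ∈ (Ioc (b i) (b (i + 1))).filter P, f m := by
  rw [Finset.sum_filter, sum_Ioc_eq_sum_cells hb _ J]
  exact Finset.sum_congr rfl fun i _ => (Finset.sum_filter _ _).symm

/-- `wRL ≠ 0` forces `l, D_m, D_n` rough and `(l̃, P) = 1`. [folklore] -/
theorem wRL_ne_zero {a : ℤ} {z : ℝ} {d g : ℕ} {t : ℤ × ℕ × ℕ} {l : ℕ} (h : wRL a z d g t l ≠ 0) :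
    (lred a d g t l).Coprime (Pa a d g) ∧ roughIndicator z l = 1 ∧ roughIndicator z t.2.1 = 1 ∧
      roughIndicator z t.2.2 = 1 := by
  unfold wRL at h
  by_cases hc : (lred a d g t l).Coprime (Pa a d g)
  · refine ⟨hc, ?_, ?_, ?_⟩
    · rcases roughIndicator_eq_zero_or_one z l with h0 | h0
      · rw [h0] at h; simp at h
      · exact h0
    · rcases roughIndicator_eq_zero_or_one z t.2.1 with h0 | h0
      · rw [h0] at h; simp at h
      · exact h0
    · rcases roughIndicator_eq_zero_or_one z t.2.2 with h0 | h0
      · rw [h0] at h; simp at h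
      · exact h0
  · rw [if_neg hc] at h; simp at h

/-- The total ambiguous contribution of the reduction term `t` over the switched piece. [folklore] -/
def ambTotal (a : ℤ) (z : ℝ) (mlo M' nlo N' L Q' rlo R S d g : ℕ) (t : ℤ × ℕ × ℕ) (v : List ℕ) (β : ℝ) (J : ℕ) : ℝ :=
  ∑ k ∈ range J, ∑ κ ∈ range J,
    ∑ r ∈ (Ioc (bp rlo R β k) (bp rlo R β (k + 1))).filter (fun r : ℕ => IsCoprime (r : ℤ) a),
      ∑ l ∈ (Ioc (bp 0 L β κ) (bp 0 L β (κ + 1))).filter (fun l : ℕ => l.Coprime r ∧ profVec a l = v),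
        wRL a z d g t l * ∑ i ∈ range J, ∑ j ∈ range J, ambOf a z mlo M' nlo N' L Q' rlo R S d g t β k κ i j r l

set_option maxHeartbeats 800000 in
/-- **One reduction term over a switched piece**: the weighted sum over `(r, l)` of `|X_t(r,l)|` is at
most the corner instances of `Δ*` of the reduced data over all product cells plus the total ambiguous
contribution. [cite: BombieriFriedlanderIwaniecActa1986, §13 p. 241–242] -/
theorem sum_weight_abs_Xred_le {a : ℤ} (ha : a ≠ 0) (z : ℝ) {mlo M' nlo N' L Q' rlo R S d g : ℕ}
    (hd : d ∣ a.natAbs) (hgΘ : g ∣ ThetaD a.natAbs d) (v : List ℕ) {t : ℤ × ℕ × ℕ}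
    (ht : t ∈ Tsel a d g (profFun a v)) (hQ' : 0 < Q') {β : ℝ} (hβ : 1 ≤ β) {J : ℕ}
    (hmlo : mlo ≤ M') (hnlo : nlo ≤ N')
    (hJM : bpM mlo M' t β J = M' / t.2.1) (hJN : bpN nlo N' t β J = N' / t.2.2)
    (hJR : bp rlo R β J = R) (hJL : bp 0 L β J = L)
    (hpos : a < (((mlo + 1) * (nlo + 1) : ℕ) : ℤ))
    (hS : L * (M' + t.2.1) * (N' + t.2.2) + a.natAbs ≤ S) :
    ∑ r ∈ (Ioc rlo R).filter (fun r : ℕ => IsCoprime (r : ℤ) a),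
      ∑ l ∈ (Icc 1 L).filter (fun l : ℕ => l.Coprime r ∧ profVec a l = v),
        roughIndicator z l * (roughIndicator z t.2.1 * roughIndicator z t.2.2) *
          |Xred a z (Ioc mlo M') (Ioc nlo N') l r Q' S d g t| ≤
      (∑ k ∈ range J, ∑ κ ∈ range J, ∑ i ∈ range J, ∑ j ∈ range J,
        cornersOf a z mlo M' nlo N' L Q' rlo R d g t β k κ i j) +
      ambTotal a z mlo M' nlo N' L Q' rlo R S d g t v β J := by
  set prof := profFun a v with hprofdef
  have hprofv : ∀ l : ℕ, profVec a l = v → profOf a l = prof := by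
    intro l hl; rw [hprofdef, ← hl, profFun_profVec]
  classical
  have hbR : Monotone (bp rlo R β) := bp_mono _ _ hβ
  have hbL : Monotone (bp 0 L β) := bp_mono _ _ hβ
  -- split `r` and `l` into cells
  have hIocR : Ioc rlo R = Ioc (bp rlo R β 0) (bp rlo R β J) := by rw [bp_zero, hJR]
  have hIccL : Icc 1 L = Ioc (bp 0 L β 0) (bp 0 L β J) := by
    rw [bp_zero, hJL]; ext l; simp only [Finset.mem_Icc, Finset.mem_Ioc]; omega
  rw [hIocR, sum_filter_Ioc_eq_sum_cells hbR _ _ J]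
  rw [Finset.sum_congr rfl fun k _ => Finset.sum_congr rfl fun r _ => by
    rw [hIccL, sum_filter_Ioc_eq_sum_cells hbL _ _ J]]
  -- bring the `κ`-sum outside the `r`-sum
  rw [Finset.sum_congr rfl fun k _ => Finset.sum_comm]
  unfold ambTotal
  rw [← Finset.sum_add_distrib]
  refine Finset.sum_le_sum fun k hk => ?_
  rw [← Finset.sum_add_distrib]
  refine Finset.sum_le_sum fun κ hκ => ?_
  -- per `(r, l)`: the cell lemma
  set Crf := (Ioc (bp rlo R β k) (bp rlo R β (k + 1))).filter (fun r : ℕ => IsCoprime (r : ℤ) a) with hCrf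
  have hstep : ∑ r ∈ Crf, ∑ l ∈ (Ioc (bp 0 L β κ) (bp 0 L β (κ + 1))).filter (fun l : ℕ => l.Coprime r ∧ profVec a l = v),
      roughIndicator z l * (roughIndicator z t.2.1 * roughIndicator z t.2.2) *
        |Xred a z (Ioc mlo M') (Ioc nlo N') l r Q' S d g t| ≤
      ∑ r ∈ Crf, ∑ l ∈ (Ioc (bp 0 L β κ) (bp 0 L β (κ + 1))).filter (fun l : ℕ => l.Coprime r ∧ profVec a l = v),
        wRL a z d g t l * ∑ i ∈ range J, ∑ j ∈ range J,
          (corners4 (a / (Ea a d g : ℤ)) z (bpM mlo M' t β i) (bpM mlo M' t β (i + 1)) (bpN nlo N' t β j) (bpN nlo N' t β (j + 1))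
              (bpS2 Q' g (bp rlo R β (k + 1)) (KmOf a mlo M' nlo N' L t β κ i j)) (Pa a d g * r) (lred a d g t l) +
            corners4 (a / (Ea a d g : ℤ)) z (bpM mlo M' t β i) (bpM mlo M' t β (i + 1)) (bpN nlo N' t β j) (bpN nlo N' t β (j + 1))
              (bpS1 Q' g (bp rlo R β k + 1) (KpOf a mlo M' nlo N' L t β κ i j)) (Pa a d g * r) (lred a d g t l) +
            ambOf a z mlo M' nlo N' L Q' rlo R S d g t β k κ i j r l) := by
    refine Finset.sum_le_sum fun r hr => Finset.sum_le_sum fun l hl => ?_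
    rw [hCrf, Finset.mem_filter] at hr
    rw [Finset.mem_filter] at hl
    have hrA : r.Coprime a.natAbs := by
      have := Int.isCoprime_iff_gcd_eq_one.1 hr.2
      rwa [Int.gcd_eq_natAbs, Int.natAbs_natCast] at this
    have hlL : l ≤ L := by
      have h1 := (Finset.mem_Ioc.1 hl.1).2
      have h2 := (bp_bounds 0 L β (κ + 1)).2
      rw [max_eq_right (Nat.zero_le L)] at h2
      omega
    exact weight_abs_Xred_le ha z hd hgΘ ht hQ' hβ hmlo hnlo hJM hJN hpos hS hr.1 hl.1 hlL (hprofv l hl.2.2) hrA hl.2.1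
  refine hstep.trans ?_
  -- split corners from the ambiguous part and swap sums
  simp only [mul_add, Finset.sum_add_distrib, Finset.mul_sum]
  refine add_le_add ?_ le_rfl
  have swap : ∀ F : ℕ → ℕ → ℕ → ℕ → ℝ,
      ∑ r ∈ Crf, ∑ l ∈ (Ioc (bp 0 L β κ) (bp 0 L β (κ + 1))).filter (fun l : ℕ => l.Coprime r ∧ profVec a l = v),
        ∑ i ∈ range J, ∑ j ∈ range J, F r l i j =
      ∑ i ∈ range J, ∑ j ∈ range J,
        ∑ r ∈ Crf, ∑ l ∈ (Ioc (bp 0 L β κ) (bp 0 L β (κ + 1))).filter (fun l : ℕ => l.Coprime r ∧ profVec a l = v),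
          F r l i j := by
    intro F
    calc ∑ r ∈ Crf, ∑ l ∈ (Ioc (bp 0 L β κ) (bp 0 L β (κ + 1))).filter (fun l : ℕ => l.Coprime r ∧ profVec a l = v),
          ∑ i ∈ range J, ∑ j ∈ range J, F r l i j
        = ∑ r ∈ Crf, ∑ i ∈ range J,
            ∑ l ∈ (Ioc (bp 0 L β κ) (bp 0 L β (κ + 1))).filter (fun l : ℕ => l.Coprime r ∧ profVec a l = v),
              ∑ j ∈ range J, F r l i j := Finset.sum_congr rfl fun r _ => Finset.sum_comm
      _ = ∑ r ∈ Crf, ∑ i ∈ range J, ∑ j ∈ range J,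
            ∑ l ∈ (Ioc (bp 0 L β κ) (bp 0 L β (κ + 1))).filter (fun l : ℕ => l.Coprime r ∧ profVec a l = v),
              F r l i j := Finset.sum_congr rfl fun r _ => Finset.sum_congr rfl fun i _ => Finset.sum_comm
      _ = ∑ i ∈ range J, ∑ r ∈ Crf, ∑ j ∈ range J,
            ∑ l ∈ (Ioc (bp 0 L β κ) (bp 0 L β (κ + 1))).filter (fun l : ℕ => l.Coprime r ∧ profVec a l = v),
              F r l i j := Finset.sum_comm
      _ = _ := Finset.sum_congr rfl fun i _ => Finset.sum_comm
  rw [swap, swap, ← Finset.sum_add_distrib]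
  refine Finset.sum_le_sum fun i _ => ?_
  rw [← Finset.sum_add_distrib]
  refine Finset.sum_le_sum fun j _ => ?_
  -- embed the two corner families
  unfold cornersOf
  have hCr : ∀ r ∈ Crf, 0 < r ∧ r ≤ bp rlo R β (k + 1) := by
    intro r hr
    rw [hCrf, Finset.mem_filter, Finset.mem_Ioc] at hr
    exact ⟨by omega, hr.1.2⟩
  have emb : ∀ Sb : ℕ, ∑ r ∈ Crf, ∑ l ∈ (Ioc (bp 0 L β κ) (bp 0 L β (κ + 1))).filter (fun l : ℕ => l.Coprime r ∧ profVec a l = v),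
      wRL a z d g t l * corners4 (a / (Ea a d g : ℤ)) z (bpM mlo M' t β i) (bpM mlo M' t β (i + 1)) (bpN nlo N' t β j)
        (bpN nlo N' t β (j + 1)) Sb (Pa a d g * r) (lred a d g t l) ≤
      cornerDS (a / (Ea a d g : ℤ)) z (bpM mlo M' t β i) (bpM mlo M' t β (i + 1)) (bpN nlo N' t β j) (bpN nlo N' t β (j + 1))
        (L * t.2.1 * t.2.2) Sb (Pa a d g * bp rlo R β (k + 1)) := by
    intro Sb
    -- enlarge the `l`-set to one independent of `r`, putting the `r`-dependence into the weight
    set Cl := (Ioc (bp 0 L β κ) (bp 0 L β (κ + 1))).filter (fun l : ℕ => profVec a l = v) with hCl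
    set w : ℕ → ℕ → ℝ := fun r l => if l.Coprime r then wRL a z d g t l else 0 with hw
    have hrew : ∀ r ∈ Crf, ∑ l ∈ (Ioc (bp 0 L β κ) (bp 0 L β (κ + 1))).filter (fun l : ℕ => l.Coprime r ∧ profVec a l = v),
        wRL a z d g t l * corners4 (a / (Ea a d g : ℤ)) z (bpM mlo M' t β i) (bpM mlo M' t β (i + 1)) (bpN nlo N' t β j)
          (bpN nlo N' t β (j + 1)) Sb (Pa a d g * r) (lred a d g t l) =
        ∑ l ∈ Cl, w r l * corners4 (a / (Ea a d g : ℤ)) z (bpM mlo M' t β i) (bpM mlo M' t β (i + 1)) (bpN nlo N' t β j)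
          (bpN nlo N' t β (j + 1)) Sb (Pa a d g * r) (lred a d g t l) := by
      intro r _
      rw [hCl, Finset.sum_filter, Finset.sum_filter]
      refine Finset.sum_congr rfl fun l _ => ?_
      simp only [hw]
      by_cases h1 : l.Coprime r <;> by_cases h2 : profVec a l = v <;> simp [h1, h2]
    rw [Finset.sum_congr rfl hrew]
    have hClprop : ∀ l ∈ Cl, 0 < l ∧ l ≤ L ∧ profOf a l = prof := by
      intro l hl
      rw [hCl, Finset.mem_filter, Finset.mem_Ioc] at hl
      have h2 := (bp_bounds 0 L β (κ + 1)).2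
      rw [max_eq_right (Nat.zero_le L)] at h2
      exact ⟨by omega, by omega, hprofv l hl.2⟩
    refine sum_corners4_le_cornerDS ha z hd hgΘ prof ht Crf Cl hCr hClprop w
      (fun r l => by
        simp only [hw]; split_ifs
        · exact (wRL_mem a z d g t l).2
        · norm_num)
      (fun r hr l hl hne => ?_) _ _ _ _ Sb
    simp only [hw] at hne
    by_cases hlr : l.Coprime r
    · rw [if_pos hlr] at hne
      obtain ⟨hcop, hρl, hρm, hρn⟩ := wRL_ne_zero hne
      have hrA : r.Coprime a.natAbs := by
        rw [hCrf, Finset.mem_filter] at hr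
        have := Int.isCoprime_iff_gcd_eq_one.1 hr.2
        rwa [Int.gcd_eq_natAbs, Int.natAbs_natCast] at this
      exact ⟨hrA, hlr, hcop, hρl, hρm, hρn⟩
    · rw [if_neg hlr] at hne; exact absurd rfl hne
  exact add_le_add (emb _) (emb _)

/-! ### The ambiguous `A`-part: reduction to the count `ρ_J` -/

/-- Natural-number floor division is monotone under cross-multiplication: `x y' ≤ x' y ⇒ x/y ≤ x'/y'`.
[folklore] -/
theorem Nat.div_le_div_of_mul_le_mul {x y x' y' : ℕ} (hy : 0 < y) (hy' : 0 < y') (h : x * y' ≤ x' * y) :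
    x / y ≤ x' / y' := by
  rw [Nat.le_div_iff_mul_le hy']
  have h1 : x / y * y ≤ x := Nat.div_mul_le_self x y
  have h2 : x / y * y' * y ≤ x' * y := by
    calc x / y * y' * y = x / y * y * y' := by ring
      _ ≤ x * y' := Nat.mul_le_mul_right _ h1
      _ ≤ x' * y := h
  exact Nat.le_of_mul_le_mul_right h2 hy

/-- The fixed windows of the reduced complementary divisor:
`(2Q'g c₁/(EP c₂), 2Q'g/(EP)] ∪ (Q'g/(EP), Q'g c₂/(EP c₁)]`. [folklore] -/
def Jfix (Q' g E P c₁ c₂ : ℕ) : Finset ℕ :=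
  Ioc (2 * Q' * g * c₁ / (E * P * c₂)) (2 * Q' * g / (E * P)) ∪ Ioc (Q' * g / (E * P)) (Q' * g * c₂ / (E * P * c₁))

/-- **Fixed windows**: under the spread condition `r₊ K₊ c₁ ≤ r₋ K₋ c₂` of the cell, an ambiguous `s'`
with the window and the reduced factorisation `K = E P q̃ r s'` has `q̃ ∈ Jfix`. [folklore] -/
theorem mem_Jfix {Q' g rm rp r Km Kp K s' E P q c₁ c₂ : ℕ}
    (hr : rm ≤ r ∧ r ≤ rp) (hrm : 0 < rm) (hK : Km ≤ K ∧ K ≤ Kp) (hKm : 0 < Km)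
    (hc₁ : 0 < c₁) (hc₂ : 0 < c₂) (hE : 0 < E) (hP : 0 < P)
    (hspread : rp * Kp * c₁ ≤ rm * Km * c₂)
    (hwin : Q' * g * r * s' < K ∧ K ≤ 2 * (Q' * g * r) * s') (hq : E * P * q * (r * s') = K)
    (hamb : s' ∈ Icc ((Km + 2 * (Q' * g * rp) - 1) / (2 * (Q' * g * rp))) ((Kp + 2 * (Q' * g * rm) - 1) / (2 * (Q' * g * rm)) - 1) ∨
      s' ∈ Ioc ((Km - 1) / (Q' * g * rp)) ((Kp - 1) / (Q' * g * rm))) :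
    q ∈ Jfix Q' g E P c₁ c₂ := by
  obtain ⟨⟨h1, h2⟩, h3, h4⟩ := mem_ambiguous_windows_red hr hrm hK hKm hwin hq
  have hrp : 0 < rp := by omega
  have hKp : 0 < Kp := by omega
  unfold Jfix
  rw [Finset.mem_union, Finset.mem_Ioc, Finset.mem_Ioc]
  rcases hamb with hamb | hamb
  · left
    rw [Finset.mem_Icc] at hamb
    constructor
    · refine lt_of_le_of_lt ?_ (h3 hamb.2)
      apply Nat.div_le_div_of_mul_le_mul (by positivity) (by positivity)
      calc 2 * Q' * g * c₁ * (E * P * rp * Kp) = (2 * Q' * g * E * P) * (rp * Kp * c₁) := by ring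
        _ ≤ (2 * Q' * g * E * P) * (rm * Km * c₂) := Nat.mul_le_mul_left _ hspread
        _ = 2 * (Q' * g) * rm * Km * (E * P * c₂) := by ring
    · rw [Nat.le_div_iff_mul_le (by positivity)]
      calc q * (E * P) = E * P * q := by ring
        _ ≤ 2 * (Q' * g) := h2
        _ = 2 * Q' * g := by ring
  · right
    rw [Finset.mem_Ioc] at hamb
    constructor
    · rw [Nat.div_lt_iff_lt_mul (by positivity)]
      calc Q' * g < E * P * q := h1
        _ = q * (E * P) := by ring
    · refine (h4 hamb.1).trans ?_
      apply Nat.div_le_div_of_mul_le_mul (by positivity) (by positivity)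
      calc Q' * g * rp * Kp * (E * P * c₁) = (Q' * g * E * P) * (rp * Kp * c₁) := by ring
        _ ≤ (Q' * g * E * P) * (rm * Km * c₂) := Nat.mul_le_mul_left _ hspread
        _ = Q' * g * c₂ * (E * P * rm * Km) := by ring

/-- `gcount` is at most the number of `(m, n)` with the congruence and the window. [folklore] -/
theorem gcount_le_count (a : ℤ) (z : ℝ) (SM SN : Finset ℕ) (lc L₀ w : ℕ) (lo hi : ℤ) :
    gcount a z SM SN lc L₀ w lo hi ≤
      ∑ m ∈ SM, ∑ n ∈ SN, (if ((w : ℤ) ∣ ((lc * m * n : ℕ) : ℤ) - a) ∧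
        (lo < ((L₀ * m * n : ℕ) : ℤ) ∧ ((L₀ * m * n : ℕ) : ℤ) ≤ hi) then (1 : ℝ) else 0) := by
  unfold gcount
  refine Finset.sum_le_sum fun m _ => Finset.sum_le_sum fun n _ => ?_
  unfold dind wind
  have hρ : roughIndicator z m * roughIndicator z n ≤ 1 :=
    mul_le_one₀ (roughIndicator_le_one' z m) (roughIndicator_nonneg z n) (roughIndicator_le_one' z n)
  push_cast
  by_cases h1 : (w : ℤ) ∣ (lc : ℤ) * m * n - a <;>
    by_cases h2 : lo < (L₀ : ℤ) * m * n ∧ (L₀ : ℤ) * m * n ≤ hi <;> simp [h1, h2, hρ]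

/-- For a fixed reduced value `K̃ ≥ 1`, the pairs `(r, s')`, `r ≤ R`, with `P r s' ∣ K̃` and
`K̃/(P r s') ∈ J` inject into the pairs `(r, q̃)` counted by `ρ_J(K̃)`. [folklore] -/
theorem card_pairs_rs_le_rhoJ {P R Kt : ℕ} (hP : 0 < P) (hKt : 0 < Kt) (J : Finset ℕ) (Smax : ℕ) :
    ((((Icc 1 R) ×ˢ (Icc 1 Smax)).filter (fun p : ℕ × ℕ =>
        P * p.1 * p.2 ∣ Kt ∧ Kt / (P * p.1 * p.2) ∈ J)).card : ℝ) ≤ rhoJ P R J Kt := by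
  classical
  unfold rhoJ pairsRJ
  have h : (((Icc 1 R) ×ˢ (Icc 1 Smax)).filter (fun p : ℕ × ℕ =>
        P * p.1 * p.2 ∣ Kt ∧ Kt / (P * p.1 * p.2) ∈ J)).card ≤
      (((Icc 1 R) ×ˢ J).filter (fun p : ℕ × ℕ => P * p.1 * p.2 ∣ Kt)).card := by
    refine Finset.card_le_card_of_injOn (fun p => (p.1, Kt / (P * p.1 * p.2))) (fun p hp => ?_) ?_
    · simp only [Finset.mem_coe, Finset.mem_filter, Finset.mem_product] at hp ⊢
      obtain ⟨⟨hr, hs⟩, hdvd, hJ⟩ := hp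
      refine ⟨⟨hr, hJ⟩, ?_⟩
      obtain ⟨q, hq⟩ := hdvd
      have hw : 0 < P * p.1 * p.2 := Nat.mul_pos (Nat.mul_pos hP (Finset.mem_Icc.1 hr).1) (Finset.mem_Icc.1 hs).1
      rw [hq, Nat.mul_div_cancel_left q hw]
      exact ⟨p.2, by ring⟩
    · intro p₁ hp₁ p₂ hp₂ heq
      simp only [Finset.coe_filter, Set.mem_setOf_eq, Finset.mem_product] at hp₁ hp₂
      simp only [Prod.mk.injEq] at heq
      obtain ⟨hreq, hqeq⟩ := heq
      have hw₁ : 0 < P * p₁.1 * p₁.2 := Nat.mul_pos (Nat.mul_pos hP (Finset.mem_Icc.1 hp₁.1.1).1) (Finset.mem_Icc.1 hp₁.1.2).1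
      have hw₂ : 0 < P * p₂.1 * p₂.2 := Nat.mul_pos (Nat.mul_pos hP (Finset.mem_Icc.1 hp₂.1.1).1) (Finset.mem_Icc.1 hp₂.1.2).1
      -- `s' = K̃ / (P r q̃)` on both sides
      obtain ⟨q₁, hq₁⟩ := hp₁.2.1
      obtain ⟨q₂, hq₂⟩ := hp₂.2.1
      have e₁ : Kt / (P * p₁.1 * p₁.2) = q₁ := by rw [hq₁, Nat.mul_div_cancel_left q₁ hw₁]
      have e₂ : Kt / (P * p₂.1 * p₂.2) = q₂ := by rw [hq₂, Nat.mul_div_cancel_left q₂ hw₂]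
      rw [e₁, e₂] at hqeq
      subst hqeq
      rw [← hreq] at hq₂
      have : P * p₁.1 * p₁.2 * q₁ = P * p₁.1 * p₂.2 * q₁ := by rw [← hq₁, ← hq₂]
      have hq0 : 0 < q₁ := by
        rcases Nat.eq_zero_or_pos q₁ with h0 | h0
        · rw [h0, mul_zero] at hq₁; omega
        · exact h0
      have hPr : 0 < P * p₁.1 := Nat.mul_pos hP (Finset.mem_Icc.1 hp₁.1.1).1
      have : p₁.2 = p₂.2 := by
        have h' : P * p₁.1 * (p₁.2 * q₁) = P * p₁.1 * (p₂.2 * q₁) := by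
          calc P * p₁.1 * (p₁.2 * q₁) = P * p₁.1 * p₁.2 * q₁ := by ring
            _ = P * p₁.1 * p₂.2 * q₁ := this
            _ = P * p₁.1 * (p₂.2 * q₁) := by ring
        have h'' := Nat.eq_of_mul_eq_mul_left hPr h'
        exact Nat.eq_of_mul_eq_mul_right hq0 h''
      exact Prod.ext hreq this
  exact_mod_cast h

/-- The congruence (`A`-) part of the ambiguous contribution of `(r, l)` in the cell `(k, κ, i, j)`. [folklore] -/
def ambAOf (a : ℤ) (z : ℝ) (mlo M' nlo N' L Q' rlo R S d g : ℕ) (t : ℤ × ℕ × ℕ) (β : ℝ) (k κ i j r l : ℕ) : ℝ :=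
  ∑ s' ∈ (Icc 1 (S / g)).filter (fun s' : ℕ =>
      s' ∈ Icc ((KmOf a mlo M' nlo N' L t β κ i j + 2 * (Q' * g * bp rlo R β (k + 1)) - 1) / (2 * (Q' * g * bp rlo R β (k + 1))))
          ((KpOf a mlo M' nlo N' L t β κ i j + 2 * (Q' * g * (bp rlo R β k + 1)) - 1) / (2 * (Q' * g * (bp rlo R β k + 1))) - 1) ∨
        s' ∈ Ioc ((KmOf a mlo M' nlo N' L t β κ i j - 1) / (Q' * g * bp rlo R β (k + 1)))
          ((KpOf a mlo M' nlo N' L t β κ i j - 1) / (Q' * g * (bp rlo R β k + 1)))),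
    gcount (a / (Ea a d g : ℤ)) z (Ioc (bpM mlo M' t β i) (bpM mlo M' t β (i + 1))) (Ioc (bpN nlo N' t β j) (bpN nlo N' t β (j + 1)))
      (lred a d g t l) (l * t.2.1 * t.2.2) (Pa a d g * r * s')
      (a + (Q' : ℤ) * r * ((g * s' : ℕ) : ℤ)) (a + 2 * (Q' : ℤ) * r * ((g * s' : ℕ) : ℤ))

/-- The expected (`B`-) part of the ambiguous contribution. [folklore] -/
def ambBOf (a : ℤ) (z : ℝ) (mlo M' nlo N' L Q' rlo R S d g : ℕ) (t : ℤ × ℕ × ℕ) (β : ℝ) (k κ i j r l : ℕ) : ℝ :=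
  ∑ s' ∈ (Icc 1 (S / g)).filter (fun s' : ℕ =>
      s' ∈ Icc ((KmOf a mlo M' nlo N' L t β κ i j + 2 * (Q' * g * bp rlo R β (k + 1)) - 1) / (2 * (Q' * g * bp rlo R β (k + 1))))
          ((KpOf a mlo M' nlo N' L t β κ i j + 2 * (Q' * g * (bp rlo R β k + 1)) - 1) / (2 * (Q' * g * (bp rlo R β k + 1))) - 1) ∨
        s' ∈ Ioc ((KmOf a mlo M' nlo N' L t β κ i j - 1) / (Q' * g * bp rlo R β (k + 1)))
          ((KpOf a mlo M' nlo N' L t β κ i j - 1) / (Q' * g * (bp rlo R β k + 1)))),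
    gmodel (a / (Ea a d g : ℤ)) z (Ioc (bpM mlo M' t β i) (bpM mlo M' t β (i + 1))) (Ioc (bpN nlo N' t β j) (bpN nlo N' t β (j + 1)))
      (lred a d g t l) (l * t.2.1 * t.2.2) (Pa a d g * r * s')
      (a + (Q' : ℤ) * r * ((g * s' : ℕ) : ℤ)) (a + 2 * (Q' : ℤ) * r * ((g * s' : ℕ) : ℤ))

/-- `ambOf = ambAOf + ambBOf`. [folklore] -/
theorem ambOf_eq (a : ℤ) (z : ℝ) (mlo M' nlo N' L Q' rlo R S d g : ℕ) (t : ℤ × ℕ × ℕ) (β : ℝ) (k κ i j r l : ℕ) :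
    ambOf a z mlo M' nlo N' L Q' rlo R S d g t β k κ i j r l =
      ambAOf a z mlo M' nlo N' L Q' rlo R S d g t β k κ i j r l + ambBOf a z mlo M' nlo N' L Q' rlo R S d g t β k κ i j r l := by
  unfold ambOf ambAOf ambBOf ambCell
  rw [← Finset.sum_add_distrib]

/-- `ambAOf ≥ 0`. [folklore] -/
theorem ambAOf_nonneg (a : ℤ) (z : ℝ) (mlo M' nlo N' L Q' rlo R S d g : ℕ) (t : ℤ × ℕ × ℕ) (β : ℝ) (k κ i j r l : ℕ) :
    0 ≤ ambAOf a z mlo M' nlo N' L Q' rlo R S d g t β k κ i j r l :=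
  Finset.sum_nonneg fun _ _ => gcount_nonneg _ _ _ _ _ _ _ _ _

/-- `ambBOf ≥ 0`. [folklore] -/
theorem ambBOf_nonneg (a : ℤ) (z : ℝ) (mlo M' nlo N' L Q' rlo R S d g : ℕ) (t : ℤ × ℕ × ℕ) (β : ℝ) (k κ i j r l : ℕ) :
    0 ≤ ambBOf a z mlo M' nlo N' L Q' rlo R S d g t β k κ i j r l :=
  Finset.sum_nonneg fun _ _ => gmodel_nonneg _ _ _ _ _ _ _ _ _

/-- The reduced value `K̃ = l̃ m'' n'' − ã` of a tuple `(l, m'', n'')` (as a natural number). [folklore] -/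
def Ktil (a : ℤ) (d g : ℕ) (t : ℤ × ℕ × ℕ) (p : ℕ × (ℕ × ℕ)) : ℕ :=
  ((((lred a d g t p.1 * p.2.1 * p.2.2 : ℕ)) : ℤ) - a / (Ea a d g : ℤ)).toNat

/-- The tuples `(l, m'', n'')` of the switched piece with profile `v` and `K̃ ≥ 1`. [folklore] -/
def Splus (a : ℤ) (mlo M' nlo N' L d g : ℕ) (t : ℤ × ℕ × ℕ) (v : List ℕ) : Finset (ℕ × (ℕ × ℕ)) :=
  (((Icc 1 L).filter (fun l : ℕ => profVec a l = v)) ×ˢ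
    ((Ioc (mlo / t.2.1) (M' / t.2.1)) ×ˢ (Ioc (nlo / t.2.2) (N' / t.2.2)))).filter
      (fun p => 1 ≤ Ktil a d g t p)

/-- **The reduced congruence is `E` times the original one**: with `E ∣ l D_m D_n` and `E ∣ a`,
`l D_m D_n m n − a = E (l̃ m n − ã)`. [folklore] -/
theorem sub_eq_Ea_mul {a : ℤ} (ha : a ≠ 0) {d g : ℕ} {t : ℤ × ℕ × ℕ} {l : ℕ} (hE : Ea a d g ∣ l * t.2.1 * t.2.2) (m n : ℕ) :
    ((l * t.2.1 * t.2.2 * m * n : ℕ) : ℤ) - a =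
      (Ea a d g : ℤ) * ((((lred a d g t l * m * n : ℕ)) : ℤ) - a / (Ea a d g : ℤ)) := by
  have hEa : (Ea a d g : ℤ) ∣ a := Int.natCast_dvd.2 (Ered_dvd (fun _ hp => prime_of_mem_psA hp) ha _)
  have h1 : (Ea a d g : ℤ) * (a / (Ea a d g : ℤ)) = a := Int.mul_ediv_cancel' hEa
  have h2 : Ea a d g * lred a d g t l = l * t.2.1 * t.2.2 := by
    unfold lred; exact Nat.mul_div_cancel' hE
  have h3 : ((l * t.2.1 * t.2.2 * m * n : ℕ) : ℤ) = (Ea a d g : ℤ) * ((lred a d g t l * m * n : ℕ) : ℤ) := by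
    have : l * t.2.1 * t.2.2 * m * n = Ea a d g * (lred a d g t l * m * n) := by rw [← mul_assoc, ← mul_assoc, h2]
    rw [this]; push_cast; ring
  rw [h3, mul_sub, h1]

/-- The lower corners of the product cells dominate `(mlo + 1)(nlo + 1)`, hence exceed `a`. [folklore] -/
theorem lt_prod_lower {a : ℤ} {mlo M' nlo N' L : ℕ} {t : ℤ × ℕ × ℕ} (hDm : 0 < t.2.1) (hDn : 0 < t.2.2)
    (hpos : a < (((mlo + 1) * (nlo + 1) : ℕ) : ℤ)) (β : ℝ) (κ i j : ℕ) :
    a < ((((bp 0 L β κ + 1) * (t.2.1 * t.2.2) * (bpM mlo M' t β i + 1) * (bpN nlo N' t β j + 1)) : ℕ) : ℤ) := by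
  have hmcell : mlo + 1 ≤ t.2.1 * (bpM mlo M' t β i + 1) := by
    have h1 : mlo / t.2.1 ≤ bpM mlo M' t β i := by unfold bpM; exact (bp_bounds _ _ _ _).1
    have h2 : mlo < t.2.1 * (mlo / t.2.1 + 1) := by
      have h := Nat.lt_div_mul_add (a := mlo) hDm
      have e : mlo / t.2.1 * t.2.1 + t.2.1 = t.2.1 * (mlo / t.2.1 + 1) := by ring
      rw [e] at h; exact h
    exact (Nat.succ_le_of_lt h2).trans (Nat.mul_le_mul_left _ (by omega))
  have hncell : nlo + 1 ≤ t.2.2 * (bpN nlo N' t β j + 1) := by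
    have h1 : nlo / t.2.2 ≤ bpN nlo N' t β j := by unfold bpN; exact (bp_bounds _ _ _ _).1
    have h2 : nlo < t.2.2 * (nlo / t.2.2 + 1) := by
      have h := Nat.lt_div_mul_add (a := nlo) hDn
      have e : nlo / t.2.2 * t.2.2 + t.2.2 = t.2.2 * (nlo / t.2.2 + 1) := by ring
      rw [e] at h; exact h
    exact (Nat.succ_le_of_lt h2).trans (Nat.mul_le_mul_left _ (by omega))
  have hprod : (mlo + 1) * (nlo + 1) ≤
      (bp 0 L β κ + 1) * (t.2.1 * t.2.2) * (bpM mlo M' t β i + 1) * (bpN nlo N' t β j + 1) := by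
    calc (mlo + 1) * (nlo + 1) ≤ (t.2.1 * (bpM mlo M' t β i + 1)) * (t.2.2 * (bpN nlo N' t β j + 1)) :=
          Nat.mul_le_mul hmcell hncell
      _ = 1 * (t.2.1 * t.2.2) * (bpM mlo M' t β i + 1) * (bpN nlo N' t β j + 1) := by ring
      _ ≤ (bp 0 L β κ + 1) * (t.2.1 * t.2.2) * (bpM mlo M' t β i + 1) * (bpN nlo N' t β j + 1) := by
          gcongr; omega
  have : (((mlo + 1) * (nlo + 1) : ℕ) : ℤ) ≤
      ((((bp 0 L β κ + 1) * (t.2.1 * t.2.2) * (bpM mlo M' t β i + 1) * (bpN nlo N' t β j + 1) : ℕ)) : ℤ) := by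
    exact_mod_cast hprod
  linarith

/-- `1 ≤ K₋` for every product cell. [folklore] -/
theorem one_le_KmOf {a : ℤ} {mlo M' nlo N' L : ℕ} {t : ℤ × ℕ × ℕ} (hDm : 0 < t.2.1) (hDn : 0 < t.2.2)
    (hpos : a < (((mlo + 1) * (nlo + 1) : ℕ) : ℤ)) (β : ℝ) (κ i j : ℕ) :
    1 ≤ KmOf a mlo M' nlo N' L t β κ i j := by
  have h := lt_prod_lower (M' := M') (N' := N') (L := L) hDm hDn hpos β κ i j
  unfold KmOf cellK
  have e : ((((bp 0 L β κ + 1) * t.2.1 * t.2.2 * (bpM mlo M' t β i + 1) * (bpN nlo N' t β j + 1) : ℕ)) : ℤ) =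
      ((((bp 0 L β κ + 1) * (t.2.1 * t.2.2) * (bpM mlo M' t β i + 1) * (bpN nlo N' t β j + 1) : ℕ)) : ℤ) := by
    push_cast; ring
  have : (1 : ℤ) ≤ ((((bp 0 L β κ + 1) * t.2.1 * t.2.2 * (bpM mlo M' t β i + 1) * (bpN nlo N' t β j + 1) : ℕ)) : ℤ) - a := by
    rw [e]; linarith
  have h2 := Int.toNat_le_toNat this
  simpa using h2

/-- The good `s'` for a tuple with reduced value `Kt` and `r`: `P r s' ∣ K̃`, `K̃/(P r s') ∈ Jfix`. [folklore] -/
def goodS (P Smax Kt : ℕ) (Jf : Finset ℕ) (r : ℕ) : Finset ℕ :=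
  (Icc 1 Smax).filter (fun s' : ℕ => P * r * s' ∣ Kt ∧ Kt / (P * r * s') ∈ Jf)

set_option maxHeartbeats 800000 in
/-- **The `A`-part of one `(r, l)`, summed over the product cells**: each counted `(m'', n'', s')` has
`K̃ ≥ 1`, `P r s' ∣ K̃` and `K̃/(P r s') ∈ Jfix` (spread condition `r₊ K₊ c₁ ≤ r₋ K₋ c₂` on all cells).
[cite: BombieriFriedlanderIwaniecActa1986, §13 p. 241–242] -/
theorem sum_ambAOf_le {a : ℤ} (ha : a ≠ 0) (z : ℝ) {mlo M' nlo N' L Q' rlo R S d g : ℕ}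
    (hd : d ∣ a.natAbs) (hgΘ : g ∣ ThetaD a.natAbs d) (v : List ℕ) {t : ℤ × ℕ × ℕ}
    (ht : t ∈ Tsel a d g (profFun a v)) (hQ' : 0 < Q') {β : ℝ} {J : ℕ}
    (hJM : bpM mlo M' t β J = M' / t.2.1) (hJN : bpN nlo N' t β J = N' / t.2.2) (hβ : 1 ≤ β)
    (hpos : a < (((mlo + 1) * (nlo + 1) : ℕ) : ℤ)) {c₁ c₂ : ℕ} (hc₁ : 0 < c₁) (hc₂ : 0 < c₂)
    {k κ : ℕ}
    (hspread : ∀ i j, ∀ m ∈ Ioc (bpM mlo M' t β i) (bpM mlo M' t β (i + 1)),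
      ∀ n ∈ Ioc (bpN nlo N' t β j) (bpN nlo N' t β (j + 1)),
      bp rlo R β (k + 1) * KpOf a mlo M' nlo N' L t β κ i j * c₁ ≤
        (bp rlo R β k + 1) * KmOf a mlo M' nlo N' L t β κ i j * c₂)
    {r l : ℕ} (hr : r ∈ Ioc (bp rlo R β k) (bp rlo R β (k + 1)))
    (hl : l ∈ Ioc (bp 0 L β κ) (bp 0 L β (κ + 1))) (hlv : profVec a l = v) :
    ∑ i ∈ range J, ∑ j ∈ range J, ambAOf a z mlo M' nlo N' L Q' rlo R S d g t β k κ i j r l ≤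
      ∑ m ∈ Ioc (mlo / t.2.1) (M' / t.2.1), ∑ n ∈ Ioc (nlo / t.2.2) (N' / t.2.2),
        (if 1 ≤ Ktil a d g t (l, (m, n)) then
          (((goodS (Pa a d g) (S / g) (Ktil a d g t (l, (m, n))) (Jfix Q' g (Ea a d g) (Pa a d g) c₁ c₂) r).card : ℕ) : ℝ)
        else 0) := by
  classical
  obtain ⟨-, hterms, hident⟩ := Tsel_spec ha hd hgΘ (profFun a v)
  obtain ⟨-, hDm, hDn, -⟩ := hterms t ht
  have hl0 : 0 < l := by have := (Finset.mem_Ioc.1 hl).1; omega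
  have hprof : profOf a l = profFun a v := by rw [← hlv, profFun_profVec]
  have hE : Ea a d g ∣ l * t.2.1 * t.2.2 := by
    obtain ⟨h1, -⟩ := hident l hl0 (fun p hp => by rw [← hprof]; exact profOf_apply_of_mem hp)
    exact h1 t ht
  have hE0 : 0 < Ea a d g := Ea_pos a d g
  have hP0 : 0 < Pa a d g := Pa_pos a d g
  have hrcell := Finset.mem_Ioc.1 hr
  have hlcell := Finset.mem_Ioc.1 hl
  have hr0 : 0 < r := by omega
  set E := Ea a d g with hEdef
  set P := Pa a d g with hPdef
  set ared := a / (E : ℤ) with hared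
  set Jf := Jfix Q' g E P c₁ c₂ with hJf
  set G : ℕ → ℕ → ℝ := fun m n =>
    if 1 ≤ Ktil a d g t (l, (m, n)) then (((goodS P (S / g) (Ktil a d g t (l, (m, n))) Jf r).card : ℕ) : ℝ) else 0 with hG
  have hG0 : ∀ m n, 0 ≤ G m n := by intro m n; simp only [hG]; split_ifs <;> positivity
  -- Step 1: each cell
  have hcell : ∀ i j, ambAOf a z mlo M' nlo N' L Q' rlo R S d g t β k κ i j r l ≤
      ∑ m ∈ Ioc (bpM mlo M' t β i) (bpM mlo M' t β (i + 1)), ∑ n ∈ Ioc (bpN nlo N' t β j) (bpN nlo N' t β (j + 1)), G m n := by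
    intro i j
    unfold ambAOf
    set Fij := (Icc 1 (S / g)).filter (fun s' : ℕ =>
      s' ∈ Icc ((KmOf a mlo M' nlo N' L t β κ i j + 2 * (Q' * g * bp rlo R β (k + 1)) - 1) / (2 * (Q' * g * bp rlo R β (k + 1))))
          ((KpOf a mlo M' nlo N' L t β κ i j + 2 * (Q' * g * (bp rlo R β k + 1)) - 1) / (2 * (Q' * g * (bp rlo R β k + 1))) - 1) ∨
        s' ∈ Ioc ((KmOf a mlo M' nlo N' L t β κ i j - 1) / (Q' * g * bp rlo R β (k + 1)))
          ((KpOf a mlo M' nlo N' L t β κ i j - 1) / (Q' * g * (bp rlo R β k + 1)))) with hFij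
    -- congruence count
    have h1 : ∑ s' ∈ Fij, gcount ared z (Ioc (bpM mlo M' t β i) (bpM mlo M' t β (i + 1)))
        (Ioc (bpN nlo N' t β j) (bpN nlo N' t β (j + 1))) (lred a d g t l) (l * t.2.1 * t.2.2) (P * r * s')
        (a + (Q' : ℤ) * r * ((g * s' : ℕ) : ℤ)) (a + 2 * (Q' : ℤ) * r * ((g * s' : ℕ) : ℤ)) ≤
        ∑ s' ∈ Fij, ∑ m ∈ Ioc (bpM mlo M' t β i) (bpM mlo M' t β (i + 1)), ∑ n ∈ Ioc (bpN nlo N' t β j) (bpN nlo N' t β (j + 1)),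
          (if ((P * r * s' : ℕ) : ℤ) ∣ ((lred a d g t l * m * n : ℕ) : ℤ) - ared ∧
            (a + (Q' : ℤ) * r * ((g * s' : ℕ) : ℤ) < ((l * t.2.1 * t.2.2 * m * n : ℕ) : ℤ) ∧
              ((l * t.2.1 * t.2.2 * m * n : ℕ) : ℤ) ≤ a + 2 * (Q' : ℤ) * r * ((g * s' : ℕ) : ℤ)) then (1 : ℝ) else 0) :=
      Finset.sum_le_sum fun s' _ => gcount_le_count _ _ _ _ _ _ _ _ _
    refine h1.trans ?_
    -- each indicator is at most `[s' good] · [1 ≤ K̃]`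
    have h2 : ∀ s' ∈ Fij, ∀ m ∈ Ioc (bpM mlo M' t β i) (bpM mlo M' t β (i + 1)),
        ∀ n ∈ Ioc (bpN nlo N' t β j) (bpN nlo N' t β (j + 1)),
        (if ((P * r * s' : ℕ) : ℤ) ∣ ((lred a d g t l * m * n : ℕ) : ℤ) - ared ∧
            (a + (Q' : ℤ) * r * ((g * s' : ℕ) : ℤ) < ((l * t.2.1 * t.2.2 * m * n : ℕ) : ℤ) ∧
              ((l * t.2.1 * t.2.2 * m * n : ℕ) : ℤ) ≤ a + 2 * (Q' : ℤ) * r * ((g * s' : ℕ) : ℤ)) then (1 : ℝ) else 0) ≤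
        (if 1 ≤ Ktil a d g t (l, (m, n)) ∧ s' ∈ goodS P (S / g) (Ktil a d g t (l, (m, n))) Jf r then (1 : ℝ) else 0) := by
      intro s' hs' m hm n hn
      by_cases hcond : ((P * r * s' : ℕ) : ℤ) ∣ ((lred a d g t l * m * n : ℕ) : ℤ) - ared ∧
            (a + (Q' : ℤ) * r * ((g * s' : ℕ) : ℤ) < ((l * t.2.1 * t.2.2 * m * n : ℕ) : ℤ) ∧
              ((l * t.2.1 * t.2.2 * m * n : ℕ) : ℤ) ≤ a + 2 * (Q' : ℤ) * r * ((g * s' : ℕ) : ℤ))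
      swap
      · rw [if_neg hcond]; split_ifs <;> norm_num
      rw [if_pos hcond]
      obtain ⟨hdvd, hwin⟩ := hcond
      have hs'1 : 1 ≤ s' := (Finset.mem_Icc.1 (Finset.mem_filter.1 hs').1).1
      have hs'S : s' ≤ S / g := (Finset.mem_Icc.1 (Finset.mem_filter.1 hs').1).2
      -- `K = E K̃`, `K̃ ≥ 1`
      have hKE := sub_eq_Ea_mul ha hE m n
      rw [← hEdef] at hKE
      set Kt := Ktil a d g t (l, (m, n)) with hKt
      have hKtint : ((((lred a d g t l * m * n : ℕ)) : ℤ) - ared) = (Kt : ℤ) := by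
        have hwpos : 0 < ((l * t.2.1 * t.2.2 * m * n : ℕ) : ℤ) - a := by
          have : (0 : ℤ) ≤ (Q' : ℤ) * r * ((g * s' : ℕ) : ℤ) := by positivity
          linarith [hwin.1]
        rw [hKE] at hwpos
        have hE0' : (0 : ℤ) < E := by exact_mod_cast hE0
        have hpos' : 0 < (((lred a d g t l * m * n : ℕ)) : ℤ) - ared := pos_of_mul_pos_right hwpos hE0'.le
        simp only [hKt, Ktil]
        rw [Int.toNat_of_nonneg hpos'.le]
      have hKt1 : 1 ≤ Kt := by
        have hwpos : 0 < ((l * t.2.1 * t.2.2 * m * n : ℕ) : ℤ) - a := by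
          have : (0 : ℤ) ≤ (Q' : ℤ) * r * ((g * s' : ℕ) : ℤ) := by positivity
          linarith [hwin.1]
        rw [hKE, hKtint] at hwpos
        have hE0' : (0 : ℤ) < E := by exact_mod_cast hE0
        have : (0 : ℤ) < Kt := pos_of_mul_pos_right hwpos hE0'.le
        exact_mod_cast this
      -- natural-number window for `K = E Kt`
      have hKnat : ((l * (t.2.1 * t.2.2) * m * n : ℕ) : ℤ) - a = ((E * Kt : ℕ) : ℤ) := by
        have e : ((l * (t.2.1 * t.2.2) * m * n : ℕ) : ℤ) = ((l * t.2.1 * t.2.2 * m * n : ℕ) : ℤ) := by push_cast; ring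
        rw [e, hKE, hKtint]; push_cast; ring
      have hwin' : a + (Q' : ℤ) * r * ((g * s' : ℕ) : ℤ) < ((l * (t.2.1 * t.2.2) * m * n : ℕ) : ℤ) ∧
          ((l * (t.2.1 * t.2.2) * m * n : ℕ) : ℤ) ≤ a + 2 * (Q' : ℤ) * r * ((g * s' : ℕ) : ℤ) := by
        have e : ((l * (t.2.1 * t.2.2) * m * n : ℕ) : ℤ) = ((l * t.2.1 * t.2.2 * m * n : ℕ) : ℤ) := by push_cast; ring
        rw [e]; exact hwin
      have hwnat := (window_iff_nat hKnat Q' r g s').1 hwin'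
      -- `P r s' ∣ Kt` and the reduced factorisation
      have hdvdnat : P * r * s' ∣ Kt := by
        rw [hKtint] at hdvd; exact Int.natCast_dvd_natCast.1 hdvd
      obtain ⟨q, hq⟩ := hdvdnat
      have hqeq : Kt / (P * r * s') = q := by
        rw [hq, Nat.mul_div_cancel_left q (Nat.mul_pos (Nat.mul_pos hP0 hr0) (by omega))]
      have hfact : E * P * q * (r * s') = E * Kt := by rw [hq]; ring
      -- the cell bounds on `K = E Kt`
      obtain ⟨K', hK', hK1, hK2⟩ := exists_K_of_mem_cell (D := t.2.1 * t.2.2) (a := a)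
        (lm := bp 0 L β κ + 1) (lp := bp 0 L β (κ + 1)) ⟨hlcell.1, hlcell.2⟩ hm hn
        (lt_prod_lower (M' := M') (N' := N') (L := L) hDm hDn hpos β κ i j)
      have hKK' : K' = E * Kt := by
        have : ((K' : ℕ) : ℤ) = ((E * Kt : ℕ) : ℤ) := by rw [← hK', ← hKnat]
        exact_mod_cast this
      rw [hKK'] at hK1 hK2
      have hKm1 := one_le_KmOf (M' := M') (N' := N') (L := L) hDm hDn hpos β κ i j
      have hmemJ : q ∈ Jf := by
        have hamb := (Finset.mem_filter.1 hs').2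
        refine mem_Jfix (rm := bp rlo R β k + 1) (rp := bp rlo R β (k + 1)) (Km := KmOf a mlo M' nlo N' L t β κ i j)
          (Kp := KpOf a mlo M' nlo N' L t β κ i j) ⟨hrcell.1, hrcell.2⟩ (by omega)
          ⟨by unfold KmOf; simpa [mul_assoc] using hK1, by unfold KpOf; simpa [mul_assoc] using hK2⟩
          hKm1 hc₁ hc₂ hE0 hP0 (hspread i j m hm n hn) hwnat hfact ?_
        rcases hamb with h | h
        · left; exact h
        · right; exact h
      rw [if_pos]
      refine ⟨hKt1, ?_⟩
      simp only [goodS, Finset.mem_filter, Finset.mem_Icc]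
      exact ⟨⟨hs'1, hs'S⟩, ⟨q, hq⟩, by rw [hqeq]; exact hmemJ⟩
    calc ∑ s' ∈ Fij, ∑ m ∈ Ioc (bpM mlo M' t β i) (bpM mlo M' t β (i + 1)), ∑ n ∈ Ioc (bpN nlo N' t β j) (bpN nlo N' t β (j + 1)),
          (if ((P * r * s' : ℕ) : ℤ) ∣ ((lred a d g t l * m * n : ℕ) : ℤ) - ared ∧
            (a + (Q' : ℤ) * r * ((g * s' : ℕ) : ℤ) < ((l * t.2.1 * t.2.2 * m * n : ℕ) : ℤ) ∧
              ((l * t.2.1 * t.2.2 * m * n : ℕ) : ℤ) ≤ a + 2 * (Q' : ℤ) * r * ((g * s' : ℕ) : ℤ)) then (1 : ℝ) else 0)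
        ≤ ∑ s' ∈ Fij, ∑ m ∈ Ioc (bpM mlo M' t β i) (bpM mlo M' t β (i + 1)), ∑ n ∈ Ioc (bpN nlo N' t β j) (bpN nlo N' t β (j + 1)),
          (if 1 ≤ Ktil a d g t (l, (m, n)) ∧ s' ∈ goodS P (S / g) (Ktil a d g t (l, (m, n))) Jf r then (1 : ℝ) else 0) :=
          Finset.sum_le_sum fun s' hs' => Finset.sum_le_sum fun m hm => Finset.sum_le_sum fun n hn => h2 s' hs' m hm n hn
      _ = ∑ m ∈ Ioc (bpM mlo M' t β i) (bpM mlo M' t β (i + 1)), ∑ n ∈ Ioc (bpN nlo N' t β j) (bpN nlo N' t β (j + 1)),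
          ∑ s' ∈ Fij, (if 1 ≤ Ktil a d g t (l, (m, n)) ∧ s' ∈ goodS P (S / g) (Ktil a d g t (l, (m, n))) Jf r then (1 : ℝ) else 0) := by
          rw [Finset.sum_comm]
          exact Finset.sum_congr rfl fun m _ => Finset.sum_comm
      _ ≤ ∑ m ∈ Ioc (bpM mlo M' t β i) (bpM mlo M' t β (i + 1)), ∑ n ∈ Ioc (bpN nlo N' t β j) (bpN nlo N' t β (j + 1)), G m n := by
          refine Finset.sum_le_sum fun m _ => Finset.sum_le_sum fun n _ => ?_
          simp only [hG]
          by_cases hK1 : 1 ≤ Ktil a d g t (l, (m, n))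
          · simp only [hK1, true_and, if_true]
            have hsub : Fij ⊆ Icc 1 (S / g) := Finset.filter_subset _ _
            calc ∑ s' ∈ Fij, (if s' ∈ goodS P (S / g) (Ktil a d g t (l, (m, n))) Jf r then (1 : ℝ) else 0)
                ≤ ∑ s' ∈ Icc 1 (S / g), (if s' ∈ goodS P (S / g) (Ktil a d g t (l, (m, n))) Jf r then (1 : ℝ) else 0) :=
                  Finset.sum_le_sum_of_subset_of_nonneg hsub fun _ _ _ => by split_ifs <;> norm_num
              _ = (((goodS P (S / g) (Ktil a d g t (l, (m, n))) Jf r).card : ℕ) : ℝ) := by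
                  rw [← Finset.sum_filter, Finset.sum_const, nsmul_eq_mul, mul_one]
                  congr 2
                  ext s'; simp only [Finset.mem_filter, goodS, Finset.mem_Icc]; tauto
          · simp only [hK1, false_and, if_false, Finset.sum_const_zero, le_refl]
  -- Step 2: recombine the cells
  calc ∑ i ∈ range J, ∑ j ∈ range J, ambAOf a z mlo M' nlo N' L Q' rlo R S d g t β k κ i j r l
      ≤ ∑ i ∈ range J, ∑ j ∈ range J, ∑ m ∈ Ioc (bpM mlo M' t β i) (bpM mlo M' t β (i + 1)),
          ∑ n ∈ Ioc (bpN nlo N' t β j) (bpN nlo N' t β (j + 1)), G m n :=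
        Finset.sum_le_sum fun i _ => Finset.sum_le_sum fun j _ => hcell i j
    _ = ∑ i ∈ range J, ∑ m ∈ Ioc (bpM mlo M' t β i) (bpM mlo M' t β (i + 1)),
          ∑ j ∈ range J, ∑ n ∈ Ioc (bpN nlo N' t β j) (bpN nlo N' t β (j + 1)), G m n :=
        Finset.sum_congr rfl fun i _ => Finset.sum_comm
    _ = ∑ m ∈ Ioc (bpM mlo M' t β 0) (bpM mlo M' t β J), ∑ n ∈ Ioc (bpN nlo N' t β 0) (bpN nlo N' t β J), G m n := by
        rw [sum_Ioc_eq_sum_cells (fun i j hij => by unfold bpM; exact bp_mono _ _ hβ hij) _ J]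
        refine Finset.sum_congr rfl fun i _ => Finset.sum_congr rfl fun m _ => ?_
        rw [sum_Ioc_eq_sum_cells (fun i j hij => by unfold bpN; exact bp_mono _ _ hβ hij) _ J]
    _ = _ := by
        rw [show bpM mlo M' t β 0 = mlo / t.2.1 by unfold bpM; exact bp_zero _ _ _, hJM,
          show bpN nlo N' t β 0 = nlo / t.2.2 by unfold bpN; exact bp_zero _ _ _, hJN]

/-- Cells recombined: `∑_{k<J} ∑_{r ∈ cell_k ∩ F} h r ≤ ∑_{r ∈ [1, R]} h r` for `h ≥ 0` (`r`-cells of `(rlo, R]`). [folklore] -/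
theorem sum_cells_filter_le_sum_Icc {rlo R : ℕ} {β : ℝ} (hβ : 1 ≤ β) {J : ℕ} (hJR : bp rlo R β J = R)
    (F : ℕ → Prop) [DecidablePred F] (h : ℕ → ℝ) (hh : ∀ r, 0 ≤ h r) :
    ∑ k ∈ range J, ∑ r ∈ (Ioc (bp rlo R β k) (bp rlo R β (k + 1))).filter F, h r ≤ ∑ r ∈ Icc 1 R, h r := by
  rw [← sum_filter_Ioc_eq_sum_cells (bp_mono _ _ hβ) F h J, bp_zero, hJR]
  refine Finset.sum_le_sum_of_subset_of_nonneg ?_ fun r _ _ => hh r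
  intro r hr
  rw [Finset.mem_filter, Finset.mem_Ioc] at hr
  rw [Finset.mem_Icc]; omega

/-- `∑_{r ≤ R} #goodS(r) = #{(r, s') : …} ≤ ρ_J(K̃)`. [folklore] -/
theorem sum_card_goodS_le_rhoJ {P R Kt : ℕ} (hP : 0 < P) (hKt : 0 < Kt) (Jf : Finset ℕ) (Smax : ℕ) :
    ∑ r ∈ Icc 1 R, (((goodS P Smax Kt Jf r).card : ℕ) : ℝ) ≤ rhoJ P R Jf Kt := by
  classical
  refine le_trans (le_of_eq ?_) (card_pairs_rs_le_rhoJ hP hKt Jf Smax)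
  rw [Finset.card_filter, Finset.sum_product]
  push_cast
  refine Finset.sum_congr rfl fun r _ => ?_
  rw [goodS, Finset.card_filter]
  push_cast
  rfl

set_option maxHeartbeats 800000 in
/-- **The ambiguous `A`-part of one reduction term is dominated by `∑ ρ_J(K̃)`** over the tuples
`(l, m'', n'')` of the piece with profile `v` and `K̃ ≥ 1`. [cite: BombieriFriedlanderIwaniecActa1986, §13 p. 241–242] -/
theorem ambTotalA_le {a : ℤ} (ha : a ≠ 0) (z : ℝ) {mlo M' nlo N' L Q' rlo R S d g : ℕ}
    (hd : d ∣ a.natAbs) (hgΘ : g ∣ ThetaD a.natAbs d) (v : List ℕ) {t : ℤ × ℕ × ℕ}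
    (ht : t ∈ Tsel a d g (profFun a v)) (hQ' : 0 < Q') {β : ℝ} (hβ : 1 ≤ β) {J : ℕ}
    (hJM : bpM mlo M' t β J = M' / t.2.1) (hJN : bpN nlo N' t β J = N' / t.2.2)
    (hJR : bp rlo R β J = R) (hJL : bp 0 L β J = L)
    (hpos : a < (((mlo + 1) * (nlo + 1) : ℕ) : ℤ)) {c₁ c₂ : ℕ} (hc₁ : 0 < c₁) (hc₂ : 0 < c₂)
    (hspread : ∀ k κ, ∀ r ∈ Ioc (bp rlo R β k) (bp rlo R β (k + 1)), ∀ l ∈ Ioc (bp 0 L β κ) (bp 0 L β (κ + 1)),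
      ∀ i j, ∀ m ∈ Ioc (bpM mlo M' t β i) (bpM mlo M' t β (i + 1)),
      ∀ n ∈ Ioc (bpN nlo N' t β j) (bpN nlo N' t β (j + 1)),
      bp rlo R β (k + 1) * KpOf a mlo M' nlo N' L t β κ i j * c₁ ≤
        (bp rlo R β k + 1) * KmOf a mlo M' nlo N' L t β κ i j * c₂) :
    ∑ k ∈ range J, ∑ κ ∈ range J,
      ∑ r ∈ (Ioc (bp rlo R β k) (bp rlo R β (k + 1))).filter (fun r : ℕ => IsCoprime (r : ℤ) a),
        ∑ l ∈ (Ioc (bp 0 L β κ) (bp 0 L β (κ + 1))).filter (fun l : ℕ => l.Coprime r ∧ profVec a l = v),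
          wRL a z d g t l * ∑ i ∈ range J, ∑ j ∈ range J, ambAOf a z mlo M' nlo N' L Q' rlo R S d g t β k κ i j r l ≤
      ∑ p ∈ Splus a mlo M' nlo N' L d g t v,
        (rhoJ (Pa a d g) R (Jfix Q' g (Ea a d g) (Pa a d g) c₁ c₂) (Ktil a d g t p) : ℝ) := by
  classical
  have hP0 : 0 < Pa a d g := Pa_pos a d g
  set Jf := Jfix Q' g (Ea a d g) (Pa a d g) c₁ c₂ with hJf
  set G : ℕ → ℕ → ℕ → ℕ → ℝ := fun r l m n =>
    if 1 ≤ Ktil a d g t (l, (m, n)) then (((goodS (Pa a d g) (S / g) (Ktil a d g t (l, (m, n))) Jf r).card : ℕ) : ℝ) else 0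
    with hG
  have hG0 : ∀ r l m n, 0 ≤ G r l m n := by intro r l m n; simp only [hG]; split_ifs <;> positivity
  set H : ℕ → ℕ → ℝ := fun r l =>
    ∑ m ∈ Ioc (mlo / t.2.1) (M' / t.2.1), ∑ n ∈ Ioc (nlo / t.2.2) (N' / t.2.2), G r l m n with hH
  have hH0 : ∀ r l, 0 ≤ H r l := fun r l => Finset.sum_nonneg fun m _ => Finset.sum_nonneg fun n _ => hG0 r l m n
  -- Step 1: `wRL ≤ 1` and the per-`(r,l)` bound
  have h1 : ∀ k ∈ range J, ∀ κ ∈ range J,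
      ∀ r ∈ (Ioc (bp rlo R β k) (bp rlo R β (k + 1))).filter (fun r : ℕ => IsCoprime (r : ℤ) a),
      ∀ l ∈ (Ioc (bp 0 L β κ) (bp 0 L β (κ + 1))).filter (fun l : ℕ => l.Coprime r ∧ profVec a l = v),
        wRL a z d g t l * ∑ i ∈ range J, ∑ j ∈ range J, ambAOf a z mlo M' nlo N' L Q' rlo R S d g t β k κ i j r l ≤
          H r l := by
    intro k _ κ _ r hr l hl
    have hamb0 : 0 ≤ ∑ i ∈ range J, ∑ j ∈ range J, ambAOf a z mlo M' nlo N' L Q' rlo R S d g t β k κ i j r l :=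
      Finset.sum_nonneg fun i _ => Finset.sum_nonneg fun j _ => ambAOf_nonneg _ _ _ _ _ _ _ _ _ _ _ _ _ _ _ _ _ _ _ _ _
    refine (mul_le_of_le_one_left hamb0 (wRL_mem a z d g t l).2).trans ?_
    rw [Finset.mem_filter] at hr hl
    exact sum_ambAOf_le ha z hd hgΘ v ht hQ' hJM hJN hβ hpos hc₁ hc₂
      (fun i j m hm n hn => hspread k κ r hr.1 l hl.1 i j m hm n hn) hr.1 hl.1 hl.2.2
  -- Step 2: sum, recombine the cells, drop the filters
  have h2 : ∑ k ∈ range J, ∑ κ ∈ range J,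
      ∑ r ∈ (Ioc (bp rlo R β k) (bp rlo R β (k + 1))).filter (fun r : ℕ => IsCoprime (r : ℤ) a),
        ∑ l ∈ (Ioc (bp 0 L β κ) (bp 0 L β (κ + 1))).filter (fun l : ℕ => l.Coprime r ∧ profVec a l = v), H r l ≤
      ∑ r ∈ Icc 1 R, ∑ l ∈ (Icc 1 L).filter (fun l : ℕ => profVec a l = v), H r l := by
    -- swap `κ` and `r`, recombine `l`, then recombine `r`
    rw [Finset.sum_congr rfl fun k _ => Finset.sum_comm]
    have hl : ∀ r : ℕ, ∑ κ ∈ range J,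
        ∑ l ∈ (Ioc (bp 0 L β κ) (bp 0 L β (κ + 1))).filter (fun l : ℕ => l.Coprime r ∧ profVec a l = v), H r l ≤
        ∑ l ∈ (Icc 1 L).filter (fun l : ℕ => profVec a l = v), H r l := by
      intro r
      rw [← sum_filter_Ioc_eq_sum_cells (bp_mono _ _ hβ) _ _ J, bp_zero, hJL]
      refine Finset.sum_le_sum_of_subset_of_nonneg ?_ fun l _ _ => hH0 r l
      intro l hl'
      rw [Finset.mem_filter, Finset.mem_Ioc] at hl'
      rw [Finset.mem_filter, Finset.mem_Icc]
      exact ⟨⟨by omega, hl'.1.2⟩, hl'.2.2⟩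
    calc ∑ k ∈ range J, ∑ r ∈ (Ioc (bp rlo R β k) (bp rlo R β (k + 1))).filter (fun r : ℕ => IsCoprime (r : ℤ) a),
          ∑ κ ∈ range J, ∑ l ∈ (Ioc (bp 0 L β κ) (bp 0 L β (κ + 1))).filter (fun l : ℕ => l.Coprime r ∧ profVec a l = v), H r l
        ≤ ∑ k ∈ range J, ∑ r ∈ (Ioc (bp rlo R β k) (bp rlo R β (k + 1))).filter (fun r : ℕ => IsCoprime (r : ℤ) a),
          ∑ l ∈ (Icc 1 L).filter (fun l : ℕ => profVec a l = v), H r l :=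
          Finset.sum_le_sum fun k _ => Finset.sum_le_sum fun r _ => hl r
      _ ≤ ∑ r ∈ Icc 1 R, ∑ l ∈ (Icc 1 L).filter (fun l : ℕ => profVec a l = v), H r l :=
          sum_cells_filter_le_sum_Icc hβ hJR _ _ fun r => Finset.sum_nonneg fun l _ => hH0 r l
  -- Step 3: swap to the tuples and use the injection
  have h3 : ∑ r ∈ Icc 1 R, ∑ l ∈ (Icc 1 L).filter (fun l : ℕ => profVec a l = v), H r l ≤
      ∑ p ∈ Splus a mlo M' nlo N' L d g t v, (rhoJ (Pa a d g) R Jf (Ktil a d g t p) : ℝ) := by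
    have eR : ∑ p ∈ Splus a mlo M' nlo N' L d g t v, (rhoJ (Pa a d g) R Jf (Ktil a d g t p) : ℝ) =
        ∑ l ∈ (Icc 1 L).filter (fun l : ℕ => profVec a l = v), ∑ m ∈ Ioc (mlo / t.2.1) (M' / t.2.1),
          ∑ n ∈ Ioc (nlo / t.2.2) (N' / t.2.2),
            (if 1 ≤ Ktil a d g t (l, (m, n)) then (rhoJ (Pa a d g) R Jf (Ktil a d g t (l, (m, n))) : ℝ) else 0) := by
      unfold Splus
      rw [Finset.sum_filter, Finset.sum_product]
      refine Finset.sum_congr rfl fun l _ => ?_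
      rw [Finset.sum_product]
    rw [eR, Finset.sum_comm]
    refine Finset.sum_le_sum fun l _ => ?_
    simp only [hH]
    rw [Finset.sum_comm]
    refine Finset.sum_le_sum fun m _ => ?_
    rw [Finset.sum_comm]
    refine Finset.sum_le_sum fun n _ => ?_
    simp only [hG]
    by_cases hK : 1 ≤ Ktil a d g t (l, (m, n))
    · simp only [hK, if_true]
      exact sum_card_goodS_le_rhoJ hP0 hK Jf (S / g)
    · simp only [hK, if_false, Finset.sum_const_zero, le_refl]
  calc _ ≤ ∑ k ∈ range J, ∑ κ ∈ range J,
        ∑ r ∈ (Ioc (bp rlo R β k) (bp rlo R β (k + 1))).filter (fun r : ℕ => IsCoprime (r : ℤ) a),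
          ∑ l ∈ (Ioc (bp 0 L β κ) (bp 0 L β (κ + 1))).filter (fun l : ℕ => l.Coprime r ∧ profVec a l = v), H r l :=
        Finset.sum_le_sum fun k hk => Finset.sum_le_sum fun κ hκ => Finset.sum_le_sum fun r hr =>
          Finset.sum_le_sum fun l hl => h1 k hk κ hκ r hr l hl
    _ ≤ _ := h2.trans h3

/-! ### The ambiguous `B`-part: model weights and short ranges of `s'` -/

/-- `φ(d m) ≤ d φ(m)`. [folklore] -/
theorem totient_mul_le (d m : ℕ) : Nat.totient (d * m) ≤ d * Nat.totient m := by
  induction d using Nat.recOnMul generalizing m with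
  | zero => simp
  | one => simp
  | prime p hp =>
    by_cases h : p ∣ m
    · rw [Nat.totient_mul_of_prime_of_dvd hp h]
    · rw [Nat.totient_mul_of_prime_of_not_dvd hp h]
      exact Nat.mul_le_mul_right _ (Nat.sub_le p 1)
  | mul a b iha ihb =>
    calc Nat.totient (a * b * m) = Nat.totient (a * (b * m)) := by rw [mul_assoc]
      _ ≤ a * Nat.totient (b * m) := iha (b * m)
      _ ≤ a * (b * Nat.totient m) := Nat.mul_le_mul_left _ (ihb m)
      _ = a * b * Nat.totient m := by ring

/-- **The model weight is at most `|ã|/φ(w)`** (`ã, w ≠ 0`): `P_ã(k; w) ≤ 1/φ(w/(ã,w)) ≤ (ã,w)/φ(w)`.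
[folklore] -/
theorem pmodel_le_natAbs_div {ared : ℤ} (hared : ared ≠ 0) (k : ℕ) {w : ℕ} (hw : 0 < w) :
    pmodel ared k w ≤ (ared.natAbs : ℝ) / Nat.totient w := by
  have hA : 0 < ared.natAbs := Int.natAbs_pos.2 hared
  have hφw : (0 : ℝ) < Nat.totient w := by exact_mod_cast Nat.totient_pos.2 hw
  unfold pmodel
  split_ifs with h
  · set e := Nat.gcd ared.natAbs w with he
    have he0 : 0 < e := Nat.gcd_pos_of_pos_right _ hw
    have hew : e ∣ w := Nat.gcd_dvd_right _ _
    have heA : e ≤ ared.natAbs := Nat.le_of_dvd hA (Nat.gcd_dvd_left _ _)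
    have hwe : 0 < w / e := Nat.div_pos (Nat.le_of_dvd hw hew) he0
    have hφ : (0 : ℝ) < Nat.totient (w / e) := by exact_mod_cast Nat.totient_pos.2 hwe
    -- `φ(w) ≤ e φ(w/e)`
    have h1 : Nat.totient w ≤ e * Nat.totient (w / e) := by
      have := totient_mul_le e (w / e)
      rwa [Nat.mul_div_cancel' hew] at this
    have h1' : (Nat.totient w : ℝ) ≤ (e : ℝ) * Nat.totient (w / e) := by exact_mod_cast h1
    rw [inv_eq_one_div, div_le_div_iff₀ hφ hφw, one_mul]
    calc (Nat.totient w : ℝ) ≤ (e : ℝ) * Nat.totient (w / e) := h1'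
      _ ≤ (ared.natAbs : ℝ) * Nat.totient (w / e) :=
          mul_le_mul_of_nonneg_right (by exact_mod_cast heA) hφ.le
  · positivity

/-- **The model count of a cell is at most `|ã| |C_m| |C_n|/φ(w)`.** [folklore] -/
theorem gmodel_le_card_div {ared : ℤ} (hared : ared ≠ 0) (z : ℝ) (SM SN : Finset ℕ) (lc L₀ : ℕ) {w : ℕ}
    (hw : 0 < w) (lo hi : ℤ) :
    gmodel ared z SM SN lc L₀ w lo hi ≤ (ared.natAbs : ℝ) * SM.card * SN.card / Nat.totient w := by
  unfold gmodel
  have hφw : (0 : ℝ) < Nat.totient w := by exact_mod_cast Nat.totient_pos.2 hw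
  calc ∑ m ∈ SM, ∑ n ∈ SN, pmodel ared (lc * m * n) w * wind lo hi (L₀ * m * n) * (roughIndicator z m * roughIndicator z n)
      ≤ ∑ m ∈ SM, ∑ n ∈ SN, (ared.natAbs : ℝ) / Nat.totient w := by
        refine Finset.sum_le_sum fun m _ => Finset.sum_le_sum fun n _ => ?_
        have h1 := pmodel_le_natAbs_div hared (lc * m * n) hw
        have h2 : wind lo hi (L₀ * m * n) ≤ 1 := by unfold wind; split_ifs <;> norm_num
        have h2' : 0 ≤ wind lo hi (L₀ * m * n) := by unfold wind; split_ifs <;> norm_num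
        have h3 : roughIndicator z m * roughIndicator z n ≤ 1 :=
          mul_le_one₀ (roughIndicator_le_one' z m) (roughIndicator_nonneg z n) (roughIndicator_le_one' z n)
        have h3' : 0 ≤ roughIndicator z m * roughIndicator z n :=
          mul_nonneg (roughIndicator_nonneg z m) (roughIndicator_nonneg z n)
        have h0 : 0 ≤ pmodel ared (lc * m * n) w := pmodel_nonneg _ _ _
        calc pmodel ared (lc * m * n) w * wind lo hi (L₀ * m * n) * (roughIndicator z m * roughIndicator z n)
            ≤ pmodel ared (lc * m * n) w * 1 * 1 := by gcongr
          _ ≤ (ared.natAbs : ℝ) / Nat.totient w := by rw [mul_one, mul_one]; exact h1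
    _ = (ared.natAbs : ℝ) * SM.card * SN.card / Nat.totient w := by
        simp only [Finset.sum_const, nsmul_eq_mul]; ring

/-- The `s'`-window sum of `1/φ` over the two ambiguous ranges of the cell `(k, κ, i, j)`. [folklore] -/
def winSum (a : ℤ) (mlo M' nlo N' L Q' rlo R g : ℕ) (t : ℤ × ℕ × ℕ) (β : ℝ) (k κ i j : ℕ) : ℝ :=
  (∑ s' ∈ Icc ((KmOf a mlo M' nlo N' L t β κ i j + 2 * (Q' * g * bp rlo R β (k + 1)) - 1) / (2 * (Q' * g * bp rlo R β (k + 1))))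
      ((KpOf a mlo M' nlo N' L t β κ i j + 2 * (Q' * g * (bp rlo R β k + 1)) - 1) / (2 * (Q' * g * (bp rlo R β k + 1))) - 1),
    (1 : ℝ) / Nat.totient s') +
  ∑ s' ∈ Ioc ((KmOf a mlo M' nlo N' L t β κ i j - 1) / (Q' * g * bp rlo R β (k + 1)))
      ((KpOf a mlo M' nlo N' L t β κ i j - 1) / (Q' * g * (bp rlo R β k + 1))), (1 : ℝ) / Nat.totient s'

/-- `winSum ≥ 0`. [folklore] -/
theorem winSum_nonneg (a : ℤ) (mlo M' nlo N' L Q' rlo R g : ℕ) (t : ℤ × ℕ × ℕ) (β : ℝ) (k κ i j : ℕ) :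
    0 ≤ winSum a mlo M' nlo N' L Q' rlo R g t β k κ i j := by
  unfold winSum
  exact add_nonneg (Finset.sum_nonneg fun _ _ => by positivity) (Finset.sum_nonneg fun _ _ => by positivity)

/-- **The `B`-part of one `(r, l)` and one cell**: `ambBOf ≤ |ã| |C_i| |C_j| winSum / φ(P r)`. [folklore] -/
theorem ambBOf_le {a : ℤ} (ha : a ≠ 0) (z : ℝ) (mlo M' nlo N' L : ℕ) {Q' rlo R S d g : ℕ} (t : ℤ × ℕ × ℕ)
    (β : ℝ) (k κ i j : ℕ) {r : ℕ} (hr : 0 < r) (l : ℕ) :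
    ambBOf a z mlo M' nlo N' L Q' rlo R S d g t β k κ i j r l ≤
      ((a / (Ea a d g : ℤ)).natAbs : ℝ) * (Ioc (bpM mlo M' t β i) (bpM mlo M' t β (i + 1))).card *
        (Ioc (bpN nlo N' t β j) (bpN nlo N' t β (j + 1))).card *
        winSum a mlo M' nlo N' L Q' rlo R g t β k κ i j / Nat.totient (Pa a d g * r) := by
  have hP0 : 0 < Pa a d g := Pa_pos a d g
  have hE0 : 0 < Ea a d g := Ea_pos a d g
  have hared : a / (Ea a d g : ℤ) ≠ 0 := by
    have hEa : (Ea a d g : ℤ) ∣ a := Int.natCast_dvd.2 (Ered_dvd (fun _ hp => prime_of_mem_psA hp) ha _)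
    intro h0
    have := Int.mul_ediv_cancel' hEa
    rw [h0, mul_zero] at this
    exact ha this.symm
  have hφPr : (0 : ℝ) < Nat.totient (Pa a d g * r) := by exact_mod_cast Nat.totient_pos.2 (Nat.mul_pos hP0 hr)
  set Cm := ((Ioc (bpM mlo M' t β i) (bpM mlo M' t β (i + 1))).card : ℝ) with hCm
  set Cn := ((Ioc (bpN nlo N' t β j) (bpN nlo N' t β (j + 1))).card : ℝ) with hCn
  set Aab := ((a / (Ea a d g : ℤ)).natAbs : ℝ) with hAab
  unfold ambBOf
  -- each term
  have hterm : ∀ s' : ℕ, 0 < s' →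
      gmodel (a / (Ea a d g : ℤ)) z (Ioc (bpM mlo M' t β i) (bpM mlo M' t β (i + 1)))
        (Ioc (bpN nlo N' t β j) (bpN nlo N' t β (j + 1))) (lred a d g t l) (l * t.2.1 * t.2.2) (Pa a d g * r * s')
        (a + (Q' : ℤ) * r * ((g * s' : ℕ) : ℤ)) (a + 2 * (Q' : ℤ) * r * ((g * s' : ℕ) : ℤ)) ≤
      Aab * Cm * Cn / Nat.totient (Pa a d g * r) * ((1 : ℝ) / Nat.totient s') := by
    intro s' hs'
    have hw : 0 < Pa a d g * r * s' := Nat.mul_pos (Nat.mul_pos hP0 hr) hs'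
    refine (gmodel_le_card_div hared z _ _ _ _ hw _ _).trans ?_
    rw [← hCm, ← hCn, ← hAab]
    have hφs : (0 : ℝ) < Nat.totient s' := by exact_mod_cast Nat.totient_pos.2 hs'
    have hφw : (0 : ℝ) < Nat.totient (Pa a d g * r * s') := by exact_mod_cast Nat.totient_pos.2 hw
    have hsup : (Nat.totient (Pa a d g * r) : ℝ) * Nat.totient s' ≤ Nat.totient (Pa a d g * r * s') := by
      exact_mod_cast Nat.totient_super_multiplicative (Pa a d g * r) s'
    rw [div_mul_div_comm, mul_one]
    exact div_le_div_of_nonneg_left (by positivity) (by positivity) hsup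
  -- sum over the filter, then enlarge the filter to the two ranges
  calc ∑ s' ∈ (Icc 1 (S / g)).filter (fun s' : ℕ =>
          s' ∈ Icc ((KmOf a mlo M' nlo N' L t β κ i j + 2 * (Q' * g * bp rlo R β (k + 1)) - 1) / (2 * (Q' * g * bp rlo R β (k + 1))))
            ((KpOf a mlo M' nlo N' L t β κ i j + 2 * (Q' * g * (bp rlo R β k + 1)) - 1) / (2 * (Q' * g * (bp rlo R β k + 1))) - 1) ∨
          s' ∈ Ioc ((KmOf a mlo M' nlo N' L t β κ i j - 1) / (Q' * g * bp rlo R β (k + 1)))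
            ((KpOf a mlo M' nlo N' L t β κ i j - 1) / (Q' * g * (bp rlo R β k + 1)))),
        gmodel (a / (Ea a d g : ℤ)) z (Ioc (bpM mlo M' t β i) (bpM mlo M' t β (i + 1)))
          (Ioc (bpN nlo N' t β j) (bpN nlo N' t β (j + 1))) (lred a d g t l) (l * t.2.1 * t.2.2) (Pa a d g * r * s')
          (a + (Q' : ℤ) * r * ((g * s' : ℕ) : ℤ)) (a + 2 * (Q' : ℤ) * r * ((g * s' : ℕ) : ℤ))
      ≤ ∑ s' ∈ (Icc 1 (S / g)).filter (fun s' : ℕ =>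
          s' ∈ Icc ((KmOf a mlo M' nlo N' L t β κ i j + 2 * (Q' * g * bp rlo R β (k + 1)) - 1) / (2 * (Q' * g * bp rlo R β (k + 1))))
            ((KpOf a mlo M' nlo N' L t β κ i j + 2 * (Q' * g * (bp rlo R β k + 1)) - 1) / (2 * (Q' * g * (bp rlo R β k + 1))) - 1) ∨
          s' ∈ Ioc ((KmOf a mlo M' nlo N' L t β κ i j - 1) / (Q' * g * bp rlo R β (k + 1)))
            ((KpOf a mlo M' nlo N' L t β κ i j - 1) / (Q' * g * (bp rlo R β k + 1)))),
        Aab * Cm * Cn / Nat.totient (Pa a d g * r) * ((1 : ℝ) / Nat.totient s') :=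
        Finset.sum_le_sum fun s' hs' => hterm s' (Finset.mem_Icc.1 (Finset.mem_filter.1 hs').1).1
    _ = Aab * Cm * Cn / Nat.totient (Pa a d g * r) * ∑ s' ∈ (Icc 1 (S / g)).filter (fun s' : ℕ =>
          s' ∈ Icc ((KmOf a mlo M' nlo N' L t β κ i j + 2 * (Q' * g * bp rlo R β (k + 1)) - 1) / (2 * (Q' * g * bp rlo R β (k + 1))))
            ((KpOf a mlo M' nlo N' L t β κ i j + 2 * (Q' * g * (bp rlo R β k + 1)) - 1) / (2 * (Q' * g * (bp rlo R β k + 1))) - 1) ∨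
          s' ∈ Ioc ((KmOf a mlo M' nlo N' L t β κ i j - 1) / (Q' * g * bp rlo R β (k + 1)))
            ((KpOf a mlo M' nlo N' L t β κ i j - 1) / (Q' * g * (bp rlo R β k + 1)))), ((1 : ℝ) / Nat.totient s') := by
        rw [Finset.mul_sum]
    _ ≤ Aab * Cm * Cn / Nat.totient (Pa a d g * r) * winSum a mlo M' nlo N' L Q' rlo R g t β k κ i j := by
        refine mul_le_mul_of_nonneg_left ?_ (by positivity)
        unfold winSum
        have hsub : (Icc 1 (S / g)).filter (fun s' : ℕ =>
            s' ∈ Icc ((KmOf a mlo M' nlo N' L t β κ i j + 2 * (Q' * g * bp rlo R β (k + 1)) - 1) / (2 * (Q' * g * bp rlo R β (k + 1))))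
              ((KpOf a mlo M' nlo N' L t β κ i j + 2 * (Q' * g * (bp rlo R β k + 1)) - 1) / (2 * (Q' * g * (bp rlo R β k + 1))) - 1) ∨
            s' ∈ Ioc ((KmOf a mlo M' nlo N' L t β κ i j - 1) / (Q' * g * bp rlo R β (k + 1)))
              ((KpOf a mlo M' nlo N' L t β κ i j - 1) / (Q' * g * (bp rlo R β k + 1)))) ⊆
            Icc ((KmOf a mlo M' nlo N' L t β κ i j + 2 * (Q' * g * bp rlo R β (k + 1)) - 1) / (2 * (Q' * g * bp rlo R β (k + 1))))
              ((KpOf a mlo M' nlo N' L t β κ i j + 2 * (Q' * g * (bp rlo R β k + 1)) - 1) / (2 * (Q' * g * (bp rlo R β k + 1))) - 1) ∪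
            Ioc ((KmOf a mlo M' nlo N' L t β κ i j - 1) / (Q' * g * bp rlo R β (k + 1)))
              ((KpOf a mlo M' nlo N' L t β κ i j - 1) / (Q' * g * (bp rlo R β k + 1))) := by
          intro s' hs'
          rw [Finset.mem_filter] at hs'
          rw [Finset.mem_union]
          exact hs'.2
        refine (Finset.sum_le_sum_of_subset_of_nonneg hsub fun _ _ _ => by positivity).trans ?_
        rw [← Finset.union_sdiff_self_eq_union, Finset.sum_union Finset.disjoint_sdiff]
        have : ∑ s' ∈ Ioc ((KmOf a mlo M' nlo N' L t β κ i j - 1) / (Q' * g * bp rlo R β (k + 1)))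
              ((KpOf a mlo M' nlo N' L t β κ i j - 1) / (Q' * g * (bp rlo R β k + 1))) \
            Icc ((KmOf a mlo M' nlo N' L t β κ i j + 2 * (Q' * g * bp rlo R β (k + 1)) - 1) / (2 * (Q' * g * bp rlo R β (k + 1))))
              ((KpOf a mlo M' nlo N' L t β κ i j + 2 * (Q' * g * (bp rlo R β k + 1)) - 1) / (2 * (Q' * g * (bp rlo R β k + 1))) - 1),
            (1 : ℝ) / Nat.totient s' ≤
            ∑ s' ∈ Ioc ((KmOf a mlo M' nlo N' L t β κ i j - 1) / (Q' * g * bp rlo R β (k + 1)))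
              ((KpOf a mlo M' nlo N' L t β κ i j - 1) / (Q' * g * (bp rlo R β k + 1))), (1 : ℝ) / Nat.totient s' :=
          Finset.sum_le_sum_of_subset_of_nonneg Finset.sdiff_subset fun _ _ _ => by positivity
        linarith
    _ = _ := by ring

/-- **The `B`-part of the ambiguous contribution of one reduction term.** [folklore] -/
theorem ambTotalB_le {a : ℤ} (ha : a ≠ 0) (z : ℝ) (mlo M' nlo N' L : ℕ) {Q' rlo R S d g : ℕ} (t : ℤ × ℕ × ℕ)
    (v : List ℕ) (β : ℝ) (J : ℕ) :
    ∑ k ∈ range J, ∑ κ ∈ range J,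
      ∑ r ∈ (Ioc (bp rlo R β k) (bp rlo R β (k + 1))).filter (fun r : ℕ => IsCoprime (r : ℤ) a),
        ∑ l ∈ (Ioc (bp 0 L β κ) (bp 0 L β (κ + 1))).filter (fun l : ℕ => l.Coprime r ∧ profVec a l = v),
          wRL a z d g t l * ∑ i ∈ range J, ∑ j ∈ range J, ambBOf a z mlo M' nlo N' L Q' rlo R S d g t β k κ i j r l ≤
      ((a / (Ea a d g : ℤ)).natAbs : ℝ) * ∑ k ∈ range J, ∑ κ ∈ range J,
        ∑ r ∈ (Ioc (bp rlo R β k) (bp rlo R β (k + 1))).filter (fun r : ℕ => IsCoprime (r : ℤ) a),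
          ∑ _l ∈ (Ioc (bp 0 L β κ) (bp 0 L β (κ + 1))).filter (fun l : ℕ => l.Coprime r ∧ profVec a l = v),
            ∑ i ∈ range J, ∑ j ∈ range J,
              ((Ioc (bpM mlo M' t β i) (bpM mlo M' t β (i + 1))).card : ℝ) *
                (Ioc (bpN nlo N' t β j) (bpN nlo N' t β (j + 1))).card *
                winSum a mlo M' nlo N' L Q' rlo R g t β k κ i j / Nat.totient (Pa a d g * r) := by
  rw [Finset.mul_sum]
  refine Finset.sum_le_sum fun k _ => ?_
  rw [Finset.mul_sum]
  refine Finset.sum_le_sum fun κ _ => ?_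
  rw [Finset.mul_sum]
  refine Finset.sum_le_sum fun r hr => ?_
  have hr0 : 0 < r := by
    rw [Finset.mem_filter, Finset.mem_Ioc] at hr; omega
  rw [Finset.mul_sum]
  refine Finset.sum_le_sum fun l _ => ?_
  have h0 : 0 ≤ ∑ i ∈ range J, ∑ j ∈ range J, ambBOf a z mlo M' nlo N' L Q' rlo R S d g t β k κ i j r l :=
    Finset.sum_nonneg fun i _ => Finset.sum_nonneg fun j _ => ambBOf_nonneg _ _ _ _ _ _ _ _ _ _ _ _ _ _ _ _ _ _ _ _ _
  refine (mul_le_of_le_one_left h0 (wRL_mem a z d g t l).2).trans ?_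
  rw [Finset.mul_sum]
  refine Finset.sum_le_sum fun i _ => ?_
  rw [Finset.mul_sum]
  refine Finset.sum_le_sum fun j _ => ?_
  have h := ambBOf_le ha z mlo M' nlo N' L (Q' := Q') (rlo := rlo) (R := R) (S := S) (d := d) (g := g) t β k κ i j hr0 l
  refine h.trans (le_of_eq ?_)
  ring

/-! ### The spread condition from the cell construction (`β = 1 + 1/D₀`) -/

/-- In a cell of `bp lo X (1 + 1/D₀)`, the endpoints satisfy `D₀ · b_{i+1} ≤ (D₀ + 2)(b_i + 1)` as soon as
the cell is nonempty. [folklore] -/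
theorem cell_ratio_nat {lo X D₀ : ℕ} (hD₀ : 0 < D₀) {i m : ℕ}
    (hm : m ∈ Ioc (bp lo X (1 + 1 / (D₀ : ℝ)) i) (bp lo X (1 + 1 / (D₀ : ℝ)) (i + 1))) :
    D₀ * bp lo X (1 + 1 / (D₀ : ℝ)) (i + 1) ≤ (D₀ + 2) * (bp lo X (1 + 1 / (D₀ : ℝ)) i + 1) := by
  have hD₀' : (0 : ℝ) < D₀ := by exact_mod_cast hD₀
  have hβ1 : (1 : ℝ) ≤ 1 + 1 / (D₀ : ℝ) := le_add_of_nonneg_right (by positivity)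
  have hmc := Finset.mem_Ioc.1 hm
  -- both endpoints `b_i + 1` and `b_{i+1}` lie in the cell
  have hlo : bp lo X (1 + 1 / (D₀ : ℝ)) i + 1 ∈
      Ioc (bp lo X (1 + 1 / (D₀ : ℝ)) i) (bp lo X (1 + 1 / (D₀ : ℝ)) (i + 1)) := by
    rw [Finset.mem_Ioc]; omega
  have hhi : bp lo X (1 + 1 / (D₀ : ℝ)) (i + 1) ∈
      Ioc (bp lo X (1 + 1 / (D₀ : ℝ)) i) (bp lo X (1 + 1 / (D₀ : ℝ)) (i + 1)) := by
    rw [Finset.mem_Ioc]; omega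
  have h := cell_spread hβ1 hlo hhi
  -- `b_{i+1} ≤ β (b_i + 1) + (β − 1)`; multiply by `D₀`
  have h2 : (D₀ : ℝ) * bp lo X (1 + 1 / (D₀ : ℝ)) (i + 1) ≤
      ((D₀ : ℝ) + 1) * ((bp lo X (1 + 1 / (D₀ : ℝ)) i : ℝ) + 1) + 1 := by
    have e1 : (D₀ : ℝ) * (1 + 1 / (D₀ : ℝ)) = D₀ + 1 := by field_simp
    have e2 : (D₀ : ℝ) * (1 + 1 / (D₀ : ℝ) - 1) = 1 := by field_simp; ring
    have := mul_le_mul_of_nonneg_left h hD₀'.le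
    push_cast at this
    have e3 : (D₀ : ℝ) * ((1 + 1 / (D₀ : ℝ)) * ((bp lo X (1 + 1 / (D₀ : ℝ)) i : ℝ) + 1) + (1 + 1 / (D₀ : ℝ) - 1)) =
        ((D₀ : ℝ) + 1) * ((bp lo X (1 + 1 / (D₀ : ℝ)) i : ℝ) + 1) + 1 := by
      rw [mul_add, ← mul_assoc, e1, e2]
    linarith
  have h3 : D₀ * bp lo X (1 + 1 / (D₀ : ℝ)) (i + 1) ≤ (D₀ + 1) * (bp lo X (1 + 1 / (D₀ : ℝ)) i + 1) + 1 := by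
    exact_mod_cast h2
  nlinarith

/-- The integer inequality behind the spread condition. [folklore] -/
theorem spread_ineq_int {D X Y a A : ℤ} (hD : 1 ≤ D) (hA1 : 1 ≤ A) (ha : a ≤ A)
    (h1 : D ^ 3 * X ≤ (D + 2) ^ 3 * Y) (h2 : 4 * A * D < Y) :
    D ^ 4 * (X - a) ≤ (D + 2) ^ 3 * (D + 1) * (Y - a) := by
  have hD0 : 0 ≤ D := by linarith
  have step1 : D ^ 4 * X ≤ D * ((D + 2) ^ 3 * Y) := by
    have := mul_le_mul_of_nonneg_left h1 hD0
    calc D ^ 4 * X = D * (D ^ 3 * X) := by ring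
      _ ≤ D * ((D + 2) ^ 3 * Y) := this
  have ecoef : (D + 1) * (D + 2) ^ 3 - D ^ 4 = 7 * D ^ 3 + 18 * D ^ 2 + 20 * D + 8 := by ring
  have hcoef : 0 ≤ (D + 1) * (D + 2) ^ 3 - D ^ 4 := by
    rw [ecoef]; nlinarith [pow_nonneg hD0 2, pow_nonneg hD0 3]
  have step2 : a * ((D + 1) * (D + 2) ^ 3 - D ^ 4) ≤ A * ((D + 1) * (D + 2) ^ 3 - D ^ 4) :=
    mul_le_mul_of_nonneg_right ha hcoef
  have step3 : A * ((D + 1) * (D + 2) ^ 3 - D ^ 4) ≤ (D + 2) ^ 3 * Y := by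
    have h4 : (D + 1) * (D + 2) ^ 3 - D ^ 4 ≤ 4 * D * (D + 2) ^ 3 := by
      rw [ecoef]
      have e4 : 4 * D * (D + 2) ^ 3 = 4 * D ^ 4 + 24 * D ^ 3 + 48 * D ^ 2 + 32 * D := by ring
      rw [e4]
      nlinarith [pow_nonneg hD0 2, pow_nonneg hD0 3, pow_nonneg hD0 4, pow_le_pow_left₀ (by norm_num : (0:ℤ) ≤ 1) hD 4,
        pow_le_pow_left₀ (by norm_num : (0:ℤ) ≤ 1) hD 3]
    have h5 : A * ((D + 1) * (D + 2) ^ 3 - D ^ 4) ≤ A * (4 * D * (D + 2) ^ 3) :=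
      mul_le_mul_of_nonneg_left h4 (by linarith)
    have h6 : A * (4 * D * (D + 2) ^ 3) = (4 * A * D) * (D + 2) ^ 3 := by ring
    have h7 : (4 * A * D) * (D + 2) ^ 3 ≤ Y * (D + 2) ^ 3 :=
      mul_le_mul_of_nonneg_right h2.le (by positivity)
    linarith
  nlinarith

set_option maxHeartbeats 800000 in
/-- **The spread condition** `r₊ K₊ D₀⁵ ≤ r₋ K₋ (D₀+2)⁴(D₀+1)` for nonempty cells whose lower corner
exceeds `4 |a| D₀`. [folklore] -/
theorem spread_of_cells {a : ℤ} (ha : a ≠ 0) {mlo M' nlo N' L rlo R D₀ : ℕ} (hD₀ : 0 < D₀) {t : ℤ × ℕ × ℕ}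
    {k κ i j r l m n : ℕ}
    (hr : r ∈ Ioc (bp rlo R (1 + 1 / (D₀ : ℝ)) k) (bp rlo R (1 + 1 / (D₀ : ℝ)) (k + 1)))
    (hl : l ∈ Ioc (bp 0 L (1 + 1 / (D₀ : ℝ)) κ) (bp 0 L (1 + 1 / (D₀ : ℝ)) (κ + 1)))
    (hm : m ∈ Ioc (bpM mlo M' t (1 + 1 / (D₀ : ℝ)) i) (bpM mlo M' t (1 + 1 / (D₀ : ℝ)) (i + 1)))
    (hn : n ∈ Ioc (bpN nlo N' t (1 + 1 / (D₀ : ℝ)) j) (bpN nlo N' t (1 + 1 / (D₀ : ℝ)) (j + 1)))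
    (hP : 4 * a.natAbs * D₀ < (bp 0 L (1 + 1 / (D₀ : ℝ)) κ + 1) * t.2.1 * t.2.2 *
      (bpM mlo M' t (1 + 1 / (D₀ : ℝ)) i + 1) * (bpN nlo N' t (1 + 1 / (D₀ : ℝ)) j + 1)) :
    bp rlo R (1 + 1 / (D₀ : ℝ)) (k + 1) * KpOf a mlo M' nlo N' L t (1 + 1 / (D₀ : ℝ)) κ i j * D₀ ^ 5 ≤
      (bp rlo R (1 + 1 / (D₀ : ℝ)) k + 1) * KmOf a mlo M' nlo N' L t (1 + 1 / (D₀ : ℝ)) κ i j *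
        ((D₀ + 2) ^ 4 * (D₀ + 1)) := by
  -- ratios of the four cells
  have hrat_r := cell_ratio_nat hD₀ hr
  have hrat_l := cell_ratio_nat hD₀ hl
  have hrat_m : D₀ * bpM mlo M' t (1 + 1 / (D₀ : ℝ)) (i + 1) ≤ (D₀ + 2) * (bpM mlo M' t (1 + 1 / (D₀ : ℝ)) i + 1) := by
    unfold bpM at hm ⊢; exact cell_ratio_nat hD₀ hm
  have hrat_n : D₀ * bpN nlo N' t (1 + 1 / (D₀ : ℝ)) (j + 1) ≤ (D₀ + 2) * (bpN nlo N' t (1 + 1 / (D₀ : ℝ)) j + 1) := by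
    unfold bpN at hn ⊢; exact cell_ratio_nat hD₀ hn
  have hlcell := Finset.mem_Ioc.1 hl
  have hmcell := Finset.mem_Ioc.1 hm
  have hncell := Finset.mem_Ioc.1 hn
  -- the two products
  have hPP : D₀ ^ 3 * (bp 0 L (1 + 1 / (D₀ : ℝ)) (κ + 1) * t.2.1 * t.2.2 * bpM mlo M' t (1 + 1 / (D₀ : ℝ)) (i + 1) *
        bpN nlo N' t (1 + 1 / (D₀ : ℝ)) (j + 1)) ≤
      (D₀ + 2) ^ 3 * ((bp 0 L (1 + 1 / (D₀ : ℝ)) κ + 1) * t.2.1 * t.2.2 * (bpM mlo M' t (1 + 1 / (D₀ : ℝ)) i + 1) *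
        (bpN nlo N' t (1 + 1 / (D₀ : ℝ)) j + 1)) := by
    have h1 := Nat.mul_le_mul (Nat.mul_le_mul hrat_l hrat_m) hrat_n
    calc D₀ ^ 3 * (bp 0 L (1 + 1 / (D₀ : ℝ)) (κ + 1) * t.2.1 * t.2.2 * bpM mlo M' t (1 + 1 / (D₀ : ℝ)) (i + 1) *
          bpN nlo N' t (1 + 1 / (D₀ : ℝ)) (j + 1))
        = D₀ * bp 0 L (1 + 1 / (D₀ : ℝ)) (κ + 1) * (D₀ * bpM mlo M' t (1 + 1 / (D₀ : ℝ)) (i + 1)) *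
            (D₀ * bpN nlo N' t (1 + 1 / (D₀ : ℝ)) (j + 1)) * (t.2.1 * t.2.2) := by ring
      _ ≤ (D₀ + 2) * (bp 0 L (1 + 1 / (D₀ : ℝ)) κ + 1) * ((D₀ + 2) * (bpM mlo M' t (1 + 1 / (D₀ : ℝ)) i + 1)) *
            ((D₀ + 2) * (bpN nlo N' t (1 + 1 / (D₀ : ℝ)) j + 1)) * (t.2.1 * t.2.2) := Nat.mul_le_mul_right _ h1
      _ = _ := by ring
  have hmono : (bp 0 L (1 + 1 / (D₀ : ℝ)) κ + 1) * t.2.1 * t.2.2 * (bpM mlo M' t (1 + 1 / (D₀ : ℝ)) i + 1) *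
        (bpN nlo N' t (1 + 1 / (D₀ : ℝ)) j + 1) ≤
      bp 0 L (1 + 1 / (D₀ : ℝ)) (κ + 1) * t.2.1 * t.2.2 * bpM mlo M' t (1 + 1 / (D₀ : ℝ)) (i + 1) *
        bpN nlo N' t (1 + 1 / (D₀ : ℝ)) (j + 1) :=
    Nat.mul_le_mul (Nat.mul_le_mul (Nat.mul_le_mul_right _ (Nat.mul_le_mul_right _ (by omega))) (by omega)) (by omega)
  -- the `K`'s as integers
  have hA : (a : ℤ) ≤ a.natAbs := Int.le_natAbs
  have hA' : -(a : ℤ) ≤ a.natAbs := by have := Int.le_natAbs (a := -a); rwa [Int.natAbs_neg] at this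
  have hA1 : (1 : ℤ) ≤ a.natAbs := by exact_mod_cast Int.natAbs_pos.2 ha
  have hD1 : (1 : ℤ) ≤ D₀ := by exact_mod_cast hD₀
  have haP : a ≤ ((((bp 0 L (1 + 1 / (D₀ : ℝ)) κ + 1) * t.2.1 * t.2.2 * (bpM mlo M' t (1 + 1 / (D₀ : ℝ)) i + 1) *
        (bpN nlo N' t (1 + 1 / (D₀ : ℝ)) j + 1) : ℕ)) : ℤ) := by
    have h1 : ((4 * a.natAbs * D₀ : ℕ) : ℤ) <
        ((((bp 0 L (1 + 1 / (D₀ : ℝ)) κ + 1) * t.2.1 * t.2.2 * (bpM mlo M' t (1 + 1 / (D₀ : ℝ)) i + 1) *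
          (bpN nlo N' t (1 + 1 / (D₀ : ℝ)) j + 1) : ℕ)) : ℤ) := by exact_mod_cast hP
    have h2 : (a : ℤ) ≤ ((4 * a.natAbs * D₀ : ℕ) : ℤ) := by
      push_cast
      nlinarith [le_abs_self a, abs_nonneg a, mul_nonneg (abs_nonneg a) (sub_nonneg.2 hD1)]
    linarith
  have haP' : a ≤ ((bp 0 L (1 + 1 / (D₀ : ℝ)) (κ + 1) * t.2.1 * t.2.2 * bpM mlo M' t (1 + 1 / (D₀ : ℝ)) (i + 1) *
        bpN nlo N' t (1 + 1 / (D₀ : ℝ)) (j + 1) : ℕ) : ℤ) := by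
    have h2 : ((((bp 0 L (1 + 1 / (D₀ : ℝ)) κ + 1) * t.2.1 * t.2.2 * (bpM mlo M' t (1 + 1 / (D₀ : ℝ)) i + 1) *
        (bpN nlo N' t (1 + 1 / (D₀ : ℝ)) j + 1) : ℕ)) : ℤ) ≤
        ((bp 0 L (1 + 1 / (D₀ : ℝ)) (κ + 1) * t.2.1 * t.2.2 * bpM mlo M' t (1 + 1 / (D₀ : ℝ)) (i + 1) *
          bpN nlo N' t (1 + 1 / (D₀ : ℝ)) (j + 1) : ℕ) : ℤ) := by exact_mod_cast hmono
    linarith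
  have hKm : ((KmOf a mlo M' nlo N' L t (1 + 1 / (D₀ : ℝ)) κ i j : ℕ) : ℤ) =
      ((((bp 0 L (1 + 1 / (D₀ : ℝ)) κ + 1) * t.2.1 * t.2.2 * (bpM mlo M' t (1 + 1 / (D₀ : ℝ)) i + 1) *
        (bpN nlo N' t (1 + 1 / (D₀ : ℝ)) j + 1) : ℕ)) : ℤ) - a := by
    unfold KmOf; exact cellK_cast haP
  have hKp : ((KpOf a mlo M' nlo N' L t (1 + 1 / (D₀ : ℝ)) κ i j : ℕ) : ℤ) =
      ((bp 0 L (1 + 1 / (D₀ : ℝ)) (κ + 1) * t.2.1 * t.2.2 * bpM mlo M' t (1 + 1 / (D₀ : ℝ)) (i + 1) *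
        bpN nlo N' t (1 + 1 / (D₀ : ℝ)) (j + 1) : ℕ) : ℤ) - a := by
    unfold KpOf; exact cellK_cast haP'
  -- the integer inequality
  have hK : (D₀ : ℤ) ^ 4 * (KpOf a mlo M' nlo N' L t (1 + 1 / (D₀ : ℝ)) κ i j : ℤ) ≤
      ((D₀ : ℤ) + 2) ^ 3 * ((D₀ : ℤ) + 1) * (KmOf a mlo M' nlo N' L t (1 + 1 / (D₀ : ℝ)) κ i j : ℤ) := by
    rw [hKm, hKp]
    refine spread_ineq_int hD1 hA1 hA ?_ ?_
    · have := Nat.cast_le (α := ℤ).2 hPP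
      push_cast at this ⊢
      linarith
    · have := Nat.cast_lt (α := ℤ).2 hP
      push_cast at this ⊢
      linarith
  -- back to `ℕ` and combine with the `r`-ratio
  have hK' : D₀ ^ 4 * KpOf a mlo M' nlo N' L t (1 + 1 / (D₀ : ℝ)) κ i j ≤
      (D₀ + 2) ^ 3 * (D₀ + 1) * KmOf a mlo M' nlo N' L t (1 + 1 / (D₀ : ℝ)) κ i j := by
    exact_mod_cast hK
  have hfin := Nat.mul_le_mul hrat_r hK'
  calc bp rlo R (1 + 1 / (D₀ : ℝ)) (k + 1) * KpOf a mlo M' nlo N' L t (1 + 1 / (D₀ : ℝ)) κ i j * D₀ ^ 5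
      = (D₀ * bp rlo R (1 + 1 / (D₀ : ℝ)) (k + 1)) * (D₀ ^ 4 * KpOf a mlo M' nlo N' L t (1 + 1 / (D₀ : ℝ)) κ i j) := by ring
    _ ≤ ((D₀ + 2) * (bp rlo R (1 + 1 / (D₀ : ℝ)) k + 1)) *
          ((D₀ + 2) ^ 3 * (D₀ + 1) * KmOf a mlo M' nlo N' L t (1 + 1 / (D₀ : ℝ)) κ i j) := hfin
    _ = _ := by ring

/-- `ambTotal = A-total + B-total`. [folklore] -/
theorem ambTotal_eq (a : ℤ) (z : ℝ) (mlo M' nlo N' L Q' rlo R S d g : ℕ) (t : ℤ × ℕ × ℕ) (v : List ℕ) (β : ℝ) (J : ℕ) :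
    ambTotal a z mlo M' nlo N' L Q' rlo R S d g t v β J =
      (∑ k ∈ range J, ∑ κ ∈ range J,
        ∑ r ∈ (Ioc (bp rlo R β k) (bp rlo R β (k + 1))).filter (fun r : ℕ => IsCoprime (r : ℤ) a),
          ∑ l ∈ (Ioc (bp 0 L β κ) (bp 0 L β (κ + 1))).filter (fun l : ℕ => l.Coprime r ∧ profVec a l = v),
            wRL a z d g t l * ∑ i ∈ range J, ∑ j ∈ range J, ambAOf a z mlo M' nlo N' L Q' rlo R S d g t β k κ i j r l) +
      ∑ k ∈ range J, ∑ κ ∈ range J,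
        ∑ r ∈ (Ioc (bp rlo R β k) (bp rlo R β (k + 1))).filter (fun r : ℕ => IsCoprime (r : ℤ) a),
          ∑ l ∈ (Ioc (bp 0 L β κ) (bp 0 L β (κ + 1))).filter (fun l : ℕ => l.Coprime r ∧ profVec a l = v),
            wRL a z d g t l * ∑ i ∈ range J, ∑ j ∈ range J, ambBOf a z mlo M' nlo N' L Q' rlo R S d g t β k κ i j r l := by
  unfold ambTotal
  simp only [ambOf_eq, Finset.sum_add_distrib, mul_add]

/-! ### One switched piece: all reduction terms -/

/-- Monotonicity of list sums. [folklore] -/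
theorem list_sum_map_le {β : Type*} (T : List β) {f g : β → ℝ} (h : ∀ t ∈ T, f t ≤ g t) :
    (T.map f).sum ≤ (T.map g).sum := by
  induction T with
  | nil => simp
  | cons t T ih =>
    simp only [List.map_cons, List.sum_cons]
    exact add_le_add (h t (List.mem_cons_self)) (ih fun t' ht' => h t' (List.mem_cons_of_mem t ht'))

/-- The largest possible `D_m D_n`: `∏_{p ∣ a} p^{v_p(a)+1}`. [folklore] -/
def Amax (a : ℤ) : ℕ := ∏ p ∈ (psA a).toFinset, p ^ (padicValNat p a.natAbs + 1)

/-- `D_m, D_n ≤ D_m D_n ≤ Amax` for the reduction terms. [folklore] -/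
theorem le_Amax_of_mem_Tsel {a : ℤ} (ha : a ≠ 0) {d g : ℕ} (hd : d ∣ a.natAbs) (hgΘ : g ∣ ThetaD a.natAbs d)
    (prof : ℕ → ℕ) {t : ℤ × ℕ × ℕ} (ht : t ∈ Tsel a d g prof) : t.2.1 ≤ Amax a ∧ t.2.2 ≤ Amax a := by
  obtain ⟨-, hterms, -⟩ := Tsel_spec ha hd hgΘ prof
  obtain ⟨-, hDm, hDn, hdvd⟩ := hterms t ht
  have hA0 : 0 < Amax a := Finset.prod_pos fun p hp => pow_pos (prime_of_mem_psA (List.mem_toFinset.1 hp)).pos _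
  have hle : t.2.1 * t.2.2 ≤ Amax a := Nat.le_of_dvd hA0 hdvd
  exact ⟨le_trans (Nat.le_mul_of_pos_right _ hDn) hle, le_trans (Nat.le_mul_of_pos_left _ hDm) hle⟩

/-- The per-term bound of one reduction term `t` over the switched piece: corners, `A`-part, `B`-part.
[folklore] -/
def termBound (a : ℤ) (z : ℝ) (mlo M' nlo N' L Q' rlo R d g D₀ J : ℕ) (v : List ℕ) (t : ℤ × ℕ × ℕ) : ℝ :=
  (∑ k ∈ range J, ∑ κ ∈ range J, ∑ i ∈ range J, ∑ j ∈ range J,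
      cornersOf a z mlo M' nlo N' L Q' rlo R d g t (1 + 1 / (D₀ : ℝ)) k κ i j) +
  (∑ p ∈ Splus a mlo M' nlo N' L d g t v,
      (rhoJ (Pa a d g) R (Jfix Q' g (Ea a d g) (Pa a d g) (D₀ ^ 5) ((D₀ + 2) ^ 4 * (D₀ + 1))) (Ktil a d g t p) : ℝ)) +
  ((a / (Ea a d g : ℤ)).natAbs : ℝ) * ∑ k ∈ range J, ∑ κ ∈ range J,
      ∑ r ∈ (Ioc (bp rlo R (1 + 1 / (D₀ : ℝ)) k) (bp rlo R (1 + 1 / (D₀ : ℝ)) (k + 1))).filter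
          (fun r : ℕ => IsCoprime (r : ℤ) a),
        ∑ _l ∈ (Ioc (bp 0 L (1 + 1 / (D₀ : ℝ)) κ) (bp 0 L (1 + 1 / (D₀ : ℝ)) (κ + 1))).filter
            (fun l : ℕ => l.Coprime r ∧ profVec a l = v),
          ∑ i ∈ range J, ∑ j ∈ range J,
            ((Ioc (bpM mlo M' t (1 + 1 / (D₀ : ℝ)) i) (bpM mlo M' t (1 + 1 / (D₀ : ℝ)) (i + 1))).card : ℝ) *
              (Ioc (bpN nlo N' t (1 + 1 / (D₀ : ℝ)) j) (bpN nlo N' t (1 + 1 / (D₀ : ℝ)) (j + 1))).card *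
              winSum a mlo M' nlo N' L Q' rlo R g t (1 + 1 / (D₀ : ℝ)) k κ i j / Nat.totient (Pa a d g * r)

/-- The model-error term of one `(r, l, m, n)`. [folklore] -/
def merrTerm (a : ℤ) (S Q' r l m n : ℕ) : ℝ :=
  merrConst a S * (σ 0 (a.natAbs * (l * m * n)) : ℝ) * totInvSum (S + 2 * Q') *
    ((Q' * r : ℝ) / (((l * m * n : ℕ) : ℝ) - a) + 1 / Q') / Nat.totient r

/-- `merrTerm ≥ 0` when `lmn > a`. [folklore] -/
theorem merrTerm_nonneg (a : ℤ) (S Q' r : ℕ) {l m n : ℕ} (h : a < ((l * m * n : ℕ) : ℤ)) :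
    0 ≤ merrTerm a S Q' r l m n := by
  unfold merrTerm
  have h1 := merrConst_nonneg a S
  have h2 := totInvSum_nonneg (S + 2 * Q')
  have h3 : (0 : ℝ) < ((l * m * n : ℕ) : ℝ) - a := by
    have : (a : ℝ) < ((l * m * n : ℕ) : ℝ) := by exact_mod_cast h
    linarith
  positivity

set_option maxHeartbeats 1600000 in
/-- **One switched piece** `(mlo, M'] × (nlo, N'] × [1, L] × (Q', 2Q'] × (rlo, R]` with
`(mlo+1)(nlo+1) > 4 |a| D₀`: `Δ*` of the piece is at most the sum over the Möbius divisors `d`, the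
`|a|`-parts `g`, the profiles `v` and the reduction terms `t` of `termBound`, plus the model error.
[cite: BombieriFriedlanderIwaniecActa1986, §13 p. 241–242, §14 p. 246] -/
theorem deltaStarSets_piece_le {a : ℤ} (ha : a ≠ 0) (z : ℝ) {mlo M' nlo N' L Q' rlo R S D₀ J : ℕ}
    (hQ' : 0 < Q') (hD₀ : 0 < D₀) (hmlo : mlo ≤ M') (hnlo : nlo ≤ N') (hrlo : rlo ≤ R)
    (hpiece : 4 * a.natAbs * D₀ < (mlo + 1) * (nlo + 1))
    (hJ : ((max (max M' N') (max R L) : ℕ) : ℝ) + 1 ≤ (1 + 1 / (D₀ : ℝ)) ^ J)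
    (hS : L * (M' + Amax a) * (N' + Amax a) + a.natAbs ≤ S) :
    deltaStarSets a z (Ioc mlo M') (Ioc nlo N') (Icc 1 L) (Ioc Q' (2 * Q')) (Ioc rlo R) ≤
      (∑ d ∈ a.natAbs.divisors, ∑ g ∈ (ThetaD a.natAbs d).divisors, ∑ v ∈ (Icc 1 L).image (profVec a),
        ((Tsel a d g (profFun a v)).map (termBound a z mlo M' nlo N' L Q' rlo R d g D₀ J v)).sum) +
      ∑ r ∈ Ioc rlo R, ∑ l ∈ Icc 1 L, ∑ m ∈ Ioc mlo M', ∑ n ∈ Ioc nlo N', merrTerm a S Q' r l m n := by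
  classical
  set β : ℝ := 1 + 1 / (D₀ : ℝ) with hβ
  have hβ1 : 1 ≤ β := le_add_of_nonneg_right (by positivity)
  set SM := Ioc mlo M' with hSMdef
  set SN := Ioc nlo N' with hSNdef
  have hSM : ∀ m ∈ SM, 0 < m := by intro m hm; rw [hSMdef, Finset.mem_Ioc] at hm; omega
  have hSN : ∀ n ∈ SN, 0 < n := by intro n hn; rw [hSNdef, Finset.mem_Ioc] at hn; omega
  have hA1 : 1 ≤ a.natAbs := Int.natAbs_pos.2 ha
  -- `a < lmn ≤ S + a` on the piece
  have hposlmn : ∀ l : ℕ, 1 ≤ l → ∀ m ∈ SM, ∀ n ∈ SN, a < ((l * m * n : ℕ) : ℤ) := by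
    intro l hl m hm n hn
    rw [hSMdef, Finset.mem_Ioc] at hm; rw [hSNdef, Finset.mem_Ioc] at hn
    have h1 : (mlo + 1) * (nlo + 1) ≤ l * m * n := by
      calc (mlo + 1) * (nlo + 1) = 1 * (mlo + 1) * (nlo + 1) := by ring
        _ ≤ l * m * n := Nat.mul_le_mul (Nat.mul_le_mul hl (by omega)) (by omega)
    have h2 : a.natAbs ≤ 4 * a.natAbs * D₀ := by nlinarith
    have h3 : (a : ℤ) ≤ a.natAbs := Int.le_natAbs
    have h4 : ((a.natAbs : ℕ) : ℤ) < ((l * m * n : ℕ) : ℤ) := by exact_mod_cast lt_of_le_of_lt h2 (hpiece.trans_le h1)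
    linarith
  have hA0 : 0 < Amax a := Finset.prod_pos fun p hp => pow_pos (prime_of_mem_psA (List.mem_toFinset.1 hp)).pos _
  have hSlmn : ∀ l ∈ Icc 1 L, ∀ m ∈ SM, ∀ n ∈ SN, ((l * m * n : ℕ) : ℤ) - a ≤ S := by
    intro l hl m hm n hn
    rw [Finset.mem_Icc] at hl; rw [hSMdef, Finset.mem_Ioc] at hm; rw [hSNdef, Finset.mem_Ioc] at hn
    have h1 : l * m * n ≤ L * (M' + Amax a) * (N' + Amax a) :=
      Nat.mul_le_mul (Nat.mul_le_mul hl.2 (by omega)) (by omega)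
    have h2 : ((l * m * n : ℕ) : ℤ) ≤ ((L * (M' + Amax a) * (N' + Amax a) : ℕ) : ℤ) := by exact_mod_cast h1
    have h3 : ((L * (M' + Amax a) * (N' + Amax a) : ℕ) : ℤ) + a.natAbs ≤ S := by exact_mod_cast hS
    have h4 : -(a : ℤ) ≤ a.natAbs := by have := Int.le_natAbs (a := -a); rwa [Int.natAbs_neg] at this
    linarith
  -- tops of the cells
  have hJR : bp rlo R β J = R := by
    apply bp_eq_top hrlo
    refine le_trans ?_ hJ
    have : (R : ℝ) ≤ ((max (max M' N') (max R L) : ℕ) : ℝ) := by exact_mod_cast le_max_of_le_right (le_max_left _ _)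
    linarith
  have hJL : bp 0 L β J = L := by
    apply bp_eq_top (Nat.zero_le L)
    refine le_trans ?_ hJ
    have : (L : ℝ) ≤ ((max (max M' N') (max R L) : ℕ) : ℝ) := by exact_mod_cast le_max_of_le_right (le_max_right _ _)
    linarith
  have hJM : ∀ t : ℤ × ℕ × ℕ, 0 < t.2.1 → bpM mlo M' t β J = M' / t.2.1 := by
    intro t hDm
    unfold bpM
    apply bp_eq_top (Nat.div_le_div_right hmlo)
    refine le_trans ?_ hJ
    have h1 : ((M' / t.2.1 : ℕ) : ℝ) ≤ M' := by exact_mod_cast Nat.div_le_self M' t.2.1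
    have h2 : (M' : ℝ) ≤ ((max (max M' N') (max R L) : ℕ) : ℝ) := by exact_mod_cast le_max_of_le_left (le_max_left _ _)
    linarith
  have hJN : ∀ t : ℤ × ℕ × ℕ, 0 < t.2.2 → bpN nlo N' t β J = N' / t.2.2 := by
    intro t hDn
    unfold bpN
    apply bp_eq_top (Nat.div_le_div_right hnlo)
    refine le_trans ?_ hJ
    have h1 : ((N' / t.2.2 : ℕ) : ℝ) ≤ N' := by exact_mod_cast Nat.div_le_self N' t.2.2
    have h2 : (N' : ℝ) ≤ ((max (max M' N') (max R L) : ℕ) : ℝ) := by exact_mod_cast le_max_of_le_left (le_max_right _ _)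
    linarith
  -- Step 1: each `(r, l)` term
  unfold deltaStarSets
  have hstep1 : ∀ r ∈ (Ioc rlo R).filter (fun r : ℕ => IsCoprime (r : ℤ) a),
      ∀ l ∈ (Icc 1 L).filter (fun l : ℕ => l.Coprime r),
      roughIndicator z l * |setQSum a z SM SN (Ioc Q' (2 * Q')) r l| ≤
        roughIndicator z l * (∑ d ∈ a.natAbs.divisors, ∑ g ∈ (ThetaD a.natAbs d).divisors,
          ((Tsel a d g (profOf a l)).map (fun t =>
            roughIndicator z t.2.1 * roughIndicator z t.2.2 * |Xred a z SM SN l r Q' S d g t|)).sum) +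
        ∑ m ∈ SM, ∑ n ∈ SN, merrTerm a S Q' r l m n := by
    intro r hr l hl
    rw [Finset.mem_filter, Finset.mem_Ioc] at hr
    rw [Finset.mem_filter, Finset.mem_Icc] at hl
    have hr0 : 0 < r := by omega
    have hl0 : 0 < l := by omega
    have hrA : r.Coprime a.natAbs := by
      have := Int.isCoprime_iff_gcd_eq_one.1 hr.2
      rwa [Int.gcd_eq_natAbs, Int.natAbs_natCast] at this
    have hmain := abs_setQSum_Ioc_le ha z hSM hSN hl0 hr0 hrA hl.2 hQ'
      (hposlmn l hl.1.1) (hSlmn l (Finset.mem_Icc.2 hl.1))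
    have hρ := roughIndicator_nonneg z l
    have hρ1 := roughIndicator_le_one' z l
    have herr0 : 0 ≤ ∑ m ∈ SM, ∑ n ∈ SN, merrTerm a S Q' r l m n :=
      Finset.sum_nonneg fun m hm => Finset.sum_nonneg fun n hn => merrTerm_nonneg a S Q' r (hposlmn l hl.1.1 m hm n hn)
    calc roughIndicator z l * |setQSum a z SM SN (Ioc Q' (2 * Q')) r l|
        ≤ roughIndicator z l * ((∑ d ∈ a.natAbs.divisors, ∑ g ∈ (ThetaD a.natAbs d).divisors,
          ((Tsel a d g (profOf a l)).map (fun t =>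
            roughIndicator z t.2.1 * roughIndicator z t.2.2 * |Xred a z SM SN l r Q' S d g t|)).sum) +
          ∑ m ∈ SM, ∑ n ∈ SN, merrTerm a S Q' r l m n) := by
          refine mul_le_mul_of_nonneg_left (hmain.trans (le_of_eq ?_)) hρ
          unfold merrTerm; rfl
      _ ≤ _ := by
          rw [mul_add]
          refine add_le_add le_rfl (mul_le_of_le_one_left herr0 hρ1)
  -- Step 2: sum; the error part
  have herr : ∑ r ∈ (Ioc rlo R).filter (fun r : ℕ => IsCoprime (r : ℤ) a),
      ∑ l ∈ (Icc 1 L).filter (fun l : ℕ => l.Coprime r), ∑ m ∈ SM, ∑ n ∈ SN, merrTerm a S Q' r l m n ≤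
      ∑ r ∈ Ioc rlo R, ∑ l ∈ Icc 1 L, ∑ m ∈ SM, ∑ n ∈ SN, merrTerm a S Q' r l m n := by
    have h0 : ∀ r, ∀ l ∈ Icc 1 L, 0 ≤ ∑ m ∈ SM, ∑ n ∈ SN, merrTerm a S Q' r l m n := fun r l hl =>
      Finset.sum_nonneg fun m hm => Finset.sum_nonneg fun n hn =>
        merrTerm_nonneg a S Q' r (hposlmn l (Finset.mem_Icc.1 hl).1 m hm n hn)
    refine (Finset.sum_le_sum_of_subset_of_nonneg (Finset.filter_subset _ _) fun r _ _ =>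
      Finset.sum_nonneg fun l hl => h0 r l (Finset.mem_filter.1 hl).1).trans ?_
    exact Finset.sum_le_sum fun r _ =>
      Finset.sum_le_sum_of_subset_of_nonneg (Finset.filter_subset _ _) fun l hl _ => h0 r l hl
  -- Step 3: the main part, regrouped by `(d, g, v, t)`
  have hmainpart : ∑ r ∈ (Ioc rlo R).filter (fun r : ℕ => IsCoprime (r : ℤ) a),
      ∑ l ∈ (Icc 1 L).filter (fun l : ℕ => l.Coprime r),
        roughIndicator z l * (∑ d ∈ a.natAbs.divisors, ∑ g ∈ (ThetaD a.natAbs d).divisors,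
          ((Tsel a d g (profOf a l)).map (fun t =>
            roughIndicator z t.2.1 * roughIndicator z t.2.2 * |Xred a z SM SN l r Q' S d g t|)).sum) ≤
      ∑ d ∈ a.natAbs.divisors, ∑ g ∈ (ThetaD a.natAbs d).divisors, ∑ v ∈ (Icc 1 L).image (profVec a),
        ((Tsel a d g (profFun a v)).map (termBound a z mlo M' nlo N' L Q' rlo R d g D₀ J v)).sum := by
    -- move `d, g` outside
    simp only [Finset.mul_sum]
    rw [Finset.sum_congr rfl fun r _ => Finset.sum_comm, Finset.sum_comm]
    refine Finset.sum_le_sum fun d hd => ?_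
    rw [Finset.sum_congr rfl fun r _ => Finset.sum_comm, Finset.sum_comm]
    refine Finset.sum_le_sum fun g hg => ?_
    have hdA : d ∣ a.natAbs := Nat.dvd_of_mem_divisors hd
    have hgΘ : g ∣ ThetaD a.natAbs d := Nat.dvd_of_mem_divisors hg
    -- group `l` by profile
    have hfib : ∀ r : ℕ, ∑ l ∈ (Icc 1 L).filter (fun l : ℕ => l.Coprime r),
        roughIndicator z l * ((Tsel a d g (profOf a l)).map (fun t =>
          roughIndicator z t.2.1 * roughIndicator z t.2.2 * |Xred a z SM SN l r Q' S d g t|)).sum =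
        ∑ v ∈ (Icc 1 L).image (profVec a), ∑ l ∈ (Icc 1 L).filter (fun l : ℕ => l.Coprime r ∧ profVec a l = v),
          ((Tsel a d g (profFun a v)).map (fun t =>
            roughIndicator z l * (roughIndicator z t.2.1 * roughIndicator z t.2.2) * |Xred a z SM SN l r Q' S d g t|)).sum := by
      intro r
      rw [← Finset.sum_fiberwise_of_maps_to (s := (Icc 1 L).filter (fun l : ℕ => l.Coprime r))
        (t := (Icc 1 L).image (profVec a)) (g := profVec a)
        (fun l hl => Finset.mem_image_of_mem _ (Finset.mem_filter.1 hl).1)]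
      refine Finset.sum_congr rfl fun v _ => ?_
      have hset : ((Icc 1 L).filter (fun l : ℕ => l.Coprime r)).filter (fun l => profVec a l = v) =
          (Icc 1 L).filter (fun l : ℕ => l.Coprime r ∧ profVec a l = v) := by
        rw [Finset.filter_filter]
      rw [hset]
      refine Finset.sum_congr rfl fun l hl => ?_
      have hlv : profVec a l = v := (Finset.mem_filter.1 hl).2.2
      have hprof : profOf a l = profFun a v := by rw [← hlv, profFun_profVec]
      rw [hprof]
      -- pull `ρ(l)` inside the list sum
      induction (Tsel a d g (profFun a v)) with
      | nil => simp
      | cons t T ih => simp only [List.map_cons, List.sum_cons, mul_add, ih]; ring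
    rw [Finset.sum_congr rfl fun r _ => hfib r, Finset.sum_comm]
    refine Finset.sum_le_sum fun v _ => ?_
    -- swap the list sum outside the `r, l` sums
    rw [Finset.sum_congr rfl fun r _ => sum_list_map_swap _ _ _, sum_list_map_swap]
    refine list_sum_map_le _ fun t ht => ?_
    -- the per-term bound
    obtain ⟨-, hterms, -⟩ := Tsel_spec ha hdA hgΘ (profFun a v)
    obtain ⟨-, hDm, hDn, -⟩ := hterms t ht
    have hposmn : a < (((mlo + 1) * (nlo + 1) : ℕ) : ℤ) := by
      have h2 : a.natAbs ≤ 4 * a.natAbs * D₀ := by nlinarith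
      have h3 : (a : ℤ) ≤ a.natAbs := Int.le_natAbs
      have h4 : ((a.natAbs : ℕ) : ℤ) < (((mlo + 1) * (nlo + 1) : ℕ) : ℤ) := by exact_mod_cast lt_of_le_of_lt h2 hpiece
      linarith
    have hSt : L * (M' + t.2.1) * (N' + t.2.2) + a.natAbs ≤ S := by
      obtain ⟨h1, h2⟩ := le_Amax_of_mem_Tsel ha hdA hgΘ _ ht
      exact le_trans (Nat.add_le_add_right (Nat.mul_le_mul (Nat.mul_le_mul_left _ (by omega)) (by omega)) _) hS
    have hW := sum_weight_abs_Xred_le ha z (mlo := mlo) (M' := M') (nlo := nlo) (N' := N') (L := L) (Q' := Q')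
      (rlo := rlo) (R := R) (S := S) hdA hgΘ v ht hQ' hβ1 hmlo hnlo (hJM t hDm) (hJN t hDn) hJR hJL hposmn hSt
    refine hW.trans ?_
    unfold termBound
    rw [add_assoc]
    refine add_le_add le_rfl ?_
    -- the ambiguous total: `A`-part and `B`-part
    rw [ambTotal_eq]
    refine add_le_add ?_ ?_
    · refine ambTotalA_le ha z hdA hgΘ v ht hQ' hβ1 (hJM t hDm) (hJN t hDn) hJR hJL hposmn (pow_pos hD₀ 5)
        (by positivity) fun k κ r hr l hl i j m hm n hn => ?_
      refine spread_of_cells ha hD₀ hr hl hm hn ?_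
      -- `4 |a| D₀ < (mlo+1)(nlo+1) ≤ P₋`
      refine lt_of_lt_of_le hpiece ?_
      have hm1 : mlo + 1 ≤ t.2.1 * (bpM mlo M' t β i + 1) := by
        have h1 : mlo / t.2.1 ≤ bpM mlo M' t β i := by unfold bpM; exact (bp_bounds _ _ _ _).1
        have h2 : mlo < t.2.1 * (mlo / t.2.1 + 1) := by
          have h := Nat.lt_div_mul_add (a := mlo) hDm
          have e : mlo / t.2.1 * t.2.1 + t.2.1 = t.2.1 * (mlo / t.2.1 + 1) := by ring
          rw [e] at h; exact h
        exact (Nat.succ_le_of_lt h2).trans (Nat.mul_le_mul_left _ (by omega))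
      have hn1 : nlo + 1 ≤ t.2.2 * (bpN nlo N' t β j + 1) := by
        have h1 : nlo / t.2.2 ≤ bpN nlo N' t β j := by unfold bpN; exact (bp_bounds _ _ _ _).1
        have h2 : nlo < t.2.2 * (nlo / t.2.2 + 1) := by
          have h := Nat.lt_div_mul_add (a := nlo) hDn
          have e : nlo / t.2.2 * t.2.2 + t.2.2 = t.2.2 * (nlo / t.2.2 + 1) := by ring
          rw [e] at h; exact h
        exact (Nat.succ_le_of_lt h2).trans (Nat.mul_le_mul_left _ (by omega))
      calc (mlo + 1) * (nlo + 1) ≤ (t.2.1 * (bpM mlo M' t β i + 1)) * (t.2.2 * (bpN nlo N' t β j + 1)) :=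
            Nat.mul_le_mul hm1 hn1
        _ = 1 * t.2.1 * t.2.2 * (bpM mlo M' t β i + 1) * (bpN nlo N' t β j + 1) := by ring
        _ ≤ (bp 0 L β κ + 1) * t.2.1 * t.2.2 * (bpM mlo M' t β i + 1) * (bpN nlo N' t β j + 1) := by
            gcongr; omega
    · exact ambTotalB_le ha z mlo M' nlo N' L t v β J
  -- Step 4: assemble
  calc ∑ r ∈ (Ioc rlo R).filter (fun r : ℕ => IsCoprime (r : ℤ) a),
        ∑ l ∈ (Icc 1 L).filter (fun l : ℕ => l.Coprime r), roughIndicator z l * |setQSum a z SM SN (Ioc Q' (2 * Q')) r l|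
      ≤ ∑ r ∈ (Ioc rlo R).filter (fun r : ℕ => IsCoprime (r : ℤ) a),
        ∑ l ∈ (Icc 1 L).filter (fun l : ℕ => l.Coprime r),
          (roughIndicator z l * (∑ d ∈ a.natAbs.divisors, ∑ g ∈ (ThetaD a.natAbs d).divisors,
            ((Tsel a d g (profOf a l)).map (fun t =>
              roughIndicator z t.2.1 * roughIndicator z t.2.2 * |Xred a z SM SN l r Q' S d g t|)).sum) +
          ∑ m ∈ SM, ∑ n ∈ SN, merrTerm a S Q' r l m n) :=
        Finset.sum_le_sum fun r hr => Finset.sum_le_sum fun l hl => hstep1 r hr l hl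
    _ ≤ _ := by
        simp only [Finset.sum_add_distrib]
        exact add_le_add hmainpart herr

end BFI

end Literature.NumberTheory.Sieve
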